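import Summits.QuantumFields.YangMills.Theses.BalabanUVNodes
import Literature.MathematicalPhysics.QuantumFieldTheory.Balaban1983to89.Node00.Record13SepCoPH
import Literature.MathematicalPhysics.QuantumFieldTheory.Balaban1983to89.T4CouplingMatching
import Literature.MathematicalPhysics.QuantumFieldTheory.Balaban1983to89.T4BetaStationary
import Literature.MathematicalPhysics.QuantumFieldTheory.Balaban1983to89.T4FlagMemory
import Literature.MathematicalPhysics.QuantumFieldTheory.Balaban1983to89.FlowStepRuns
import Summits.QuantumFields.YangMills.Theorems.BalabanUVNodesSpineRates
import Summits.QuantumFields.BalabanUV.T4Continuum.Spine.NE4.Targets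
import Summits.QuantumFields.BalabanUV.T4Continuum.Spine.NE4.AsymptoticContent
import Summits.QuantumFields.YangMills.Theorems.BalabanUVNodesK2NamedJetsRunRemAt  -- EDITION 3 (§8): DEF-1's letters `RemAt` (p593586) ∕ `RunRemAt` (p596574)
import Summits.QuantumFields.BalabanUV.Gaps.CapTailPinnedLimitSign  -- EDITION 4 (§9): g1-p3's HYPOTHESIS-FREE limit letters `tendsto_pinned` ∕ `d1Drift_pinned_iff_lim_eq` (gan24-p1's rate)

/-!
# Crux idea «corner-limit-sign» for K2⁷ = `EndpointGivenBR13SepCoPH` (stmt-QuantumFields-20543) — SKETCH (seat ym-nodeO-idea-7, GEN 2 + EDITION 2 GEN 3 + EDITION 3 GEN 4 + EDITION 4 GEN 5, lens: inversion)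

INVERSION, second pass (from the v3 skeleton of record `D80-K2V3/K2Skeleton13SepCoPHv3.lean`, LINE 2 = idea-7 g0's «shift-cauchy-everyslope»).
Run LINE 2's four stubs backwards once more and ask, for each, WHO ELSE in the route already pays it:

* S1 (remainder shift-rate) ⟸ K3⁷'s N17 (v2/v3, CRIT-2 C2) — already consolidated.
* S3 `ContRecord13` ⟸ K3⁷'s N22 ∧ (R) : `HistLipschitz Λ θ.γ (datum).βfun` (`Spine.NE4.Targets.u2Inputs_of_u3 … |>.2.1`), by the tree's
  `T4BetaStationary.betaContH_of_histLipschitz`.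
* S2 `D4AnchorRecord13` (per-scale anchor of the merged β to the v₀-RAY numbers `beta0OfMerged … θ.v₀ k`, `θ.v₀ = 0`): the SAME K3 letter gives, by a
  corner-Cauchy argument, the existence of the CORNER LIMITS `L_k := lim_{v → 0, v ∈ ]0,γ]^{k+1}} βfun k v` — and END never reads the off-box ray
  `(0,…,0,g)` at all.  Re-base the line on `L_k` instead of `β⁰_k(v₀)`: S2 becomes the DEFINITION of `L_k`; the v₀-ray object (CRIT-2 P2/F3, idea-4's
  data anomaly, idea-8 V5) disappears from the line.
* (D1)+S0 `D1AtRecord13Pos` (Residue pinned on jets numbers + positive `stepBal`): under N17 the corner limits converge geometrically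
  (`|L_{k+1} − L_k| ≤ c·ρ^k`: NE4 evaluated at the corner), so every AF-sign currency on this line collapses to ONE BIT: `0 < L_∞`.

RESULT (kernel-checked below, 0 sorry): `EndpointGivenBR13SepCoPH` ⟸ `N17AtRecord13` (v3 verbatim, K3-shared) ∧ `HistLipAtRecord13` (K3-shared content:
N22 ∧ (R)) ∧ `CornerSignRecord13` («whatever the corner limits of the record's β are, their k-limit is positive» — reference-free, jets-free, v₀-free,
Residue-free; size = row (D1)'s one-loop law READ AT THE CORNER + the AF sign).  I.e. **K2⁷ ⊆ (K3⁷'s β-letters on the datum) ∪ {one sign}**: in this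
route THE END carries no private analytic estimate.  §1 is generic real analysis over the tree's carriers (`HBeta`, `Box`, `ScaleShiftRate`,
`HistLipschitz`, `BetaPartialSumsLowerH`); §2 the three stub SHAPES at the record and the composition concluding the ROUTE DECL BY NAME; §3 the
«one bit» lemma (corner sign ⟺ eventual positivity on small boxes, under the two K3 letters) and two non-vacuity/independence toys.

EDITION 2 (GEN 3, 2026-08-28 — THE INVERSION CLOSED; insert-only: §1–§3 byte-identical to edition 1 `1126ef5ab277`, §4–§7 appended).  Run the LAST
dependency backwards: not «what implies END» but «what does END imply».  §4 the GUARDED stub shapes (CRIT-2 ROUND 2 J1: K3⁷'s letters exist only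
under `θ.ZhUnity ∧ θ.SlotsNondegenerate₁₃`) and the TWO-STUB line {`U3TripleAtRecord13G` = verbatim the right-hand side of the landed
`exists_u3Objects₁₁_readOut_n18_n22_datumOfRecord₁₃CoPH_iff` (dag-n17-w2), `CornerSignRecord13G`} concluding the crux BY NAME.  §5 the inversion's
OBJECT: node U2's continuum β-functional `T4BetaStationary.betaInf` (print's «one function β», [I] p.255) — under N17 the corner limits' limit `L_∞`
IS its value at the zero history, `betaInf β h → L_∞` as the history box shrinks (Moore–Osgood), so stub 3 ⟺ `FunctionalAF` («the continuum
functional is ≥ e > 0 near the zero history»), and `FunctionalAF ⟹` eventual positivity WITHOUT `HistLipschitz` (representation theorem).  §6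
NECESSITY: for ANY forward-generated construction, `EndpointExistence` FORCES `0 ≤ L_∞` (an eventually negative β on small boxes drives `1/g_K²` to
`+∞` uniformly in `g₀`); so on K3⁷'s letters K2⁷'s private content is EXACTLY the strictness `0 < L_∞` versus the forced `0 ≤ L_∞`, and ON the
boundary `L_∞ = 0` the letters decide nothing: two stationary toys with identical letters and `L_∞ = 0`, one with END (β ≡ 0 — CRIT-2's P3‴ witness
lives here) and one without (β_k = −g_k).  §7 the two typed SUPPLIER roads for stub 3 (CRIT-2 P2‴): (R-k) per-scale anchoring to θ-covariant named
numbers eventually ≥ e, (R-∞) ONE identification of the functional's corner value — no per-k statement at all.  0 sorry throughout.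

EDITION 3 (GEN 4, 2026-08-28 — v4's WALL LOCATED; insert-only: §1–§7 byte-identical to edition 2 `9788fc0d5f16`, one import + §8 appended).  Run plan g81's v4 stub 2′
`RemAtSomeJets` (DEF-1's letter ed.3 `RemAt F κ θ hP θ.cβ`: constant remainder ∀k with the cap + per-scale anchor + box (C); κ after θ, `θ.cβ` carried — №203 met) BACKWARDS
through K3⁷'s letters: N17 + the per-scale anchor manufacture the constant remainder at EVERY height (§1's telescoping), `HistLipschitz` manufactures (C) — so GIVEN
`U3TripleAtRecord13G`, 2′ ⟺ CRIT-2 2e §B's `AnchorSomeJets13` (the per-scale IDENTIFICATION alone, M per k, BN-F «NOT HIT»), and the run letter 2ᴮ″ (`RunRemAt`, p596574)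
follows too.  §8 types: the junction J2 re-proved; the locating `iff`; THE THREE-STUB LINE ON v4's OWN LETTERS {`U3TripleAtRecord13G`, `AnchorSomeJets13`, THE (D1) STUB in any
of its three spellings (v4's registered `D1AtShadowingJets`, DEF-1's anchor-keyed form = director-ym №23's «THE (D1) stub», CRIT-2's eventual sign)} concluding the crux BY
NAME; the Cesàro junction «(D1)'s drift ⟹ the corner sign» (the sign text is the weaker ask); BN-F placement (the line's only box-wide ∀k letters are K3⁷'s); and, for CRIT-2 2e
§B's flag, the every-slope telescoping + END re-typed for an ABSTRACT tail-closed family of history sets through DEF-1's run consumer (generic; naming the family is K3⁷'s call);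
and (8.7) ALL OF IT AT v5's KEYING — plan g82's skeleton OF RECORD `D82-K2V5/K2Skeleton13SepCoPHv5.lean` 16e2ea6200bb4554 REGISTERED 02:22:53Z (№204 T1 decision: every
stub on the crux's FULL prefix `guard → Admissible → (B) → Window13`): v5's 2′∕1′ texts verbatim, `U3TripleAtRecord13K`, `AnchorSomeJets13K`, `D1SignShadowingAnchor13K`,
`D1AtAnchoredJetsK`, the located `iff` and the three-stub compositions to the crux BY NAME, pointwise (CRIT-2's pre-registration ASK (iii), STATUS l.1618, texts supplied).

EDITION 4 (GEN 5, 2026-08-28 — v6's (D1) STUB LOCATED; insert-only: §1–§8 byte-identical to edition 3 `ac2684917169b959`, one import + §9 appended).  Plan g82's skeleton OF RECORD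
v6 `D82-K2V6/K2Skeleton13SepCoPHv6.lean` 5a75a2378c79b303 (REGISTERED 02:32:34Z) = {`stub_runRemNamedJets13` (XL) = 8.7's `RunRemAtSomeJetsV5`, `stub_d1AnchoredJets13` («L»,
«row (D1) at the named jets») = 8.7's `D1AtAnchoredJetsK`}.  Run stub 1 BACKWARDS: it must hold at every colour datum κ that NAMES an admissible record; and the TREE decides
the drift at each κ HYPOTHESIS-FREE — `beta0OfJs F κ` converges for EVERY κ (gan24-p1 ∕ g1-p3's `CapTailPinnedLimitSign.tendsto_pinned`) and «(D1) at κ» ⟺ `limOfJs F κ =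
stepBal 2 F.L` (`d1Drift_pinned_iff_lim_eq`; g1-p1's closed form).  §9 types (0 sorry): stub 1 ⟺ `UVNamable13K` («every κ naming an admissible record lies on the drift
variety») — a statement about WHICH colour data name def-T's records, implied by (and on namable records equivalent to) the jets-free UNIVERSAL CORNER VALUE statement, its
only record-free sufficient condition being colour-blindness of the one-loop limit (undecided, unexpected); by anchor uniqueness v6's PAIR ⟺ ONE ∃κ statement
`RunRemAtDriftingJets13K` concluding the crux BY NAME (LINE 1″, one private stub; the pinned (R-a) keying is its special case and the only place a θ-free (D1) stub lives —
there it is ONE real-number identity per `L`); THE END accepts any positive slope, so the corner road's LINE 2″ is {`U3TripleAtRecord13K`, `AnchorPositiveJets13K`} («some κ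
with POSITIVE one-loop limit names the record»; ⟺ `AnchorSomeJets13K ∧` edition 1's sign bit) concluding the crux BY NAME with the eventual floor supplied by the tree;
SELF-CORRECTION: editions 2∕3's `D1SignShadowingAnchor13(K)` is record-side in the same way (⟺ `PositivelyNamable13K`), superseded by LINE 2″'s ∃κ-internal sign conjunct.

HONEST FRAMING.  Hypothesis SHAPES and kernel junctions only; nothing of Bałaban's β is asserted; instance 0∕1 on every stub; the Clay YM mass gap is
NOT proved by any of this — R4/`BalabanUVNodes` closes only the conditional finite-𝕋⁴ rung `BalabanLadder.UV`, and this file re-cuts ONE crux of it.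
-/

noncomputable section

namespace Summit.QuantumFields.YangMills.Cruxes.EndpointGivenBR13SepCoPH.CornerLimitSign

open Filter Topology Finset
open Literature.MathematicalPhysics.QuantumFieldTheory.Balaban1983to89
open Literature.MathematicalPhysics.QuantumFieldTheory.Balaban1983to89.FlowStep
open Literature.MathematicalPhysics.QuantumFieldTheory.Balaban1983to89.FlowStepRuns (BetaPartialSumsLowerH endpointExistence_of_partialSums)
open Literature.MathematicalPhysics.QuantumFieldTheory.Balaban1983to89.DagBinding (EndpointExistence ForwardGenerated)
open Literature.MathematicalPhysics.QuantumFieldTheory.Balaban1983to89.T4CouplingMatching (ScaleShiftRate HistLipschitz)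
open Literature.MathematicalPhysics.QuantumFieldTheory.Balaban1983to89.T4FlagMemory (tail_mem_box)
open Literature.MathematicalPhysics.QuantumFieldTheory.Balaban1983to89.T4Continuum (T4Family)
open YMDAG.UVSplit (U3Carriers N17At)

/-! ## §1 Generic: corner limits from history-Lipschitz moduli; their geometric convergence from NE4; every-slope; END from one sign -/

/-- CORNER ANCHOR of `β` to a reference sequence `b` on the window `γ`: at each scale `k`, `β k v → b k` as `v → 0` inside the open boxes
(`∀ ε>0 ∃ δ ∈ ]0,γ], |β k v − b k| ≤ ε` on `]0,δ]^{k+1}`).  With `b := beta0OfMerged …` this is v3's `AnchorVanishing` of the definitional split;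
here `b` is FREE (it will be ∃-produced from `HistLipschitz`).  A hypothesis SHAPE. [folklore] -/
def CornerAnchor (b : ℕ → ℝ) (γ : ℝ) (β : HBeta) : Prop :=
  ∀ k : ℕ, ∀ ε : ℝ, 0 < ε → ∃ δ : ℝ, 0 < δ ∧ δ ≤ γ ∧ ∀ v ∈ Box δ k, |β k v - b k| ≤ ε

/-- sup-form of the history-Lipschitz bound on a sub-box `]0,δ]^{k+1}`, `δ ≤ γ`. [folklore] -/
theorem histLipschitz_sup {Λ : ℕ → ℕ → ℝ} {γ : ℝ} {β : HBeta} (hL : HistLipschitz Λ γ β) (k : ℕ) {δ : ℝ} (hδ : δ ≤ γ)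
    (p q : Fin (k + 1) → ℝ) (hp : p ∈ Box δ k) (hq : q ∈ Box δ k) :
    |β k p - β k q| ≤ (∑ i : Fin (k + 1), |Λ k i|) * δ := by
  refine (hL k p q (box_mono hδ k hp) (box_mono hδ k hq)).trans ?_
  rw [Finset.sum_mul]
  refine Finset.sum_le_sum fun i _ => ?_
  have h1 : |p i - q i| ≤ δ := by
    have hp' := (mem_box.mp hp) i
    have hq' := (mem_box.mp hq) i
    rw [abs_sub_le_iff]; constructor <;> linarith
  calc Λ k i * |p i - q i| ≤ |Λ k i| * |p i - q i| := mul_le_mul_of_nonneg_right (le_abs_self _) (abs_nonneg _)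
    _ ≤ |Λ k i| * δ := mul_le_mul_of_nonneg_left h1 (abs_nonneg _)

/-- **CORNER CAUCHY: history-Lipschitz moduli on the open boxes ⟹ the corner limits exist** (`ℝ` complete; the constant histories
`(γ2^{-n-1},…)` are Cauchy under the moduli and every small box is within `S_k·δ` of them).  This is what S2 («anchor») becomes once the reference numbers are
the corner limits themselves rather than the v₀-ray limits. [folklore] -/
theorem cornerAnchor_of_histLipschitz {Λ : ℕ → ℕ → ℝ} {γ : ℝ} {β : HBeta} (hγ : 0 < γ) (hL : HistLipschitz Λ γ β) :
    ∃ b : ℕ → ℝ, CornerAnchor b γ β := by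
  have key : ∀ k : ℕ, ∃ L : ℝ, ∀ ε : ℝ, 0 < ε → ∃ δ : ℝ, 0 < δ ∧ δ ≤ γ ∧ ∀ v ∈ Box δ k, |β k v - L| ≤ ε := by
    intro k
    set S : ℝ := ∑ i : Fin (k + 1), |Λ k i| with hS
    have hS0 : 0 ≤ S := Finset.sum_nonneg fun i _ => abs_nonneg _
    let c : ℕ → ℝ := fun n => γ * (1 / 2) ^ (n + 1)
    have hc0 : ∀ n, 0 < c n := fun n => by positivity
    have hcmono : ∀ n m, n ≤ m → c m ≤ c n := fun n m hnm =>
      mul_le_mul_of_nonneg_left (pow_le_pow_of_le_one (by norm_num) (by norm_num) (by omega)) hγ.le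
    have hcγ : ∀ n, c n ≤ γ := fun n => by
      have : (1 / 2 : ℝ) ^ (n + 1) ≤ 1 := pow_le_one₀ (by norm_num) (by norm_num)
      calc c n = γ * (1 / 2) ^ (n + 1) := rfl
        _ ≤ γ * 1 := mul_le_mul_of_nonneg_left this hγ.le
        _ = γ := mul_one γ
    have hcmem : ∀ n m, n ≤ m → (fun _ : Fin (k + 1) => c m) ∈ Box (c n) k := fun n m hnm =>
      mem_box.mpr fun _ => ⟨hc0 m, hcmono n m hnm⟩
    let u : ℕ → ℝ := fun n => β k (fun _ => c n)
    have hstep : ∀ n, dist (u n) (u (n + 1)) ≤ S * γ * (1 / 2) ^ n := by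
      intro n
      rw [Real.dist_eq]
      have h := histLipschitz_sup hL k (hcγ n) (fun _ => c n) (fun _ => c (n + 1)) (hcmem n n le_rfl) (hcmem n (n + 1) (Nat.le_succ n))
      calc |u n - u (n + 1)| ≤ S * c n := h
        _ = S * γ * (1 / 2) ^ n * (1 / 2) := by simp only [c, pow_succ]; ring
        _ ≤ S * γ * (1 / 2) ^ n * 1 := by gcongr; norm_num
        _ = S * γ * (1 / 2) ^ n := mul_one _
    obtain ⟨L, hlim⟩ := cauchySeq_tendsto_of_complete (cauchySeq_of_le_geometric (1 / 2) (S * γ) (by norm_num) hstep)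
    refine ⟨L, fun ε hε => ?_⟩
    have hev1 : ∀ᶠ n in atTop, |u n - L| ≤ ε / 2 := by
      obtain ⟨N, hN⟩ := (Metric.tendsto_atTop.mp hlim) (ε / 2) (half_pos hε)
      exact Filter.eventually_atTop.mpr ⟨N, fun n hn => by have h := hN n hn; rw [Real.dist_eq] at h; exact h.le⟩
    have hev2 : ∀ᶠ n in atTop, S * c n ≤ ε / 2 := by
      have ht : Tendsto (fun n => S * (γ * (1 / 2 : ℝ) ^ (n + 1))) atTop (𝓝 (S * (γ * 0))) :=
        tendsto_const_nhds.mul (tendsto_const_nhds.mul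
          ((tendsto_pow_atTop_nhds_zero_of_lt_one (by norm_num) (by norm_num)).comp (tendsto_add_atTop_nat 1)))
      rw [mul_zero, mul_zero] at ht
      exact (ht.eventually (Iio_mem_nhds (half_pos hε))).mono fun n hn => le_of_lt hn
    obtain ⟨n, hn1, hn2⟩ := (hev1.and hev2).exists
    refine ⟨c n, hc0 n, hcγ n, fun v hv => ?_⟩
    have h1 : |β k v - u n| ≤ S * c n := histLipschitz_sup hL k (hcγ n) v (fun _ => c n) hv (hcmem n n le_rfl)
    calc |β k v - L| = |(β k v - u n) + (u n - L)| := by congr 1; ring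
      _ ≤ |β k v - u n| + |u n - L| := abs_add_le _ _
      _ ≤ S * c n + ε / 2 := add_le_add h1 hn1
      _ ≤ ε := by linarith
  choose b hb using key
  exact ⟨b, fun k => hb k⟩


/-- ANY TWO CORNER-ANCHORING SEQUENCES COINCIDE (so under stub 2 the «stationary corner coefficient» of stub 3 is ONE well-defined number). [folklore] -/
theorem cornerAnchor_unique {β : HBeta} {b b' : ℕ → ℝ} {γ : ℝ} (hb : CornerAnchor b γ β) (hb' : CornerAnchor b' γ β) : b = b' := by
  funext k
  refine eq_of_forall_dist_le fun ε hε => ?_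
  obtain ⟨δ, hδ, -, h⟩ := hb k (ε / 2) (half_pos hε)
  obtain ⟨δ', hδ', -, h'⟩ := hb' k (ε / 2) (half_pos hε)
  let v : Fin (k + 1) → ℝ := fun _ => min δ δ'
  have hv : v ∈ Box δ k := mem_box.mpr fun _ => ⟨lt_min hδ hδ', min_le_left _ _⟩
  have hv' : v ∈ Box δ' k := mem_box.mpr fun _ => ⟨lt_min hδ hδ', min_le_right _ _⟩
  have h1 := h v hv
  have h2 := h' v hv'
  rw [Real.dist_eq]
  calc |b k - b' k| = |(β k v - b' k) - (β k v - b k)| := by congr 1; ring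
    _ ≤ |β k v - b' k| + |β k v - b k| := abs_sub _ _
    _ ≤ ε / 2 + ε / 2 := add_le_add h2 h1
    _ = ε := by ring

/-- WHAT v3's S2 SAYS IN THIS LANGUAGE: a one-loop split whose remainder vanishes at the corner scale by scale (v3 `AnchorVanishing`, text inlined) makes its
one-loop numbers `S.β0` a corner-anchoring sequence — so under stub 2, by `cornerAnchor_unique`, S2 ⟺ «the v₀-ray numbers `beta0OfMerged … θ.v₀` ARE the corner
limits» (CRIT-2's face letter F3), a statement this line never needs. [folklore] -/
theorem cornerAnchor_of_anchorVanishing {β : HBeta} (S : B12Beta.OneLoopSplit β) {γ : ℝ} (hγ : 0 < γ)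
    (hA : ∀ k : ℕ, ∀ δ : ℝ, 0 < δ → ∃ γ' : ℝ, 0 < γ' ∧ ∀ v ∈ Box γ' k, |S.β1 k v| ≤ δ) : CornerAnchor S.β0 γ β := by
  intro k ε hε
  obtain ⟨γ', hγ', h⟩ := hA k ε hε
  refine ⟨min γ' γ, lt_min hγ' hγ, min_le_right _ _, fun v hv => ?_⟩
  have e : β k v - S.β0 k = S.β1 k v := by rw [S.split k v]; ring
  rw [e]
  exact h v (box_mono (min_le_left _ _) k hv)

/-- CORNER STEP: NE4 (`ScaleShiftRate c θ γ β`) evaluated at the corner bounds the step of the corner limits, `|b_{k+1} − b_k| ≤ c·θ^k`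
(constant history `(t,…,t)` below `γ` and below both anchor radii; = v3's `abs_beta0_step_le_of_scaleShiftRate_anchor` with the reference free). [folklore] -/
theorem abs_step_le_of_scaleShiftRate_cornerAnchor {β : HBeta} {b : ℕ → ℝ} {c θ γ : ℝ} (hγ : 0 < γ)
    (hb : CornerAnchor b γ β) (h : ScaleShiftRate c θ γ β) (k : ℕ) : |b (k + 1) - b k| ≤ c * θ ^ k := by
  refine le_of_forall_pos_le_add fun ε hε => ?_
  obtain ⟨γ₁, hγ₁, -, hA₁⟩ := hb (k + 1) (ε / 2) (half_pos hε)
  obtain ⟨γ₀, hγ₀, -, hA₀⟩ := hb k (ε / 2) (half_pos hε)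
  set t : ℝ := min γ (min γ₁ γ₀) with ht
  have ht0 : 0 < t := lt_min hγ (lt_min hγ₁ hγ₀)
  have htγ : t ≤ γ := min_le_left _ _
  have htγ₁ : t ≤ γ₁ := (min_le_right _ _).trans (min_le_left _ _)
  have htγ₀ : t ≤ γ₀ := (min_le_right _ _).trans (min_le_right _ _)
  let w : Fin (k + 2) → ℝ := fun _ => t
  have hw : w ∈ Box γ (k + 1) := mem_box.mpr fun _ => ⟨ht0, htγ⟩
  have hw₁ : w ∈ Box γ₁ (k + 1) := mem_box.mpr fun _ => ⟨ht0, htγ₁⟩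
  have hw₀ : Fin.tail w ∈ Box γ₀ k := mem_box.mpr fun _ => ⟨ht0, htγ₀⟩
  have h1 : |β (k + 1) w - β k (Fin.tail w)| ≤ c * θ ^ k := h k w hw
  have h2 : |β (k + 1) w - b (k + 1)| ≤ ε / 2 := hA₁ w hw₁
  have h3 : |β k (Fin.tail w) - b k| ≤ ε / 2 := hA₀ (Fin.tail w) hw₀
  have e : b (k + 1) - b k = ((β (k + 1) w - β k (Fin.tail w)) - (β (k + 1) w - b (k + 1))) + (β k (Fin.tail w) - b k) := by ring
  rw [e]
  calc |((β (k + 1) w - β k (Fin.tail w)) - (β (k + 1) w - b (k + 1))) + (β k (Fin.tail w) - b k)|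
      ≤ |(β (k + 1) w - β k (Fin.tail w)) - (β (k + 1) w - b (k + 1))| + |β k (Fin.tail w) - b k| := abs_add_le _ _
    _ ≤ (|β (k + 1) w - β k (Fin.tail w)| + |β (k + 1) w - b (k + 1)|) + |β k (Fin.tail w) - b k| :=
        add_le_add (abs_sub _ _) le_rfl
    _ ≤ (c * θ ^ k + ε / 2) + ε / 2 := add_le_add (add_le_add h1 h2) h3
    _ = c * θ ^ k + ε := by ring

/-- NE4 + corner anchor ⟹ the corner limits converge geometrically to some `b_∞` (AF-0r shape for the CORNER numbers; geometric Cauchy). [folklore] -/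
theorem conv_of_scaleShiftRate_cornerAnchor {β : HBeta} {b : ℕ → ℝ} {c θ γ : ℝ} (hγ : 0 < γ) (hθ1 : θ < 1)
    (hb : CornerAnchor b γ β) (h : ScaleShiftRate c θ γ β) :
    ∃ binf : ℝ, Tendsto b atTop (𝓝 binf) ∧ ∀ k, |b k - binf| ≤ c / (1 - θ) * θ ^ k := by
  have hstep : ∀ n, dist (b n) (b (n + 1)) ≤ c * θ ^ n := fun n => by
    rw [Real.dist_eq, abs_sub_comm]
    exact abs_step_le_of_scaleShiftRate_cornerAnchor hγ hb h n
  obtain ⟨binf, hlim⟩ := cauchySeq_tendsto_of_complete (cauchySeq_of_le_geometric θ c hθ1 hstep)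
  refine ⟨binf, hlim, fun k => ?_⟩
  have hk := dist_le_of_le_geometric_of_tendsto θ c hθ1 hstep hlim k
  rw [Real.dist_eq] at hk
  calc |b k - binf| ≤ c * θ ^ k / (1 - θ) := hk
    _ = c / (1 - θ) * θ ^ k := by ring

/-- finitely many scales at once (min of finitely many radii). [folklore] -/
theorem cornerAnchor_upTo {β : HBeta} {b : ℕ → ℝ} {γ : ℝ} (hb : CornerAnchor b γ β) (k₀ : ℕ) {ε : ℝ} (hε : 0 < ε) :
    ∃ δ : ℝ, 0 < δ ∧ δ ≤ γ ∧ ∀ k, k ≤ k₀ → ∀ v ∈ Box δ k, |β k v - b k| ≤ ε := by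
  induction k₀ with
  | zero =>
    obtain ⟨δ, hδ, hδγ, h⟩ := hb 0 ε hε
    refine ⟨δ, hδ, hδγ, fun k hk v hv => ?_⟩
    obtain rfl := Nat.le_zero.mp hk
    exact h v hv
  | succ n ih =>
    obtain ⟨δ, hδ, hδγ, h⟩ := ih
    obtain ⟨δ', hδ', -, h'⟩ := hb (n + 1) ε hε
    refine ⟨min δ δ', lt_min hδ hδ', (min_le_left _ _).trans hδγ, fun k hk v hv => ?_⟩
    rcases Nat.lt_or_ge k (n + 1) with hlt | hge
    · exact h k (Nat.lt_succ_iff.mp hlt) v (box_mono (min_le_left _ _) k hv)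
    · obtain rfl := le_antisymm hk hge
      exact h' v (box_mono (min_le_right _ _) _ hv)

/-- TELESCOPING of the re-based remainder `R_k(v) := β k v − b k` along the ladder: its scale shift is `≤ 2c·θ^k` (NE4 + the corner step), so from a
bound `e` at depth `k₀` on `]0,δ]^{k₀+1}` (`δ ≤ γ`), `|R_{k₀+m}| ≤ e + Σ_{j<m} 2c θ^{k₀+j}` on `]0,δ]^{k₀+m+1}`. [folklore] -/
theorem rebased_iterate {β : HBeta} {b : ℕ → ℝ} {c θ γ δ : ℝ} (hγ : 0 < γ) (hb : CornerAnchor b γ β) (h : ScaleShiftRate c θ γ β)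
    (hδ : δ ≤ γ) (k₀ : ℕ) {e : ℝ} (hbase : ∀ v ∈ Box δ k₀, |β k₀ v - b k₀| ≤ e) :
    ∀ m : ℕ, ∀ v ∈ Box δ (k₀ + m), |β (k₀ + m) v - b (k₀ + m)| ≤ e + ∑ j ∈ range m, 2 * c * θ ^ (k₀ + j) := by
  intro m
  induction m with
  | zero => intro v hv; simpa using hbase v hv
  | succ m ih =>
    intro v hv
    have hv₁ : v ∈ Box γ (k₀ + m + 1) := box_mono hδ _ hv
    have hs : |β (k₀ + m + 1) v - β (k₀ + m) (Fin.tail v)| ≤ c * θ ^ (k₀ + m) := h (k₀ + m) v hv₁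
    have hbs : |b (k₀ + m + 1) - b (k₀ + m)| ≤ c * θ ^ (k₀ + m) := abs_step_le_of_scaleShiftRate_cornerAnchor hγ hb h (k₀ + m)
    have ht : |β (k₀ + m) (Fin.tail v) - b (k₀ + m)| ≤ e + ∑ j ∈ range m, 2 * c * θ ^ (k₀ + j) := ih (Fin.tail v) (tail_mem_box hv)
    have eq : β (k₀ + m + 1) v - b (k₀ + m + 1)
        = (β (k₀ + m + 1) v - β (k₀ + m) (Fin.tail v)) - (b (k₀ + m + 1) - b (k₀ + m)) + (β (k₀ + m) (Fin.tail v) - b (k₀ + m)) := by ring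
    show |β (k₀ + m + 1) v - b (k₀ + m + 1)| ≤ e + ∑ j ∈ range (m + 1), 2 * c * θ ^ (k₀ + j)
    rw [Finset.sum_range_succ, eq]
    calc |(β (k₀ + m + 1) v - β (k₀ + m) (Fin.tail v)) - (b (k₀ + m + 1) - b (k₀ + m)) + (β (k₀ + m) (Fin.tail v) - b (k₀ + m))|
        ≤ |(β (k₀ + m + 1) v - β (k₀ + m) (Fin.tail v)) - (b (k₀ + m + 1) - b (k₀ + m))| + |β (k₀ + m) (Fin.tail v) - b (k₀ + m)| :=
          abs_add_le _ _
      _ ≤ (|β (k₀ + m + 1) v - β (k₀ + m) (Fin.tail v)| + |b (k₀ + m + 1) - b (k₀ + m)|) + |β (k₀ + m) (Fin.tail v) - b (k₀ + m)| :=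
          add_le_add (abs_sub _ _) le_rfl
      _ ≤ (c * θ ^ (k₀ + m) + c * θ ^ (k₀ + m)) + (e + ∑ j ∈ range m, 2 * c * θ ^ (k₀ + j)) := add_le_add (add_le_add hs hbs) ht
      _ = e + (∑ j ∈ range m, 2 * c * θ ^ (k₀ + j) + 2 * c * θ ^ (k₀ + m)) := by ring

/-- geometric tail. [folklore] -/
theorem geom_tail_le {θ : ℝ} (hθ0 : 0 ≤ θ) (hθ1 : θ < 1) (m : ℕ) : ∑ j ∈ range m, θ ^ j ≤ (1 - θ)⁻¹ := by
  have h1 : 0 < 1 - θ := by linarith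
  rw [geom_sum_eq hθ1.ne m]
  have : (θ ^ m - 1) / (θ - 1) = (1 - θ ^ m) / (1 - θ) := by
    rw [show θ - 1 = -(1 - θ) by ring, show θ ^ m - 1 = -(1 - θ ^ m) by ring, neg_div_neg_eq]
  rw [this, inv_eq_one_div]
  have hp : 0 ≤ θ ^ m := pow_nonneg hθ0 m
  gcongr
  linarith

/-- **EVERY-SLOPE FOR THE RE-BASED REMAINDER (the g0 lever, reference free):** NE4 + corner anchor ⟹ for every `s > 0` a box `]0,γ_s]`, `γ_s ≤ γ`, on
which `|β k v − b k| ≤ s` at EVERY scale — tail `k > k₀` by telescoping (`2cθ^{k₀}/(1−θ) ≤ s/2`), head `k ≤ k₀` by the finitely many anchors. [folklore] -/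
theorem rebased_everySlope {β : HBeta} {b : ℕ → ℝ} {c θ γ : ℝ} (hγ : 0 < γ) (hθ0 : 0 ≤ θ) (hθ1 : θ < 1)
    (hb : CornerAnchor b γ β) (h : ScaleShiftRate c θ γ β) {s : ℝ} (hs : 0 < s) :
    ∃ γs : ℝ, 0 < γs ∧ γs ≤ γ ∧ ∀ k, ∀ v ∈ Box γs k, |β k v - b k| ≤ s := by
  have hc : 0 ≤ c := Summit.QuantumFields.BalabanUV.T4Continuum.Spine.NE4.scaleShiftRate_const_nonneg h hγ
  have h1 : 0 < 1 - θ := by linarith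
  set ε : ℝ := s / 2 * (1 - θ) / (2 * c + 1) with hε
  have hεpos : 0 < ε := by positivity
  obtain ⟨k₀, hk₀⟩ := exists_pow_lt_of_lt_one hεpos hθ1
  obtain ⟨δ, hδ, hδγ, ha⟩ := cornerAnchor_upTo hb k₀ (half_pos hs)
  refine ⟨δ, hδ, hδγ, fun k v hv => ?_⟩
  rcases Nat.lt_or_ge k₀ k with hk | hk
  · obtain ⟨m, rfl⟩ := Nat.exists_eq_add_of_le hk.le
    have hiter := rebased_iterate hγ hb h hδγ k₀ (fun v hv => ha k₀ le_rfl v hv) m v hv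
    have htail : ∑ j ∈ range m, 2 * c * θ ^ (k₀ + j) ≤ s / 2 := by
      have hsum : ∑ j ∈ range m, 2 * c * θ ^ (k₀ + j) = 2 * c * θ ^ k₀ * ∑ j ∈ range m, θ ^ j := by
        rw [Finset.mul_sum]
        refine Finset.sum_congr rfl fun j _ => ?_
        rw [pow_add]; ring
      rw [hsum]
      have hpk : 0 ≤ θ ^ k₀ := pow_nonneg hθ0 k₀
      calc 2 * c * θ ^ k₀ * ∑ j ∈ range m, θ ^ j
          ≤ 2 * c * θ ^ k₀ * (1 - θ)⁻¹ :=
            mul_le_mul_of_nonneg_left (geom_tail_le hθ0 hθ1 m) (mul_nonneg (by positivity) hpk)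
        _ ≤ (2 * c + 1) * ε * (1 - θ)⁻¹ := by
            apply mul_le_mul_of_nonneg_right _ (inv_nonneg.mpr h1.le)
            calc 2 * c * θ ^ k₀ ≤ (2 * c + 1) * θ ^ k₀ := by nlinarith
              _ ≤ (2 * c + 1) * ε := mul_le_mul_of_nonneg_left hk₀.le (by linarith)
        _ = s / 2 := by rw [hε]; field_simp
    linarith
  · exact (ha k hk v hv).trans (half_le_self hs.le)

/-- **PARTIAL SUMS + UPPER BOUND FROM THE SIGN OF THE STATIONARY CORNER COEFFICIENT.**  If the corner limits tend to `b_∞ > 0` at the geometric rate and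
the re-based remainder is `≤ b_∞/3` on `]0,γ_s]` at every scale, then `β_k(v) ≥ 2b_∞/3 − C θ^k` there, so the partial sums along any `]0,γ_s]`-history are
`≥ −C/(1−θ)` ((A-ps) with `M := C/(1−θ)`) and `β ≤ b_∞ + C + b_∞/3` ((A-hi)). [folklore] -/
theorem partialSums_upper_of_cornerSign {β : HBeta} {b : ℕ → ℝ} {C θ γs binf : ℝ} (hθ0 : 0 ≤ θ) (hθ1 : θ < 1) (hC : 0 ≤ C)
    (hpos : 0 < binf) (hrate : ∀ k, |b k - binf| ≤ C * θ ^ k) (hrem : ∀ k, ∀ v ∈ Box γs k, |β k v - b k| ≤ binf / 3) :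
    BetaPartialSumsLowerH (C * (1 - θ)⁻¹) γs β ∧ BetaUpperH (binf + C + binf / 3) γs β := by
  have hlow : ∀ k, ∀ v ∈ Box γs k, -(C * θ ^ k) ≤ β k v := by
    intro k v hv
    have h1 := (abs_sub_le_iff.mp (hrem k v hv)).2
    have h2 := (abs_sub_le_iff.mp (hrate k)).2
    linarith
  have hup : ∀ k, ∀ v ∈ Box γs k, β k v ≤ binf + C + binf / 3 := by
    intro k v hv
    have h1 := (abs_sub_le_iff.mp (hrem k v hv)).1
    have h2 := (abs_sub_le_iff.mp (hrate k)).1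
    have h3 : C * θ ^ k ≤ C := by
      have : θ ^ k ≤ 1 := pow_le_one₀ hθ0 hθ1.le
      nlinarith
    linarith
  refine ⟨?_, fun k v hv => hup k v hv⟩
  intro g hg k n hkn
  have hmem : ∀ j, prefixOf g j ∈ Box γs j := fun j => mem_box.mpr fun i => hg i
  have hsum : ∑ j ∈ Finset.Ico k n, -(C * θ ^ j) ≤ ∑ j ∈ Finset.Ico k n, β j (prefixOf g j) :=
    Finset.sum_le_sum fun j _ => hlow j _ (hmem j)
  have hgeo : ∑ j ∈ Finset.Ico k n, C * θ ^ j ≤ C * (1 - θ)⁻¹ := by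
    calc ∑ j ∈ Finset.Ico k n, C * θ ^ j ≤ ∑ j ∈ range n, C * θ ^ j := by
          refine Finset.sum_le_sum_of_subset_of_nonneg ?_ fun j _ _ => by positivity
          rw [Finset.range_eq_Ico]
          exact Finset.Ico_subset_Ico (Nat.zero_le k) le_rfl
      _ = C * ∑ j ∈ range n, θ ^ j := by rw [Finset.mul_sum]
      _ ≤ C * (1 - θ)⁻¹ := mul_le_mul_of_nonneg_left (geom_tail_le hθ0 hθ1 n) hC
  have hneg : ∑ j ∈ Finset.Ico k n, -(C * θ ^ j) = -∑ j ∈ Finset.Ico k n, C * θ ^ j := Finset.sum_neg_distrib ..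
  linarith

/-- **END FROM THE TWO K3 LETTERS AND ONE SIGN (abstract construction level).**  `HistLipschitz` (N22+(R)) gives the corner limits `b` and the box
continuity (`T4BetaStationary.betaContH_of_histLipschitz`, tree); NE4 gives their geometric convergence to `b_∞`; the SIGN `0 < b_∞` — asked of EVERY
corner-anchored sequence, so that no limit object is constructed in the statement — gives (A-ps)+(A-hi) on a small box; `FlowStepRuns.endpointExistence_of_partialSums`
BY NAME concludes.  No split, no `beta0OfMerged`, no jets, no Residue, no slope. [folklore] -/
theorem endpointExistence_of_cornerSign {Cn : B12.Construction} {β : HBeta} (hgen : ForwardGenerated Cn β) {Λ : ℕ → ℕ → ℝ} {c θ γ : ℝ}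
    (hγ : 0 < γ) (hθ0 : 0 ≤ θ) (hθ1 : θ < 1) (hL : HistLipschitz Λ γ β) (h : ScaleShiftRate c θ γ β)
    (hsign : ∀ b : ℕ → ℝ, CornerAnchor b γ β → ∀ binf : ℝ, Tendsto b atTop (𝓝 binf) → 0 < binf) : EndpointExistence Cn := by
  obtain ⟨b, hb⟩ := cornerAnchor_of_histLipschitz hγ hL
  obtain ⟨binf, hlim, hrate⟩ := conv_of_scaleShiftRate_cornerAnchor hγ hθ1 hb h
  have hpos : 0 < binf := hsign b hb binf hlim
  have hc : 0 ≤ c := Summit.QuantumFields.BalabanUV.T4Continuum.Spine.NE4.scaleShiftRate_const_nonneg h hγ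
  have hC : 0 ≤ c / (1 - θ) := div_nonneg hc (by linarith)
  obtain ⟨γs, hγs, hγsle, hrem⟩ := rebased_everySlope hγ hθ0 hθ1 hb h (s := binf / 3) (by positivity)
  obtain ⟨hps, hhi⟩ := partialSums_upper_of_cornerSign hθ0 hθ1 hC hpos hrate hrem
  have hcont : BetaContH γs β := fun k => (T4BetaStationary.betaContH_of_histLipschitz hL k).mono (box_mono hγsle k)
  have hM : 0 ≤ c / (1 - θ) * (1 - θ)⁻¹ := mul_nonneg hC (inv_nonneg.mpr (by linarith))
  exact endpointExistence_of_partialSums hgen hγs hM (by positivity) hcont hps hhi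

/-! ## §2 At the record `datumOfRecord₁₃SepCoPH`: the three stub SHAPES and the composition concluding the ROUTE DECL BY NAME -/

/-- STUB SHAPE 1 = v3's `N17AtRecord13` VERBATIM (registered stub `stub_n17AtRecord13`, K3⁷-shared): NE4 on the datum at window `θ.γ`, `0 ≤ ρ < 1` displayed. -/
def N17AtRecord13 : Prop :=
  ∀ (F : T4Family) (θ : Node00.Stage13HParams F 2) (hP : θ.Provisos₁₃SepCoPH F 2), θ.Admissible F 2 →
    ∃ u : U3Carriers, u.γ = θ.γ ∧ 0 ≤ u.ρ ∧ u.ρ < 1 ∧ N17At (Node00.datumOfRecord₁₃SepCoPH F 2 θ hP) u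

/-- STUB SHAPE 2 «HISTORY-LIPSCHITZ MODULI OF THE RECORD'S β ON THE WINDOW» — the middle conjunct of node U2's input triple
`Spine.NE4.Targets.U2Inputs D … θ.γ Λ` = what K3⁷'s N22 ∧ (R) letters deliver on the datum (`u2Inputs_of_u3 … |>.2.1`, moduli `cr·Λ(k+1,·)`); SHARED CONTENT
with K3⁷ exactly as stub 1 shares N17 (a statement about `D.βfun` on the boxes only — END-free).  NOT PRINTED as such ([Balaban1987RG1] (1.20)–(1.22) p. 264
give only the linear structure).  Size: inside K3⁷'s XL N22-debt; 0 private. -/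
def HistLipAtRecord13 : Prop :=
  ∀ (F : T4Family) (θ : Node00.Stage13HParams F 2) (hP : θ.Provisos₁₃SepCoPH F 2), θ.Admissible F 2 →
    ∃ Λ : ℕ → ℕ → ℝ, HistLipschitz Λ θ.γ (Node00.datumOfRecord₁₃SepCoPH F 2 θ hP).βfun

/-- STUB SHAPE 3 «THE STATIONARY CORNER COEFFICIENT OF THE RECORD IS POSITIVE» — for EVERY sequence `b` to which the record's β is corner-anchored on the
window and EVERY limit `b_∞` of it, `0 < b_∞`.  (Under stubs 1–2 such a `b` exists and converges, and any two corner-anchoring sequences agree scale by scale,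
so this is the sign of ONE well-defined number `L_∞(F,θ)` = lim_k lim_{v→0⁺} β_k(v); its proof = row (D1)'s one-loop law READ AT THE CORNER — identify `L_k`
with the lattice one-loop coefficient — plus asymptotic freedom `L_∞ = (11N/3)(4π)⁻²·(normalisation)·log L > 0`; [Balaban1987RG1] (2.13) p. 268, [MRS93] (A.27).)
Reference-free: no `beta0OfMerged … θ.v₀`, no jets, no `Residue`, no `stepBal`.  Size L (= (D1) at the corner + the sign); instance 0∕1. -/
def CornerSignRecord13 : Prop :=
  ∀ (F : T4Family) (θ : Node00.Stage13HParams F 2) (hP : θ.Provisos₁₃SepCoPH F 2), θ.Admissible F 2 →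
    ∀ b : ℕ → ℝ, CornerAnchor b θ.γ (Node00.datumOfRecord₁₃SepCoPH F 2 θ hP).βfun →
      ∀ binf : ℝ, Tendsto b atTop (𝓝 binf) → 0 < binf

/-- **THE COMPOSITION AT THE RECORD (kernel, 0 sorry): N17 → HistLip → CornerSign → K2⁷'s TEXT** through `endpointExistence_of_cornerSign` at the datum of
record (forward generation = the datum's field `fwd`; `0 < θ.γ` from admissibility; the crux's unity ∕ (B) ∕ window hypotheses unused, as on lines 1′ and 2). -/
theorem EndpointGivenBR13SepCoPH_of_cornerSign_text (hN : N17AtRecord13) (hL : HistLipAtRecord13) (hs : CornerSignRecord13) :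
    (∀ (F : Literature.MathematicalPhysics.QuantumFieldTheory.Balaban1983to89.T4Continuum.T4Family) (θ : Literature.MathematicalPhysics.QuantumFieldTheory.Balaban1983to89.Node00.Stage13HParams F 2) (h : θ.Provisos₁₃SepCoPH F 2), (θ.ZhUnity F 2 ∧ θ.SlotsNondegenerate₁₃ F 2) → θ.Admissible F 2 → Literature.MathematicalPhysics.QuantumFieldTheory.Balaban1983to89.B16.EndStatementBPrinted (Literature.MathematicalPhysics.QuantumFieldTheory.Balaban1983to89.Node00.datumOfRecord₁₃SepCoPH F 2 θ h).C → (∃ γ₁ : ℝ, 0 < γ₁ ∧ ∀ γ : ℝ, 0 < γ → γ ≤ γ₁ → ∃ P : Literature.MathematicalPhysics.QuantumFieldTheory.Balaban1983to89.B12.RunParams, 1 ≤ P.K ∧ ((Literature.MathematicalPhysics.QuantumFieldTheory.Balaban1983to89.Node00.datumOfRecord₁₃SepCoPH F 2 θ h).C P).flow.InInterval γ P.K) → Literature.MathematicalPhysics.QuantumFieldTheory.Balaban1983to89.DagBinding.EndpointExistence (Literature.MathematicalPhysics.QuantumFieldTheory.Balaban1983to89.Node00.datumOfRecord₁₃SepCoPH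 F 2 θ h).C.toB12) := by
  intro F θ hP _hU hθ _hB _hwin
  obtain ⟨u, hγu, hρ0, hρ1, h17⟩ := hN F θ hP hθ
  obtain ⟨Λ, hLip⟩ := hL F θ hP hθ
  have hγ : 0 < θ.γ := hθ.toStage12.toStage9.gamma_pos
  have h' : ScaleShiftRate (u.cr * u.C₅ * u.θ) u.ρ θ.γ (Node00.datumOfRecord₁₃SepCoPH F 2 θ hP).βfun := by
    have h'' : ScaleShiftRate (u.cr * u.C₅ * u.θ) u.ρ u.γ (Node00.datumOfRecord₁₃SepCoPH F 2 θ hP).βfun := h17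
    rw [hγu] at h''
    exact h''
  exact endpointExistence_of_cornerSign (Node00.datumOfRecord₁₃SepCoPH F 2 θ hP).fwd hγ hρ0 hρ1 hLip h' (hs F θ hP hθ)

/-- **THE ROUTE'S CRUX DECL BY NAME from the three stub shapes** (what a registered LINE 2′ concluder `EndpointGivenBR13SepCoPH_proof₂'` would be, with
`stub_n17AtRecord13` (v3, registered) · `stub_histLip13 : HistLipAtRecord13` · `stub_cornerSign13 : CornerSignRecord13`). -/
theorem EndpointGivenBR13SepCoPH_of_cornerSign (hN : N17AtRecord13) (hL : HistLipAtRecord13) (hs : CornerSignRecord13) :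
    Summit.QuantumFields.YangMills.Theses.BalabanUVNodes.EndpointGivenBR13SepCoPH :=
  EndpointGivenBR13SepCoPH_of_cornerSign_text hN hL hs

/-- K3-SIDE FACE OF STUB 2 (bookkeeping, kernel): node U2's input triple on ANY data at window `γ` carries the history moduli — so at the record, K3⁷'s
`u2Inputs_of_u3` output (N18 ∧ N22 ∧ (R) on carriers with `u.γ = θ.γ`) discharges `HistLipAtRecord13`'s matrix conjunct scale by scale. [folklore] -/
theorem histLipschitz_of_u2Inputs {F : T4Family} {G : Type*} [GaugeGroup G] [MeasurableSpace G] [HaarData G]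
    (D : T4Continuum.FiniteEpsData F G) {c C θ γ : ℝ} {Λ : ℕ → ℕ → ℝ}
    (hI : Summit.QuantumFields.BalabanUV.T4Continuum.Spine.NE4.U2Inputs D c C θ γ Λ) : HistLipschitz Λ γ D.βfun :=
  hI.2.1


/-- K3⁷'s NODE-U3 LETTERS KEYED AT THE RECORD — the shape K3⁷ v2's registered `stub_rates13H` delivers at its reading of record (conjuncts N17 ∕ N18 ∕ N22 of
`SpineRatesHolder.RatesHolderAt`, the read-out binders `ReadOutAt`, node U3's rate letter `0 ≤ ρ < 1`; «node U3's window∕γ letters ARE θ's»), read on K2⁷'s keys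
(`datumOfRecord₁₃SepCoPH F 2 θ hP = datumOfRecord₁₃CoPH F 2 θ hP.toCore`, `rfl`).  A hypothesis SHAPE. -/
def U3LettersAtRecord13 : Prop :=
  ∀ (F : T4Family) (θ : Node00.Stage13HParams F 2) (hP : θ.Provisos₁₃SepCoPH F 2), θ.Admissible F 2 →
    ∃ u : U3Carriers, u.γ = θ.γ ∧ 0 ≤ u.ρ ∧ u.ρ < 1 ∧
      YMDAG.UVSplit.ReadOutAt (Node00.datumOfRecord₁₃SepCoPH F 2 θ hP) u ∧ YMDAG.UVSplit.N18At u ∧ YMDAG.UVSplit.N22At u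

/-- **THE K3-SIDE JUNCTION (kernel): K3⁷'s U3 letters at the record ⟹ stubs 1 AND 2** — N17 by `SpineRates.n17At_of_u3`, the history moduli
`Λ' k i := u.cr·u.Λ (k+1) i` by `Spine.NE4.Targets.u2Inputs_of_u3 … |>.2.1`, BOTH BY NAME.  So on this line K2⁷'s stubs 1–2 are K3⁷'s, and the private
content of THE END is stub 3 alone. [folklore] -/
theorem n17_histLip_of_u3Letters (h : U3LettersAtRecord13) : N17AtRecord13 ∧ HistLipAtRecord13 := by
  refine ⟨fun F θ hP hθ => ?_, fun F θ hP hθ => ?_⟩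
  · obtain ⟨u, hγu, hρ0, hρ1, hR, h18, h22⟩ := h F θ hP hθ
    exact ⟨u, hγu, hρ0, hρ1, YMDAG.UVSplit.n17At_of_u3 _ hR h18 h22⟩
  · obtain ⟨u, hγu, hρ0, hρ1, hR, h18, h22⟩ := h F θ hP hθ
    obtain ⟨𝒜A, 𝒜B, rA, rB, hW, hA, hB, h𝒜A, h𝒜B, hr, hcov, hcr, hC₅, hθ', hω, hθρ, hωρ⟩ := hR
    have hI := Summit.QuantumFields.BalabanUV.T4Continuum.Spine.NE4.u2Inputs_of_u3 _ hW h18 h22.1 h22.2 hA hB h𝒜A h𝒜B hr hcov hcr hC₅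
      hθ' hω hθρ hωρ
    have hL : HistLipschitz (fun k i => u.cr * u.Λ (k + 1) i) u.γ (Node00.datumOfRecord₁₃SepCoPH F 2 θ hP).βfun := hI.2.1
    rw [hγu] at hL
    exact ⟨_, hL⟩

/-- … hence THE END from K3⁷'s U3 letters and the one sign (kernel). -/
theorem EndpointGivenBR13SepCoPH_of_u3Letters_cornerSign (h : U3LettersAtRecord13) (hs : CornerSignRecord13) :
    Summit.QuantumFields.YangMills.Theses.BalabanUVNodes.EndpointGivenBR13SepCoPH :=
  EndpointGivenBR13SepCoPH_of_cornerSign (n17_histLip_of_u3Letters h).1 (n17_histLip_of_u3Letters h).2 hs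

/-! ## §3 The «one bit» lemma and two toys -/

/-- EVENTUAL POSITIVITY ON SMALL BOXES (idea-1's (EP) currency, stated for the β itself): some `e > 0`, depth `k₀` and box `]0,γ']` with `e ≤ β_k` on
`]0,γ']^{k+1}` for all `k ≥ k₀`. [folklore] -/
def EventualPosOnBoxes (γ : ℝ) (β : HBeta) : Prop :=
  ∃ e : ℝ, 0 < e ∧ ∃ k₀ : ℕ, ∃ γ' : ℝ, 0 < γ' ∧ γ' ≤ γ ∧ ∀ k, k₀ ≤ k → ∀ v ∈ Box γ' k, e ≤ β k v

/-- **ONE BIT: under the two K3 letters, the corner sign ⟺ eventual positivity on small boxes** — every AF-sign currency proposed for K2⁷ (idea-1's (EP),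
line 2's `posDrift`∕`0 < stepBal`, this card's corner sign) is the same bit once NE4 and the history moduli are on the table. [folklore] -/
theorem cornerSign_iff_eventualPos {β : HBeta} {Λ : ℕ → ℕ → ℝ} {c θ γ : ℝ} (hγ : 0 < γ) (hθ0 : 0 ≤ θ) (hθ1 : θ < 1)
    (hL : HistLipschitz Λ γ β) (h : ScaleShiftRate c θ γ β) :
    (∀ b : ℕ → ℝ, CornerAnchor b γ β → ∀ binf : ℝ, Tendsto b atTop (𝓝 binf) → 0 < binf) ↔ EventualPosOnBoxes γ β := by
  constructor
  · intro hsign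
    obtain ⟨b, hb⟩ := cornerAnchor_of_histLipschitz hγ hL
    obtain ⟨binf, hlim, hrate⟩ := conv_of_scaleShiftRate_cornerAnchor hγ hθ1 hb h
    have hpos : 0 < binf := hsign b hb binf hlim
    have hc : 0 ≤ c := Summit.QuantumFields.BalabanUV.T4Continuum.Spine.NE4.scaleShiftRate_const_nonneg h hγ
    have hC : 0 ≤ c / (1 - θ) := div_nonneg hc (by linarith)
    obtain ⟨γs, hγs, hγsle, hrem⟩ := rebased_everySlope hγ hθ0 hθ1 hb h (s := binf / 4) (by positivity)
    have hq : 0 < binf / 4 / (c / (1 - θ) + 1) := by positivity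
    obtain ⟨k₀, hk₀⟩ := exists_pow_lt_of_lt_one hq hθ1
    refine ⟨binf / 4, by positivity, k₀, γs, hγs, hγsle, fun k hk v hv => ?_⟩
    have h1 := (abs_sub_le_iff.mp (hrem k v hv)).2
    have h2 := (abs_sub_le_iff.mp (hrate k)).2
    have h3 : c / (1 - θ) * θ ^ k ≤ binf / 4 := by
      have hθk : θ ^ k ≤ θ ^ k₀ := pow_le_pow_of_le_one hθ0 hθ1.le hk
      calc c / (1 - θ) * θ ^ k ≤ (c / (1 - θ) + 1) * θ ^ k₀ := by
            have : 0 ≤ θ ^ k := pow_nonneg hθ0 k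
            nlinarith
        _ ≤ (c / (1 - θ) + 1) * (binf / 4 / (c / (1 - θ) + 1)) := mul_le_mul_of_nonneg_left hk₀.le (by positivity)
        _ = binf / 4 := by field_simp
    linarith
  · rintro ⟨e, he, k₀, γ', hγ', hγ'le, hev⟩ b hb binf hlim
    -- each corner limit at depth ≥ k₀ is ≥ e, hence so is binf
    have hbk : ∀ k, k₀ ≤ k → e ≤ b k := by
      intro k hk
      refine le_of_forall_pos_le_add fun ε hε => ?_
      obtain ⟨δ, hδ, -, hA⟩ := hb k ε hε
      let v : Fin (k + 1) → ℝ := fun _ => min δ γ'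
      have hvδ : v ∈ Box δ k := mem_box.mpr fun _ => ⟨lt_min hδ hγ', min_le_left _ _⟩
      have hvγ : v ∈ Box γ' k := mem_box.mpr fun _ => ⟨lt_min hδ hγ', min_le_right _ _⟩
      have h1 := (abs_sub_le_iff.mp (hA v hvδ)).1
      have h2 := hev k hk v hvγ
      linarith
    have hev' : ∀ᶠ k in atTop, e ≤ b k := Filter.eventually_atTop.mpr ⟨k₀, hbk⟩
    exact lt_of_lt_of_le he (ge_of_tendsto hlim hev')

/-- TOY 1 (non-vacuity of the generic END theorem's hypotheses): the constant β ≡ 1 carries NE4 with `c = 0`, zero history moduli, and a positive corner sign. -/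
example : ScaleShiftRate 0 (1 / 2) 1 (fun _ _ => (1 : ℝ)) ∧ HistLipschitz (fun _ _ => 0) 1 (fun _ _ => (1 : ℝ)) ∧
    (∀ b : ℕ → ℝ, CornerAnchor b 1 (fun _ _ => (1 : ℝ)) → ∀ binf : ℝ, Tendsto b atTop (𝓝 binf) → 0 < binf) := by
  refine ⟨fun k w _ => by simp, fun k p q _ _ => by simp, ?_⟩
  rw [cornerSign_iff_eventualPos (Λ := fun _ _ => 0) (c := 0) (θ := 1 / 2) one_pos (by norm_num) (by norm_num)
    (fun k p q _ _ => by simp) (fun k w _ => by simp)]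
  exact ⟨1, one_pos, 0, 1, one_pos, le_rfl, fun k _ v _ => le_rfl⟩

/-- TOY 2 (the sign stub carries content the two K3 letters do not): the constant β ≡ −1 carries NE4 and zero moduli, and its corner sign FAILS
(so stubs 1–2 ⇏ stub 3; and for β ≡ −1 every run's partial sums drift to −∞, the necessity side `FlowStepRuns.partialSums_lower_of_endpointRun`). -/
example : ScaleShiftRate 0 (1 / 2) 1 (fun _ _ => (-1 : ℝ)) ∧ HistLipschitz (fun _ _ => 0) 1 (fun _ _ => (-1 : ℝ)) ∧
    ¬ (∀ b : ℕ → ℝ, CornerAnchor b 1 (fun _ _ => (-1 : ℝ)) → ∀ binf : ℝ, Tendsto b atTop (𝓝 binf) → 0 < binf) := by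
  refine ⟨fun k w _ => by simp, fun k p q _ _ => by simp, fun H => ?_⟩
  have hb : CornerAnchor (fun _ => (-1 : ℝ)) 1 (fun _ _ => (-1 : ℝ)) :=
    fun k ε hε => ⟨1, one_pos, le_rfl, fun v _ => by simp [hε.le]⟩
  have := H _ hb (-1) tendsto_const_nhds
  linarith

/-! ## §4 (EDITION 2) GUARDED stub shapes (CRIT-2 ROUND 2 J1) and the TWO-STUB line through the landed U3 read-out `iff`

K3⁷'s `stub_rates13H` delivers its letters only at tuples with `θ.ZhUnity F 2 ∧ θ.SlotsNondegenerate₁₃ F 2`; K2⁷'s text has that guard (`hU`) in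
scope, so every K3-shared stub is re-typed WITH the guard (free repair J1).  The merged letter `U3TripleAtRecord13G` is, up to the `rfl`
`(datumOfRecord₁₃SepCoPH F 2 θ hP).βfun = Node00.betaOfRecord₁₃ F 2 θ.toStage13Params` (`Node00.βfun_datumOfRecord₁₃CoPH`), VERBATIM the right-hand
side of dag-n17-w2's landed `exists_u3Objects₁₁_readOut_n18_n22_datumOfRecord₁₃CoPH_iff` (`Theorems/BalabanUVNodesN17D4ReadOutAtRecord13.lean`) under
the guard — i.e. exactly what K3⁷'s (D4)-keyed U3 slots SAY about the β of record, no more (that file is not imported here to keep the sketch light;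
the junction is one `rw`). -/

/-- v3's `N17AtRecord13`, GUARDED (J1). [cite: Balaban1987RG1, (1.20)-(1.22) p.264] -/
def N17AtRecord13G : Prop :=
  ∀ (F : T4Family) (θ : Node00.Stage13HParams F 2) (hP : θ.Provisos₁₃SepCoPH F 2),
    (θ.ZhUnity F 2 ∧ θ.SlotsNondegenerate₁₃ F 2) → θ.Admissible F 2 →
      ∃ u : U3Carriers, u.γ = θ.γ ∧ 0 ≤ u.ρ ∧ u.ρ < 1 ∧ N17At (Node00.datumOfRecord₁₃SepCoPH F 2 θ hP) u

/-- Edition 1's `HistLipAtRecord13`, GUARDED (J1). [cite: Balaban1987RG1, (1.22) p.264] -/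
def HistLipAtRecord13G : Prop :=
  ∀ (F : T4Family) (θ : Node00.Stage13HParams F 2) (hP : θ.Provisos₁₃SepCoPH F 2),
    (θ.ZhUnity F 2 ∧ θ.SlotsNondegenerate₁₃ F 2) → θ.Admissible F 2 →
      ∃ Λ : ℕ → ℕ → ℝ, HistLipschitz Λ θ.γ (Node00.datumOfRecord₁₃SepCoPH F 2 θ hP).βfun

/-- Edition 1's `CornerSignRecord13` (K2⁷'s ONE private bit), GUARDED (J1). [cite: Balaban1987RG1, (2.13)-(2.14) p.268] -/
def CornerSignRecord13G : Prop :=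
  ∀ (F : T4Family) (θ : Node00.Stage13HParams F 2) (hP : θ.Provisos₁₃SepCoPH F 2),
    (θ.ZhUnity F 2 ∧ θ.SlotsNondegenerate₁₃ F 2) → θ.Admissible F 2 →
      ∀ b : ℕ → ℝ, CornerAnchor b θ.γ (Node00.datumOfRecord₁₃SepCoPH F 2 θ hP).βfun →
        ∀ binf : ℝ, Tendsto b atTop (𝓝 binf) → 0 < binf

/-- THE MERGED K3 LETTER (node U2's input triple `Spine.NE4.U2Inputs` on the β of record, GUARDED): verbatim the right-hand side of the landed
`exists_u3Objects₁₁_readOut_n18_n22_datumOfRecord₁₃CoPH_iff`, stated with `(datum).βfun` (`rfl`-equal to `betaOfRecord₁₃`).  ONE K3-shared stub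
replacing edition 1's two (`N17AtRecord13`, `HistLipAtRecord13`); its third conjunct `FadingMemory` is not used by K2⁷ at all.
[cite: Balaban1987RG1, (1.20)-(1.22) p.264, (2.9) p.266] -/
def U3TripleAtRecord13G : Prop :=
  ∀ (F : T4Family) (θ : Node00.Stage13HParams F 2) (hP : θ.Provisos₁₃SepCoPH F 2),
    (θ.ZhUnity F 2 ∧ θ.SlotsNondegenerate₁₃ F 2) → θ.Admissible F 2 →
      ∃ (c C ρ : ℝ) (Λ : ℕ → ℕ → ℝ), 0 ≤ c ∧ 0 < ρ ∧ ρ < 1 ∧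
        ScaleShiftRate c ρ θ.γ (Node00.datumOfRecord₁₃SepCoPH F 2 θ hP).βfun ∧
          HistLipschitz Λ θ.γ (Node00.datumOfRecord₁₃SepCoPH F 2 θ hP).βfun ∧ T4CouplingMatching.FadingMemory C ρ Λ

/-- The unguarded edition-1 shapes imply the guarded ones (so edition 1's compositions are the special case). [folklore] -/
theorem n17AtRecord13G_of (h : N17AtRecord13) : N17AtRecord13G := fun F θ hP _ hθ => h F θ hP hθ

/-- Idem for the history modulus. [folklore] -/
theorem histLipAtRecord13G_of (h : HistLipAtRecord13) : HistLipAtRecord13G := fun F θ hP _ hθ => h F θ hP hθ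

/-- Idem for the sign. [folklore] -/
theorem cornerSignRecord13G_of (h : CornerSignRecord13) : CornerSignRecord13G := fun F θ hP _ hθ => h F θ hP hθ

/-- The merged letter yields the two guarded edition-1 letters' CONTENT (a `ScaleShiftRate` with `0 ≤ ρ < 1` and a `HistLipschitz`). [folklore] -/
theorem letters_of_u3TripleG (h : U3TripleAtRecord13G) (F : T4Family) (θ : Node00.Stage13HParams F 2) (hP : θ.Provisos₁₃SepCoPH F 2)
    (hU : θ.ZhUnity F 2 ∧ θ.SlotsNondegenerate₁₃ F 2) (hθ : θ.Admissible F 2) :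
    ∃ (c ρ : ℝ) (Λ : ℕ → ℕ → ℝ), 0 ≤ ρ ∧ ρ < 1 ∧ ScaleShiftRate c ρ θ.γ (Node00.datumOfRecord₁₃SepCoPH F 2 θ hP).βfun ∧
      HistLipschitz Λ θ.γ (Node00.datumOfRecord₁₃SepCoPH F 2 θ hP).βfun := by
  obtain ⟨c, -, ρ, Λ, -, hρ0, hρ1, hss, hL, -⟩ := h F θ hP hU hθ
  exact ⟨c, ρ, Λ, hρ0.le, hρ1, hss, hL⟩

/-- **GUARDED THREE-STUB LINE, concluding the ROUTE DECL BY NAME** (edition 1's `EndpointGivenBR13SepCoPH_of_cornerSign` with J1 applied). [folklore] -/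
theorem EndpointGivenBR13SepCoPH_of_cornerSignG (hN : N17AtRecord13G) (hL : HistLipAtRecord13G) (hs : CornerSignRecord13G) :
    Summit.QuantumFields.YangMills.Theses.BalabanUVNodes.EndpointGivenBR13SepCoPH := by
  unfold Summit.QuantumFields.YangMills.Theses.BalabanUVNodes.EndpointGivenBR13SepCoPH
  intro F θ hP hU hθ _hB _hwin
  obtain ⟨u, hγu, hρ0, hρ1, h17⟩ := hN F θ hP hU hθ
  obtain ⟨Λ, hLip⟩ := hL F θ hP hU hθ
  have hγ : 0 < θ.γ := hθ.toStage12.toStage9.gamma_pos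
  have h' : ScaleShiftRate (u.cr * u.C₅ * u.θ) u.ρ θ.γ (Node00.datumOfRecord₁₃SepCoPH F 2 θ hP).βfun := by
    have h'' : ScaleShiftRate (u.cr * u.C₅ * u.θ) u.ρ u.γ (Node00.datumOfRecord₁₃SepCoPH F 2 θ hP).βfun := h17
    rw [hγu] at h''
    exact h''
  exact endpointExistence_of_cornerSign (Node00.datumOfRecord₁₃SepCoPH F 2 θ hP).fwd hγ hρ0 hρ1 hLip h' (hs F θ hP hU hθ)

/-- **THE TWO-STUB LINE**: `U3TripleAtRecord13G → CornerSignRecord13G → EndpointGivenBR13SepCoPH` — K2⁷ = (what K3⁷'s U3 slots say about the β of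
record, landed `iff`) + ONE SIGN. [folklore] -/
theorem EndpointGivenBR13SepCoPH_of_u3TripleG_cornerSignG (h : U3TripleAtRecord13G) (hs : CornerSignRecord13G) :
    Summit.QuantumFields.YangMills.Theses.BalabanUVNodes.EndpointGivenBR13SepCoPH := by
  unfold Summit.QuantumFields.YangMills.Theses.BalabanUVNodes.EndpointGivenBR13SepCoPH
  intro F θ hP hU hθ _hB _hwin
  obtain ⟨c, ρ, Λ, hρ0, hρ1, hss, hLip⟩ := letters_of_u3TripleG h F θ hP hU hθ
  have hγ : 0 < θ.γ := hθ.toStage12.toStage9.gamma_pos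
  exact endpointExistence_of_cornerSign (Node00.datumOfRecord₁₃SepCoPH F 2 θ hP).fwd hγ hρ0 hρ1 hLip hss (hs F θ hP hU hθ)

/-! ## §5 (EDITION 2) THE INVERSION'S OBJECT: node U2's continuum β-functional `betaInf` at the zero corner

`T4BetaStationary.betaInf β h := lim_k β k (revHist h k)` (node U2's «ONE continuum β-function», [Balaban1987RG1] p.255 «we can take one function β
instead of the sequence β_j») exists on every box-valued reversed history under N17 alone (`tendsto_betaInf`).  Under N17 and an anchoring sequence
`b → L_∞` (which `HistLipschitz` supplies): `betaInf β h → L_∞` UNIFORMLY as the history box `]0,δ]^ℕ` shrinks — the number stub 3 signs is the value of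
node U2's functional at the zero history; on constant histories `(g, g, …)` it is the ordinary limit `lim_{g→0⁺} lim_k β_k(g,…,g)` (three descriptions,
one number).  Hence `FunctionalAF` («`betaInf ≥ e > 0` near the zero history») is THE SAME BIT as the corner sign; and by the REPRESENTATION theorem
`abs_beta_sub_betaInf_padHist_le` it gives eventual positivity on small boxes WITHOUT `HistLipschitz`. -/

open T4BetaStationary (SeqBox revHist padHist betaInf)

/-- Box-valued histories are monotone in the box. [folklore] -/
theorem seqBox_mono {δ γ : ℝ} (hδγ : δ ≤ γ) {h : ℕ → ℝ} (hh : SeqBox δ h) : SeqBox γ h :=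
  fun j => ⟨(hh j).1, (hh j).2.trans hδγ⟩

/-- The diagonal values `β k (g,…,g)` converge (to `betaInf` of the constant history) under N17 alone — `Fin.tail` of a constant prefix is the
constant prefix. [folklore] -/
theorem diag_tendsto_betaInf {β : HBeta} {c θ γ g : ℝ} (h : ScaleShiftRate c θ γ β) (hθ1 : θ < 1) (hg0 : 0 < g) (hgγ : g ≤ γ) :
    Tendsto (fun k => β k (fun _ : Fin (k + 1) => g)) atTop (𝓝 (betaInf β (fun _ => g))) := by
  have hh : SeqBox γ (fun _ => g) := fun _ => ⟨hg0, hgγ⟩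
  have := T4BetaStationary.tendsto_betaInf h hθ1 hh
  have hrev : ∀ k, revHist (fun _ : ℕ => g) k = fun _ : Fin (k + 1) => g := fun k => funext fun i => rfl
  simpa only [hrev] using this

/-- The geometric rate with a PRESCRIBED limit (uniqueness of limits on top of `conv_of_scaleShiftRate_cornerAnchor`). [folklore] -/
theorem rate_of_cornerAnchor_tendsto {β : HBeta} {b : ℕ → ℝ} {c θ γ binf : ℝ} (hγ : 0 < γ) (hθ1 : θ < 1)
    (hb : CornerAnchor b γ β) (h : ScaleShiftRate c θ γ β) (hlim : Tendsto b atTop (𝓝 binf)) :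
    ∀ k, |b k - binf| ≤ c / (1 - θ) * θ ^ k := by
  obtain ⟨binf', hlim', hrate⟩ := conv_of_scaleShiftRate_cornerAnchor hγ hθ1 hb h
  have he : binf' = binf := tendsto_nhds_unique hlim' hlim
  subst he
  exact hrate

/-- A geometric tail can be made small: `∃ k₀, ∀ k ≥ k₀, (c/(1−θ))·θ^k ≤ η`. [folklore] -/
theorem geomTail_small {c θ : ℝ} (hc : 0 ≤ c) (hθ0 : 0 ≤ θ) (hθ1 : θ < 1) {η : ℝ} (hη : 0 < η) :
    ∃ k₀ : ℕ, ∀ k, k₀ ≤ k → c / (1 - θ) * θ ^ k ≤ η := by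
  have h1 : 0 < 1 - θ := by linarith
  have hq : 0 < η / (c / (1 - θ) + 1) := by positivity
  obtain ⟨k₀, hk₀⟩ := exists_pow_lt_of_lt_one hq hθ1
  refine ⟨k₀, fun k hk => ?_⟩
  have hθk : θ ^ k ≤ θ ^ k₀ := pow_le_pow_of_le_one hθ0 hθ1.le hk
  have hcd : 0 ≤ c / (1 - θ) := div_nonneg hc h1.le
  calc c / (1 - θ) * θ ^ k ≤ (c / (1 - θ) + 1) * θ ^ k₀ := by
        have : 0 ≤ θ ^ k := pow_nonneg hθ0 k
        nlinarith
    _ ≤ (c / (1 - θ) + 1) * (η / (c / (1 - θ) + 1)) := mul_le_mul_of_nonneg_left hk₀.le (by positivity)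
    _ = η := by field_simp

/-- **THE CORNER VALUE OF NODE U2's FUNCTIONAL** (Moore–Osgood): under N17 and an anchoring sequence `b → L_∞`, `betaInf β h → L_∞` UNIFORMLY on
shrinking history boxes: `∀ ε > 0, ∃ δ ∈ ]0,γ], ∀ h ∈ ]0,δ]^ℕ, |betaInf β h − L_∞| ≤ ε`.  (ε/3: geometric tail of `betaInf`, the anchor at ONE deep
scale, the geometric rate of `b`.) [folklore] -/
theorem betaInf_corner {β : HBeta} {b : ℕ → ℝ} {c θ γ binf : ℝ} (hγ : 0 < γ) (hθ0 : 0 ≤ θ) (hθ1 : θ < 1)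
    (h : ScaleShiftRate c θ γ β) (hb : CornerAnchor b γ β) (hlim : Tendsto b atTop (𝓝 binf)) {ε : ℝ} (hε : 0 < ε) :
    ∃ δ : ℝ, 0 < δ ∧ δ ≤ γ ∧ ∀ hh : ℕ → ℝ, SeqBox δ hh → |betaInf β hh - binf| ≤ ε := by
  have hc : 0 ≤ c := T4BetaStationary.constant_nonneg_of_scaleShiftRate h hγ
  have hrate := rate_of_cornerAnchor_tendsto hγ hθ1 hb h hlim
  obtain ⟨k, hk⟩ := geomTail_small hc hθ0 hθ1 (show 0 < ε / 3 by positivity)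
  have htail : c / (1 - θ) * θ ^ k ≤ ε / 3 := hk k le_rfl
  obtain ⟨δ, hδ, hδγ, hA⟩ := hb k (ε / 3) (by positivity)
  refine ⟨δ, hδ, hδγ, fun hh hhh => ?_⟩
  have hhγ : SeqBox γ hh := seqBox_mono hδγ hhh
  have e1 : |β k (revHist hh k) - betaInf β hh| ≤ ε / 3 := by
    have := T4BetaStationary.abs_beta_revHist_sub_betaInf_le h hθ1 hhγ k
    have hcomm : c * θ ^ k / (1 - θ) = c / (1 - θ) * θ ^ k := by ring
    linarith
  have e2 : |β k (revHist hh k) - b k| ≤ ε / 3 := hA (revHist hh k) (T4BetaStationary.revHist_mem_box hhh k)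
  have e3 : |b k - binf| ≤ ε / 3 := (hrate k).trans htail
  calc |betaInf β hh - binf|
      = |(-(β k (revHist hh k) - betaInf β hh)) + ((β k (revHist hh k) - b k) + (b k - binf))| := by congr 1; ring
    _ ≤ |-(β k (revHist hh k) - betaInf β hh)| + |(β k (revHist hh k) - b k) + (b k - binf)| := abs_add_le _ _
    _ ≤ |β k (revHist hh k) - betaInf β hh| + (|β k (revHist hh k) - b k| + |b k - binf|) := by
        rw [abs_neg]; exact add_le_add le_rfl (abs_add_le _ _)
    _ ≤ ε / 3 + (ε / 3 + ε / 3) := add_le_add e1 (add_le_add e2 e3)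
    _ = ε := by ring

/-- **ASYMPTOTIC FREEDOM OF THE CONTINUUM β-FUNCTIONAL** near the zero history: node U2's functional is bounded below by a positive constant on some
history box `]0,δ]^ℕ`.  The functional's HOME is node U2 (`T4BetaStationary`); the SIGN is K2⁷'s. [cite: Balaban1987RG1, (2.13)-(2.14) p.268, p.255] -/
def FunctionalAF (γ : ℝ) (β : HBeta) : Prop :=
  ∃ e : ℝ, 0 < e ∧ ∃ δ : ℝ, 0 < δ ∧ δ ≤ γ ∧ ∀ h : ℕ → ℝ, SeqBox δ h → e ≤ betaInf β h

/-- **STUB 3 ⟺ FUNCTIONAL AF** under K3⁷'s two letters: the corner sign (edition 1's typing) and the asymptotic freedom of node U2's functional are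
ONE BIT. [folklore] -/
theorem cornerSign_iff_functionalAF {β : HBeta} {Λ : ℕ → ℕ → ℝ} {c θ γ : ℝ} (hγ : 0 < γ) (hθ0 : 0 ≤ θ) (hθ1 : θ < 1)
    (hL : HistLipschitz Λ γ β) (h : ScaleShiftRate c θ γ β) :
    (∀ b : ℕ → ℝ, CornerAnchor b γ β → ∀ binf : ℝ, Tendsto b atTop (𝓝 binf) → 0 < binf) ↔ FunctionalAF γ β := by
  obtain ⟨b, hb⟩ := cornerAnchor_of_histLipschitz hγ hL
  obtain ⟨binf, hlim, -⟩ := conv_of_scaleShiftRate_cornerAnchor hγ hθ1 hb h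
  constructor
  · intro hsign
    have hpos : 0 < binf := hsign b hb binf hlim
    obtain ⟨δ, hδ, hδγ, hA⟩ := betaInf_corner hγ hθ0 hθ1 h hb hlim (half_pos hpos)
    refine ⟨binf / 2, half_pos hpos, δ, hδ, hδγ, fun hh hhh => ?_⟩
    have := (abs_sub_le_iff.mp (hA hh hhh)).2
    linarith
  · rintro ⟨e, he, δ, hδ, -, hA⟩ b' hb' binf' hlim'
    have key : ∀ ε : ℝ, 0 < ε → e ≤ binf' + ε := by
      intro ε hε
      obtain ⟨δ', hδ', -, hA'⟩ := betaInf_corner hγ hθ0 hθ1 h hb' hlim' hε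
      have h1 : SeqBox δ (fun _ => min δ δ') := fun _ => ⟨lt_min hδ hδ', min_le_left _ _⟩
      have h2 : SeqBox δ' (fun _ => min δ δ') := fun _ => ⟨lt_min hδ hδ', min_le_right _ _⟩
      have i1 := hA _ h1
      have i2 := (abs_sub_le_iff.mp (hA' _ h2)).1
      linarith
    exact lt_of_lt_of_le he (le_of_forall_pos_le_add key)

/-- **FUNCTIONAL AF ⟹ EVENTUAL POSITIVITY ON SMALL BOXES, WITHOUT `HistLipschitz`** (N17 + the representation theorem
`abs_beta_sub_betaInf_padHist_le`): `β k v ≥ betaInf β (padHist δ v) − cθ^k/(1−θ) ≥ e/2` on `]0,δ]^{k+1}` for `k ≥ k₀`. [folklore] -/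
theorem eventualPos_of_functionalAF {β : HBeta} {c θ γ : ℝ} (hγ : 0 < γ) (hθ0 : 0 ≤ θ) (hθ1 : θ < 1)
    (h : ScaleShiftRate c θ γ β) (hF : FunctionalAF γ β) : EventualPosOnBoxes γ β := by
  obtain ⟨e, he, δ, hδ, hδγ, hA⟩ := hF
  have hc : 0 ≤ c := T4BetaStationary.constant_nonneg_of_scaleShiftRate h hγ
  obtain ⟨k₀, hk₀⟩ := geomTail_small hc hθ0 hθ1 (half_pos he)
  refine ⟨e / 2, half_pos he, k₀, δ, hδ, hδγ, fun k hk v hv => ?_⟩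
  have hδss : ScaleShiftRate c θ δ β := fun j w hw => h j w (box_mono hδγ _ hw)
  have hrep := T4BetaStationary.abs_beta_sub_betaInf_padHist_le hδss hθ1 hδ le_rfl hv
  have hlow : e ≤ betaInf β (padHist δ v) := hA _ (T4BetaStationary.padHist_seqBox hδ le_rfl hv)
  have htail : c * θ ^ k / (1 - θ) ≤ e / 2 := by
    have := hk₀ k hk
    have hcomm : c * θ ^ k / (1 - θ) = c / (1 - θ) * θ ^ k := by ring
    linarith
  have := (abs_sub_le_iff.mp hrep).2
  linarith

/-- Record-keyed: FUNCTIONAL AF of the β of record, GUARDED. [cite: Balaban1987RG1, (2.13)-(2.14) p.268] -/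
def FunctionalAFRecord13G : Prop :=
  ∀ (F : T4Family) (θ : Node00.Stage13HParams F 2) (hP : θ.Provisos₁₃SepCoPH F 2),
    (θ.ZhUnity F 2 ∧ θ.SlotsNondegenerate₁₃ F 2) → θ.Admissible F 2 →
      FunctionalAF θ.γ (Node00.datumOfRecord₁₃SepCoPH F 2 θ hP).βfun

/-- **THE TWO-STUB LINE IN THE FUNCTIONAL CURRENCY**: `U3TripleAtRecord13G → FunctionalAFRecord13G → EndpointGivenBR13SepCoPH` (BY NAME). [folklore] -/
theorem EndpointGivenBR13SepCoPH_of_u3TripleG_functionalAFG (h : U3TripleAtRecord13G) (hF : FunctionalAFRecord13G) :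
    Summit.QuantumFields.YangMills.Theses.BalabanUVNodes.EndpointGivenBR13SepCoPH := by
  refine EndpointGivenBR13SepCoPH_of_u3TripleG_cornerSignG h fun F θ hP hU hθ => ?_
  obtain ⟨c, ρ, Λ, hρ0, hρ1, hss, hLip⟩ := letters_of_u3TripleG h F θ hP hU hθ
  exact (cornerSign_iff_functionalAF hθ.toStage12.toStage9.gamma_pos hρ0 hρ1 hLip hss).mpr (hF F θ hP hU hθ)

/-! ## §6 (EDITION 2) NECESSITY — the inversion closed — and the BOUNDARY

For ANY construction forward-generated by `β` ([Balaban1987RG1] (0.17)–(0.20)), an EVENTUALLY NEGATIVE β on small boxes (`β_k ≤ −e` on `]0,γ']^{k+1}`,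
`k ≥ k₁`) refutes `EndpointExistence`: along every in-interval run `1/g²_{k₁+n} ≥ 1/g²_{k₁} + n·e → ∞` uniformly in `g₀`, so `g_K < g` for `K`
large — letter-free.  With N17 and an anchoring sequence `b → L_∞`: `L_∞ < 0 ⟹` eventually negative (re-based every-slope estimate + geometric rate).
Hence **END ⟹ 0 ≤ L_∞**, while edition 1 proved **0 < L_∞ ⟹ END**: on K3⁷'s letters K2⁷'s private content is EXACTLY the strictness of one
inequality, and it is NECESSARY off the boundary `{L_∞ = 0}`.  ON the boundary the letters (even with `FadingMemory`) decide nothing: TOY A (β ≡ 0,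
END — CRIT-2 ROUND 2's P3‴ witness `cornerSign13_false_of_zeroOnBox` is this toy) and TOY B (β_k = −g_k, ¬END) carry identical letters and `L_∞ = 0`. -/

/-- HYPOTHESIS SHAPE — EVENTUALLY NEGATIVE on small boxes (the negation side of stub 3, one level down). [folklore] -/
def EventualNegOnBoxes (γ : ℝ) (β : HBeta) : Prop :=
  ∃ e : ℝ, 0 < e ∧ ∃ k₁ : ℕ, ∃ γ' : ℝ, 0 < γ' ∧ γ' ≤ γ ∧ ∀ k, k₁ ≤ k → ∀ v ∈ Box γ' k, β k v ≤ -e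

/-- ONE RUN: along an in-interval run of a forward-generated construction whose β is `≤ −e` (`0 ≤ e`) on the boxes from depth `k₁` on,
`1/g²_{k₁} + n·e ≤ 1/g²_{k₁+n}` — (0.20) solved forward, the right-hand side staying positive BECAUSE β is negative. [cite: Balaban1987RG1, (0.20) p.256] -/
theorem inv_sq_growth_of_neg {Cn : B12.Construction} {β : HBeta} (hgen : ForwardGenerated Cn β) {γ' e : ℝ} (he : 0 ≤ e) {k₁ : ℕ}
    (hN : ∀ k, k₁ ≤ k → ∀ v ∈ Box γ' k, β k v ≤ -e) (P : B12.RunParams) (hI : (Cn P).flow.InInterval γ' P.K) :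
    ∀ n, k₁ + n ≤ P.K → 1 / ((Cn P).flow.g k₁) ^ 2 + n * e ≤ 1 / ((Cn P).flow.g (k₁ + n)) ^ 2 := by
  intro n
  induction n with
  | zero => intro; simp
  | succ n ih =>
    intro hn
    have hk : k₁ + n < P.K := by omega
    have hposAll : ∀ i, i ≤ k₁ + n → 0 < (Cn P).flow.g i := fun i hi => (hI i (by omega)).1
    have hmem : prefixOf (Cn P).flow.g (k₁ + n) ∈ Box γ' (k₁ + n) :=
      mem_box.mpr fun i => by
        have hi := i.2
        exact hI i (by omega)
    have hβ := hN (k₁ + n) (by omega) _ hmem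
    have hsq : 0 < 1 / ((Cn P).flow.g (k₁ + n)) ^ 2 := by
      have := hposAll (k₁ + n) le_rfl
      positivity
    have hrhs : 0 < 1 / ((Cn P).flow.g (k₁ + n)) ^ 2 - β (k₁ + n) (prefixOf (Cn P).flow.g (k₁ + n)) := by linarith
    obtain ⟨-, heq⟩ := hgen.2 P (k₁ + n) hk hposAll hrhs
    have ih' := ih (by omega)
    have e1 : k₁ + (n + 1) = k₁ + n + 1 := by omega
    rw [e1]
    push_cast
    linarith

/-- **AN EVENTUALLY NEGATIVE β REFUTES END** for every forward-generated construction (letter-free). [cite: Balaban1987RG1, (0.17)-(0.20) pp.255-256] -/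
theorem not_endpointExistence_of_eventualNeg {Cn : B12.Construction} {β : HBeta} (hgen : ForwardGenerated Cn β) {γ : ℝ}
    (hneg : EventualNegOnBoxes γ β) : ¬ EndpointExistence Cn := by
  intro hE
  obtain ⟨e, he, k₁, γ', hγ', -, hN⟩ := hneg
  obtain ⟨γ₂, hγ₂, hE2⟩ := hE 0
  have hγ₀ : 0 < min γ₂ γ' := lt_min hγ₂ hγ'
  obtain ⟨gstar, hgstar, hE3⟩ := hE2 (min γ₂ γ') hγ₀ (min_le_left _ _)
  obtain ⟨N, hNgt⟩ := exists_nat_gt (1 / gstar ^ 2 / e)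
  obtain ⟨g0, hI, hK⟩ := hE3 gstar hgstar le_rfl (k₁ + N)
  have hI' : (Cn ⟨k₁ + N, 0, g0⟩).flow.InInterval γ' (k₁ + N) :=
    fun i hi => ⟨(hI i hi).1, (hI i hi).2.trans (min_le_right _ _)⟩
  have hgrow := inv_sq_growth_of_neg hgen he.le hN ⟨k₁ + N, 0, g0⟩ hI' N le_rfl
  have hKe : (Cn ⟨k₁ + N, 0, g0⟩).flow.g (k₁ + N) = gstar := hK
  rw [hKe] at hgrow
  have h1 : 0 < 1 / ((Cn ⟨k₁ + N, 0, g0⟩).flow.g k₁) ^ 2 := by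
    have := (hI k₁ (by omega)).1
    positivity
  have h2 : 1 / gstar ^ 2 < N * e := (div_lt_iff₀ he).mp hNgt
  linarith

/-- Under N17 and an anchoring sequence `b → L_∞`: `L_∞ < 0 ⟹` β is eventually negative on small boxes. [folklore] -/
theorem eventualNeg_of_cornerLimit_neg {β : HBeta} {b : ℕ → ℝ} {c θ γ binf : ℝ} (hγ : 0 < γ) (hθ0 : 0 ≤ θ) (hθ1 : θ < 1)
    (h : ScaleShiftRate c θ γ β) (hb : CornerAnchor b γ β) (hlim : Tendsto b atTop (𝓝 binf)) (hneg : binf < 0) :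
    EventualNegOnBoxes γ β := by
  have hc : 0 ≤ c := T4BetaStationary.constant_nonneg_of_scaleShiftRate h hγ
  have hrate := rate_of_cornerAnchor_tendsto hγ hθ1 hb h hlim
  have hs : 0 < -binf / 3 := by linarith
  obtain ⟨γs, hγs, hγsle, hrem⟩ := rebased_everySlope hγ hθ0 hθ1 hb h hs
  obtain ⟨k₁, hk₁⟩ := geomTail_small hc hθ0 hθ1 hs
  refine ⟨-binf / 3, hs, k₁, γs, hγs, hγsle, fun k hk v hv => ?_⟩
  have e1 := (abs_sub_le_iff.mp (hrem k v hv)).1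
  have e2 := (abs_sub_le_iff.mp (hrate k)).1
  have e3 := hk₁ k hk
  linarith

/-- **NECESSITY (the inversion closed): END FORCES `0 ≤ L_∞`** for every construction forward-generated by a β with N17 and an anchoring sequence.
[cite: Balaban1987RG1, (0.17)-(0.20) pp.255-256, (2.13)-(2.14) p.268] -/
theorem cornerLimit_nonneg_of_endpointExistence {Cn : B12.Construction} {β : HBeta} (hgen : ForwardGenerated Cn β) {b : ℕ → ℝ}
    {c θ γ binf : ℝ} (hγ : 0 < γ) (hθ0 : 0 ≤ θ) (hθ1 : θ < 1) (h : ScaleShiftRate c θ γ β) (hb : CornerAnchor b γ β)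
    (hlim : Tendsto b atTop (𝓝 binf)) (hE : EndpointExistence Cn) : 0 ≤ binf := by
  by_contra hneg
  exact not_endpointExistence_of_eventualNeg hgen (eventualNeg_of_cornerLimit_neg hγ hθ0 hθ1 h hb hlim (not_le.mp hneg)) hE

/-- Record-keyed NECESSITY shape: at every guarded admissible tuple, K2⁷'s CONCLUSION forces the non-strict corner sign of the β of record. [folklore] -/
def CornerNonnegRecord13G : Prop :=
  ∀ (F : T4Family) (θ : Node00.Stage13HParams F 2) (hP : θ.Provisos₁₃SepCoPH F 2),
    (θ.ZhUnity F 2 ∧ θ.SlotsNondegenerate₁₃ F 2) → θ.Admissible F 2 →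
      EndpointExistence (Node00.datumOfRecord₁₃SepCoPH F 2 θ hP).C.toB12 →
        ∀ b : ℕ → ℝ, CornerAnchor b θ.γ (Node00.datumOfRecord₁₃SepCoPH F 2 θ hP).βfun →
          ∀ binf : ℝ, Tendsto b atTop (𝓝 binf) → 0 ≤ binf

/-- **AT THE RECORD: K3⁷'s N17 letter alone makes the non-strict sign a CONSEQUENCE of K2⁷'s conclusion** — so stub 3 (`0 < L_∞`) exceeds what END
forces (`0 ≤ L_∞`) by the boundary case only. [folklore] -/
theorem cornerNonnegRecord13G_of_n17G (hN : N17AtRecord13G) : CornerNonnegRecord13G := by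
  intro F θ hP hU hθ hE b hb binf hlim
  obtain ⟨u, hγu, hρ0, hρ1, h17⟩ := hN F θ hP hU hθ
  have hγ : 0 < θ.γ := hθ.toStage12.toStage9.gamma_pos
  have h' : ScaleShiftRate (u.cr * u.C₅ * u.θ) u.ρ θ.γ (Node00.datumOfRecord₁₃SepCoPH F 2 θ hP).βfun := by
    have h'' : ScaleShiftRate (u.cr * u.C₅ * u.θ) u.ρ u.γ (Node00.datumOfRecord₁₃SepCoPH F 2 θ hP).βfun := h17
    rw [hγu] at h''
    exact h''
  exact cornerLimit_nonneg_of_endpointExistence (Node00.datumOfRecord₁₃SepCoPH F 2 θ hP).fwd hγ hρ0 hρ1 h' hb hlim hE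

/-- TOY A (ON the boundary, END true): β ≡ 0. [folklore] -/
def betaZero : HBeta := fun _ _ => 0

/-- TOY B (ON the boundary, END false): `β_k(g_0,…,g_k) = −g_k` — the stationary family of the functional `h ↦ −h 0`. [folklore] -/
def betaLast : HBeta := fun k v => -v (Fin.last k)

/-- TOY A carries the full merged K3 letter (N17 with `c = 0`, `HistLipschitz` with `Λ ≡ 0`, `FadingMemory`) and is anchored to `0` (`L_∞ = 0`). [folklore] -/
theorem betaZero_letters {γ : ℝ} (hγ : 0 < γ) :
    ScaleShiftRate 0 (1 / 2) γ betaZero ∧ HistLipschitz (fun _ _ => 0) γ betaZero ∧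
      T4CouplingMatching.FadingMemory 0 (1 / 2) (fun _ _ => 0) ∧ CornerAnchor (fun _ => 0) γ betaZero := by
  refine ⟨fun k w _ => by simp [betaZero], fun k p q _ _ => by simp [betaZero], fun k i _ => by simp,
    fun k ε hε => ⟨γ, hγ, le_rfl, fun v _ => by simp [betaZero, hε.le]⟩⟩

/-- TOY A has END (constant runs `g_k ≡ g₀`; the tree's `endpointExistence_modelOf` with `β' = 0`). [folklore] -/
theorem betaZero_endpointExistence : EndpointExistence (FlowStepRuns.modelOf betaZero) :=
  FlowStepRuns.endpointExistence_modelOf betaZero one_pos le_rfl (fun _ => continuousOn_const) (fun _ _ _ => le_rfl)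
    (fun _ _ _ => le_rfl)

/-- TOY B carries the full merged K3 letter (N17 with `c = 0`, `HistLipschitz` with the last-slot modulus, `FadingMemory` with `C = 1`) and is
anchored to `0` (`L_∞ = 0`). [folklore] -/
theorem betaLast_letters {γ : ℝ} (hγ : 0 < γ) :
    ScaleShiftRate 0 (1 / 2) γ betaLast ∧ HistLipschitz (fun k i => if i = k then 1 else 0) γ betaLast ∧
      T4CouplingMatching.FadingMemory 1 (1 / 2) (fun k i => if i = k then 1 else 0) ∧ CornerAnchor (fun _ => 0) γ betaLast := by
  refine ⟨?_, ?_, ?_, ?_⟩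
  · intro k w _
    have htl : Fin.tail w (Fin.last k) = w (Fin.last (k + 1)) := by
      show w (Fin.last k).succ = w (Fin.last (k + 1))
      rw [Fin.succ_last]
    simp [betaLast, htl]
  · intro k p q _ _
    have hsum : ∑ i : Fin (k + 1), (if (i : ℕ) = k then (1 : ℝ) else 0) * |p i - q i| = |p (Fin.last k) - q (Fin.last k)| := by
      rw [Finset.sum_eq_single (Fin.last k)]
      · simp
      · intro i _ hi
        have hne : (i : ℕ) ≠ k := fun hik => hi (Fin.ext (by rw [hik, Fin.val_last]))
        simp [hne]
      · intro hnot
        exact absurd (Finset.mem_univ _) hnot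
    rw [hsum]
    simp only [betaLast]
    rw [show -p (Fin.last k) - -q (Fin.last k) = -(p (Fin.last k) - q (Fin.last k)) by ring, abs_neg]
  · intro k i _
    by_cases hik : i = k
    · subst hik
      simp
    · simp only [if_neg hik]
      exact ⟨le_rfl, by positivity⟩
  · intro k ε hε
    refine ⟨min ε γ, lt_min hε hγ, min_le_right _ _, fun v hv => ?_⟩
    have h1 := (mem_box.mp hv) (Fin.last k)
    simp only [betaLast, sub_zero, abs_neg]
    rw [abs_of_pos h1.1]
    exact h1.2.trans (min_le_left _ _)

/-- TOY B's recursion: `g_{k+1} = solveCoupling (1/g_k² + g_k)`. [folklore] -/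
theorem genSeq_betaLast_succ (g0 : ℝ) (k : ℕ) :
    FlowStepRuns.genSeq betaLast g0 (k + 1) =
      FlowStepRuns.solveCoupling (1 / (FlowStepRuns.genSeq betaLast g0 k) ^ 2 + FlowStepRuns.genSeq betaLast g0 k) := by
  rw [FlowStepRuns.genSeq_succ]
  simp only [betaLast, prefixOf, Fin.val_last, sub_neg_eq_add]

/-- TOY B's runs from `g₀ > 0`: positive, with `1/g²_{k+1} = 1/g²_k + g_k`. [folklore] -/
theorem genSeq_betaLast_pos_step {g0 : ℝ} (hg0 : 0 < g0) :
    ∀ k, 0 < FlowStepRuns.genSeq betaLast g0 k ∧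
      1 / (FlowStepRuns.genSeq betaLast g0 (k + 1)) ^ 2 = 1 / (FlowStepRuns.genSeq betaLast g0 k) ^ 2 + FlowStepRuns.genSeq betaLast g0 k := by
  intro k
  induction k with
  | zero =>
    have h0 : FlowStepRuns.genSeq betaLast g0 0 = g0 := FlowStepRuns.genSeq_zero _ _
    rw [genSeq_betaLast_succ, h0]
    exact ⟨hg0, FlowStepRuns.inv_sq_solveCoupling (by positivity)⟩
  | succ k ih =>
    obtain ⟨hpos, -⟩ := ih
    have hy : 0 < 1 / (FlowStepRuns.genSeq betaLast g0 k) ^ 2 + FlowStepRuns.genSeq betaLast g0 k := by positivity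
    have hpos' : 0 < FlowStepRuns.genSeq betaLast g0 (k + 1) := by
      rw [genSeq_betaLast_succ]
      exact FlowStepRuns.solveCoupling_pos hy
    refine ⟨hpos', ?_⟩
    rw [genSeq_betaLast_succ g0 (k + 1)]
    exact FlowStepRuns.inv_sq_solveCoupling (by positivity)

/-- TOY B's runs are non-increasing. [folklore] -/
theorem genSeq_betaLast_antitone {g0 : ℝ} (hg0 : 0 < g0) : Antitone (FlowStepRuns.genSeq betaLast g0) := by
  refine antitone_nat_of_succ_le fun k => ?_
  obtain ⟨hpos, hstep⟩ := genSeq_betaLast_pos_step hg0 k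
  have hpos' := (genSeq_betaLast_pos_step hg0 (k + 1)).1
  have hsq : (FlowStepRuns.genSeq betaLast g0 (k + 1)) ^ 2 ≤ (FlowStepRuns.genSeq betaLast g0 k) ^ 2 := by
    rw [← one_div_le_one_div (pow_pos hpos 2) (pow_pos hpos' 2)]
    linarith [hpos.le]
  nlinarith [hpos, hpos']

/-- TOY B: `n · g_n ≤ 1/g_n²` along every run from `g₀ > 0` (the sum `Σ_{j<n} g_j ≥ n·g_n`). [folklore] -/
theorem genSeq_betaLast_nmul_le {g0 : ℝ} (hg0 : 0 < g0) :
    ∀ n : ℕ, (n : ℝ) * FlowStepRuns.genSeq betaLast g0 n ≤ 1 / (FlowStepRuns.genSeq betaLast g0 n) ^ 2 := by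
  intro n
  induction n with
  | zero =>
    have := (genSeq_betaLast_pos_step hg0 0).1
    simp only [Nat.cast_zero, zero_mul]
    positivity
  | succ n ih =>
    obtain ⟨hpos, hstep⟩ := genSeq_betaLast_pos_step hg0 n
    have hmono : FlowStepRuns.genSeq betaLast g0 (n + 1) ≤ FlowStepRuns.genSeq betaLast g0 n :=
      genSeq_betaLast_antitone hg0 (Nat.le_succ n)
    rw [hstep]
    push_cast
    nlinarith [hmono, hpos, ih]

/-- **TOY B HAS NO ENDPOINT RUNS for large `K`**: an endpoint run with `g_K = g` has `K·g ≤ 1/g²`, i.e. `K ≤ 1/g³`. [folklore] -/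
theorem betaLast_not_endpointExistence : ¬ EndpointExistence (FlowStepRuns.modelOf betaLast) := by
  intro hE
  obtain ⟨γ₂, hγ₂, hE2⟩ := hE 0
  obtain ⟨gstar, hgstar, hE3⟩ := hE2 γ₂ hγ₂ le_rfl
  obtain ⟨N, hN⟩ := exists_nat_gt (1 / gstar ^ 3)
  obtain ⟨g0, hI, hK⟩ := hE3 gstar hgstar le_rfl N
  have hrun : (FlowStepRuns.modelOf betaLast ⟨N, 0, g0⟩).flow.g = FlowStepRuns.genSeq betaLast g0 := rfl
  rw [hrun] at hK
  have hg0 : 0 < g0 := by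
    have := (hI 0 (Nat.zero_le _)).1
    have e0 : (FlowStepRuns.modelOf betaLast ⟨N, 0, g0⟩).flow.g 0 = g0 := FlowStepRuns.genSeq_zero _ _
    rwa [e0] at this
  have hb := genSeq_betaLast_nmul_le hg0 N
  have hKN : FlowStepRuns.genSeq betaLast g0 N = gstar := hK
  rw [hKN] at hb
  have h3 : 1 / gstar ^ 2 = 1 / gstar ^ 3 * gstar := by
    field_simp
  have hlt : 1 / gstar ^ 2 < N * gstar := by
    rw [h3]
    exact mul_lt_mul_of_pos_right hN hgstar
  linarith

/-- **THE BOUNDARY IS UNDECIDED BY THE LETTERS**: two history families with the same merged K3 letter and the same corner value `L_∞ = 0`, one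
forward-generating a construction WITH END and one WITHOUT.  So `0 < L_∞` (stub 3) is NECESSARY for END off `{L_∞ = 0}` (above) and nothing typed in
K3⁷'s letters replaces it on `{L_∞ = 0}`; CRIT-2's P3‴ witness (β ≡ 0 on a box: END true, stub false) is TOY A, ON the boundary. [folklore] -/
theorem boundary_undecided {γ : ℝ} (hγ : 0 < γ) :
    (∃ β : HBeta, (∃ c ρ C Λ, 0 ≤ c ∧ 0 < ρ ∧ ρ < 1 ∧ ScaleShiftRate c ρ γ β ∧ HistLipschitz Λ γ β ∧ T4CouplingMatching.FadingMemory C ρ Λ) ∧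
        CornerAnchor (fun _ => 0) γ β ∧ ForwardGenerated (FlowStepRuns.modelOf β) β ∧ EndpointExistence (FlowStepRuns.modelOf β)) ∧
      ∃ β : HBeta, (∃ c ρ C Λ, 0 ≤ c ∧ 0 < ρ ∧ ρ < 1 ∧ ScaleShiftRate c ρ γ β ∧ HistLipschitz Λ γ β ∧ T4CouplingMatching.FadingMemory C ρ Λ) ∧
        CornerAnchor (fun _ => 0) γ β ∧ ForwardGenerated (FlowStepRuns.modelOf β) β ∧ ¬ EndpointExistence (FlowStepRuns.modelOf β) := by
  obtain ⟨a1, a2, a3, a4⟩ := betaZero_letters hγ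
  obtain ⟨b1, b2, b3, b4⟩ := betaLast_letters hγ
  exact ⟨⟨betaZero, ⟨0, 1 / 2, 0, _, le_rfl, by norm_num, by norm_num, a1, a2, a3⟩, a4, FlowStepRuns.modelOf_forwardGenerated _,
      betaZero_endpointExistence⟩,
    ⟨betaLast, ⟨0, 1 / 2, 1, _, le_rfl, by norm_num, by norm_num, b1, b2, b3⟩, b4, FlowStepRuns.modelOf_forwardGenerated _,
      betaLast_not_endpointExistence⟩⟩

/-! ## §7 (EDITION 2) THE TWO TYPED SUPPLIER ROADS FOR STUB 3 (CRIT-2 ROUND 2 P2‴)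

(R-k) PER-SCALE: anchor the β of record, scale by scale, to θ-COVARIANT named numbers `cβ · b⁰_k` (DEF-1 ed.3's `θ.cβ · beta0OfJs F κ k`, κ chosen
AFTER θ — immune to `Negative/RemNamedJets13FalseOfTwoNormalisations` and `…/Anchor13FalseOfTwoBaseHistories` by construction) that are EVENTUALLY
`≥ e > 0` (row (D1): one-loop law + AF sign, [Balaban1987RG1] (2.13) p.268); by uniqueness of corner limits the sign follows — S-ref per k.
(R-∞) STATIONARY: identify ONCE the value of node U2's functional at the zero history with a positive number `B` ([I] §5's j-uniform operators /
node U2's `T4BetaStationary` stationary step; print p.255 «one function β … asymptotic expansions») — NO per-k statement; by §5 the corner limits' limit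
equals `B`.  Both are typed below generically (instance 0∕1 at the record is the supplier's burden, not asserted here). -/

/-- **(R-k)**: a θ-covariantly NAMED anchoring sequence `k ↦ cβ·b⁰_k` with `cβ > 0` and `b⁰_k ≥ e > 0` eventually supplies the corner sign. [folklore] -/
theorem cornerSign_of_namedAnchor {β : HBeta} {b0 : ℕ → ℝ} {cβ e γ : ℝ} (hcβ : 0 < cβ) (he : 0 < e)
    (hA : CornerAnchor (fun k => cβ * b0 k) γ β) (hev : ∃ k₀ : ℕ, ∀ k, k₀ ≤ k → e ≤ b0 k) :
    ∀ b : ℕ → ℝ, CornerAnchor b γ β → ∀ binf : ℝ, Tendsto b atTop (𝓝 binf) → 0 < binf := by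
  intro b hb binf hlim
  have hbb : b = fun k => cβ * b0 k := cornerAnchor_unique hb hA
  obtain ⟨k₀, hk₀⟩ := hev
  have hev' : ∀ᶠ k in atTop, cβ * e ≤ b k :=
    Filter.eventually_atTop.mpr ⟨k₀, fun k hk => by rw [hbb]; exact mul_le_mul_of_nonneg_left (hk₀ k hk) hcβ.le⟩
  exact lt_of_lt_of_le (mul_pos hcβ he) (ge_of_tendsto hlim hev')

/-- **(R-∞)**: under N17, ONE identification of the corner value of node U2's functional with a number `B > 0` supplies the corner sign — for every
anchoring sequence and every limit, `L_∞ = B`. [folklore] -/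
theorem cornerSign_of_functionalValue {β : HBeta} {c θ γ B : ℝ} (hγ : 0 < γ) (hθ0 : 0 ≤ θ) (hθ1 : θ < 1)
    (h : ScaleShiftRate c θ γ β) (hB : 0 < B)
    (hval : ∀ ε : ℝ, 0 < ε → ∃ δ : ℝ, 0 < δ ∧ ∀ hh : ℕ → ℝ, SeqBox δ hh → |betaInf β hh - B| ≤ ε) :
    ∀ b : ℕ → ℝ, CornerAnchor b γ β → ∀ binf : ℝ, Tendsto b atTop (𝓝 binf) → 0 < binf := by
  intro b hb binf hlim
  have heq : binf = B := by
    refine eq_of_forall_dist_le fun ε hε => ?_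
    obtain ⟨δ, hδ, -, hA⟩ := betaInf_corner hγ hθ0 hθ1 h hb hlim (half_pos hε)
    obtain ⟨δ', hδ', hA'⟩ := hval (ε / 2) (half_pos hε)
    have h1 : SeqBox δ (fun _ => min δ δ') := fun _ => ⟨lt_min hδ hδ', min_le_left _ _⟩
    have h2 : SeqBox δ' (fun _ => min δ δ') := fun _ => ⟨lt_min hδ hδ', min_le_right _ _⟩
    have i1 := hA _ h1
    have i2 := hA' _ h2
    rw [Real.dist_eq]
    calc |binf - B| = |(betaInf β (fun _ => min δ δ') - B) - (betaInf β (fun _ => min δ δ') - binf)| := by congr 1; ring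
      _ ≤ |betaInf β (fun _ => min δ δ') - B| + |betaInf β (fun _ => min δ δ') - binf| := abs_sub _ _
      _ ≤ ε / 2 + ε / 2 := add_le_add i2 i1
      _ = ε := by ring
  rw [heq]
  exact hB

/-! ## §8 (EDITION 3, GEN 4) v4's WALL 2′ LOCATED ON THE CORNER LINE; the 2′-free THREE-STUB line on v4's own letters; the (D1)-drift ⟹ sign junction; BN-F placement

Event-driven on plan g81's v4 cut `D81-K2V4/K2Skeleton13SepCoPHv4.lean` (e802584e…; line 1′ texts = DEF-1's letter EDITION 3 `BalabanUVNodesK2NamedJetsRemAt.RemAt F κ θ hP c`,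
p593586 — №203 «κ AFTER θ, `θ.cβ` carried» MET), DEF-1's RUN edition `BalabanUVNodesK2NamedJetsRunRemAt.RunRemAt` (p596574, №204 ∕ idea-4's 2ᴮ″), CRIT-2 ROUND 2c (junction
J2 `ScaleAnchor ⟺ CornerAnchor`) ∕ ROUND 2e §B (the re-keyed corner texts `AnchorSomeJets13`, `D1SignShadowingAnchor13`) and IDEA-5's barrier note BN-F (N3) («box-wide ∀k
letters at a fixed level are infrared statements»; graded a VALID located typing point by CRIT-2 2e §A).

THE INVERSION, third pass.  Run v4's XL stub 2′ `RemAtSomeJets := ∀ F θ hP, θ.Admissible F 2 → ∃ κ, RemAt F κ θ hP θ.cβ` — «CONSTANT remainder ∀k with the cap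
`s ≤ θ.cβ·stepBal 2 F.L` + PER-SCALE ANCHOR at `θ.cβ • beta0OfJs F κ` + box (C)» — BACKWARDS through K3⁷'s letters.  Under `U3TripleAtRecord13G` (§4; K3-shared; verbatim the
right-hand side of dag-n17-w2's landed read-out `iff`):
* N17 (`ScaleShiftRate`) + the per-scale anchor MANUFACTURE the constant remainder at EVERY height `s > 0` on some box `]0, γ_s] ⊆ ]0, θ.γ]` (§1 `rebased_everySlope` — the
  telescoping of edition 1) — so the cap is met with room (`0 < θ.cβ·stepBal 2 F.L`: Stage-9 chart clause + `B12Normalization.stepBal_pos`);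
* `HistLipschitz` manufactures box (C) (`T4BetaStationary.betaContH_of_histLipschitz`).
HENCE (8.2, kernel): GIVEN `U3TripleAtRecord13G`, `RemAtSomeJetsG ⟺ AnchorSomeJets13` — on this line NODE O's wall is the per-scale IDENTIFICATION «for some κ chosen after θ,
`β_{k+1}(p) → θ.cβ·β⁰(J^s_k(κ))` as `p → 0`, k FIXED» (size M per k; ∃κ once) and NOTHING k-uniform: every k-uniform conjunct of `RemAt` — and of `RunRemAt`, which `RemAt` implies
(`runRemAt_of_remAt`) — is a theorem of K3⁷'s letters + the identification.  Typed consequences: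
(8.3) THE THREE-STUB LINE ON v4's OWN LETTERS concluding the crux BY NAME, {`U3TripleAtRecord13G`, `AnchorSomeJets13` (CRIT-2 2e §B VERBATIM), THE (D1) STUB OF RECORD} — the
  (D1) stub in ANY of its three circulating spellings: v4's registered `stub_d1NamedJets13 : D1AtShadowingJets` (hypothesis `RemAt`; here `D1AtShadowingJetsV4`, verbatim),
  DEF-1's anchor-keyed use form (hypothesis `ScaleAnchor`; `D1AtAnchoredJets`, verbatim = `h` of `d1AtShadowingJets_of_drift_of_anchor` p593586 = `hD1` of
  `EndpointGivenBR13SepCoPH_of_runShadowingJetsGivenB_anchorRoad` p596574; director-ym №23 «THE (D1) stub»), or CRIT-2 2e §B's eventual-sign text `D1SignShadowingAnchor13`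
  — i.e. LINE 1′ ∕ 1ᴮ″ with NODE O's wall 2′ ∕ 2ᴮ″ PRE-PAID by K3⁷'s letters + the identification (`remAtSomeJetsG_of_u3TripleG_anchor`, `runRemAtSomeJetsGivenB_of_u3TripleG_anchor`);
(8.4) THE SIGN JUNCTION: under N17 + anchor the named numbers CONVERGE (§1), so a drift at slope `stepBal 2 F.L` ((D1), [II] (2.38)) forces their LIMIT to be `stepBal 2 F.L > 0`
  (Cesàro: the averages tend to the limit AND to the slope) — (D1)'s drift IS road (R-k)'s sign supplier (§7), and CRIT-2's eventual-sign text is the WEAKER ask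
  (`d1SignShadowingAnchor13_of_u3TripleG_d1V4`); conversely an eventual sign does not pin the slope (no converse);
(8.5) BN-F (N3) PLACEMENT (kernel display `runRemAtSomeJetsGivenB_of_u3TripleG_anchor` + prose): the line's PRIVATE stubs are `AnchorSomeJets13` (per-k SHRINKING boxes — BN-F §3
  «`ScaleAnchor` NOT HIT», print-faithful (2.13) at fixed k) and the (D1) numbers' drift ∕ sign (algebra of named one-loop numbers — NOT HIT); its ONLY box-wide ∀k letters are
  `U3TripleAtRecord13G`'s own (`ScaleShiftRate` ∕ `HistLipschitz` on `Box θ.γ` ∀k) — K3⁷'s typing call (CRIT-1's BN-F addendum, CRIT-2 2e §A «K3's typing call»), exposure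
  K3-SHARED exactly like T1∕ε₂₉ (№204);
(8.6) WHAT A RUN-KEYED N17 MUST SERVE THIS CONSUMER (CRIT-2 2e §B's flag «if K3 run-restricts, `endpointExistence_of_cornerSign` needs a run-keyed re-proof»): the every-slope
  telescoping reads N17 ONLY along `Fin.tail` chains, so it is re-typed for an ABSTRACT family of history sets `H k` that is TAIL-CLOSED and REACHES THE CORNER (`ShiftRateOn`,
  `TailClosed`, `ReachesCorner`): N17 on `H` + the per-scale anchor ⟹ the remainder at every height on `H ∩` small boxes (`everySlopeOn_of_shiftRateOn_cornerAnchor`); with `H ⊇`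
  the in-window run prefixes this IS DEF-1's `RunConstRemainder` at every height, and with the (D1) drift + run-wise (C) the END follows through DEF-1's run consumer
  `endpointExistence_of_drift_runConstRemainder_survCont` BY NAME (`endpointExistence_of_shiftRateOn_anchor_drift`) — the real-analysis AND the END halves of the flagged re-proof,
  generic in `H`; `H k := Box θ.γ k` is §1; naming the print-faithful `H` at the record (suffixes of in-window run prefixes pass BN-F's test up to N17-size margins) is K3⁷'s
  typing call and is NOT done here.
HONEST: hypothesis SHAPES and kernel junctions only; instance 0∕1 on every stub; nothing of Bałaban's β asserted; K2⁷ OPEN; the Clay YM mass gap is NOT proved by any of this —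
R4 ∕ `BalabanUVNodes` closes only the conditional finite-𝕋⁴ rung `BalabanLadder.UV`. -/

section Edition3

open Literature.MathematicalPhysics.QuantumFieldTheory.Balaban1983to89.B12Beta (HistBox)
open Literature.MathematicalPhysics.QuantumFieldTheory.Balaban1983to89.Beta.Drift (OneLoopDrift)
open Summit.QuantumFields.YangMills.Theorems.BalabanUVNodesK2JsOfRecord (StepColourData beta0OfJs)
open Summit.QuantumFields.YangMills.Theorems.BalabanUVNodesK2NamedJetsRemAt (RemAt ConstRemainder ScaleAnchor endpointExistence_of_remAt_drift)
open Summit.QuantumFields.YangMills.Theorems.BalabanUVNodesK2NamedJetsRunRemAt (RunRemAt RunConstRemainder SurvCont runRemAt_of_remAt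
  endpointExistence_of_drift_runConstRemainder_survCont)
open Summit.QuantumFields.YangMills.Theorems.EndpointGivenBR13SepCoPH.Negative.RemNamedJets13FalseOfTwoNormalisations (oneLoopDrift_const_mul)

/-! ### 8.1 Generic junctions: DEF-1's `ScaleAnchor` ⟺ §1's `CornerAnchor` (CRIT-2 J2, re-proved here); N17 + anchor MANUFACTURE `ConstRemainder` at every height -/

/-- J2 (⇒) (CRIT-2 ROUND 2c `Crit2Round2c.cornerAnchor_of_scaleAnchor`, re-proved in this namespace): DEF-1's per-scale anchor (over `B12Beta.HistBox`, no window clause) gives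
§1's corner anchor on every positive window (the two boxes are the same set, `FlowStep.histBox_eq_box`; the `δ ≤ γ` clause is free). [folklore] -/
theorem cornerAnchor_of_scaleAnchor {β : HBeta} {b : ℕ → ℝ} {γ : ℝ} (hγ : 0 < γ) (h : ScaleAnchor β b) : CornerAnchor b γ β := by
  intro k ε hε
  obtain ⟨γ', hγ', hA⟩ := h k ε hε
  refine ⟨min γ' γ, lt_min hγ' hγ, min_le_right _ _, fun v hv => hA v ?_⟩
  rw [histBox_eq_box]
  exact box_mono (min_le_left _ _) k hv

/-- J2 (⇐): §1's corner anchor gives DEF-1's per-scale anchor. [folklore] -/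
theorem scaleAnchor_of_cornerAnchor {β : HBeta} {b : ℕ → ℝ} {γ : ℝ} (h : CornerAnchor b γ β) : ScaleAnchor β b := by
  intro k δ hδ
  obtain ⟨δ', hδ', -, hA⟩ := h k δ hδ
  exact ⟨δ', hδ', fun p hp => hA p ((histBox_eq_box δ' k) ▸ hp)⟩

/-- **★ N17 + THE PER-SCALE ANCHOR MANUFACTURE DEF-1's CONSTANT REMAINDER AT EVERY HEIGHT `s > 0`** on some box `]0, γ_s] ⊆ ]0, γ]` — edition 1's every-slope telescoping
(`rebased_everySlope`) read in DEF-1's letter `ConstRemainder β b s γ_s`.  So the k-UNIFORM conjunct of v4's `RemAt` (with ANY cap `s ≤ …` by a positive number) carries no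
content beyond N17 + the identification. [folklore] -/
theorem constRemainder_of_scaleShiftRate_cornerAnchor {β : HBeta} {b : ℕ → ℝ} {c θ γ : ℝ} (hγ : 0 < γ) (hθ0 : 0 ≤ θ) (hθ1 : θ < 1)
    (hb : CornerAnchor b γ β) (h : ScaleShiftRate c θ γ β) {s : ℝ} (hs : 0 < s) :
    ∃ γs : ℝ, 0 < γs ∧ γs ≤ γ ∧ ConstRemainder β b s γs := by
  obtain ⟨γs, hγs, hle, hrem⟩ := rebased_everySlope hγ hθ0 hθ1 hb h hs
  refine ⟨γs, hγs, hle, fun k p hp => ?_⟩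
  have hp' : p ∈ Box γs k := (histBox_eq_box γs k) ▸ hp
  exact hrem k p hp'

/-! ### 8.2 The Cesàro junction: under N17 + anchor, a DRIFT of the named numbers pins their LIMIT (= (D1)'s slope) — (D1) ⟹ the corner sign -/

/-- The averages of a drifting sequence tend to the slope: `|Σ_{j<n} b_j − s·n| ≤ A` gives `|n⁻¹ Σ_{j<n} b_j − s| ≤ A∕n`. [folklore] -/
theorem tendsto_avg_of_oneLoopDrift {b : ℕ → ℝ} {s A : ℝ} (h : OneLoopDrift s A b) :
    Tendsto (fun n : ℕ => (n⁻¹ : ℝ) * ∑ i ∈ range n, b i) atTop (𝓝 s) := by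
  rw [Metric.tendsto_atTop]
  intro ε hε
  obtain ⟨N, hN⟩ := exists_nat_gt (A / ε)
  refine ⟨N + 1, fun n hn => ?_⟩
  have hNn : (N : ℝ) < n := by exact_mod_cast (Nat.lt_of_lt_of_le (Nat.lt_succ_self N) hn)
  have hnpos : (0 : ℝ) < (n : ℝ) := lt_of_le_of_lt (Nat.cast_nonneg N) hNn
  have hAε : A < n * ε := by
    have h1 : A / ε < n := hN.trans hNn
    rwa [div_lt_iff₀ hε] at h1
  have key : (n⁻¹ : ℝ) * ∑ i ∈ range n, b i - s = (n⁻¹ : ℝ) * (∑ i ∈ range n, b i - s * n) := by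
    have e1 : (n : ℝ)⁻¹ * (s * n) = s := by field_simp
    rw [mul_sub, e1]
  rw [Real.dist_eq, key, abs_mul, abs_of_pos (inv_pos.mpr hnpos)]
  calc (n : ℝ)⁻¹ * |∑ i ∈ range n, b i - s * n| ≤ (n : ℝ)⁻¹ * A := mul_le_mul_of_nonneg_left (h n) (inv_nonneg.mpr hnpos.le)
    _ < (n : ℝ)⁻¹ * (n * ε) := mul_lt_mul_of_pos_left hAε (inv_pos.mpr hnpos)
    _ = ε := by field_simp

/-- **UNDER N17 + A CORNER ANCHOR TO `cβ • b0` (`cβ > 0`), A DRIFT OF `b0` AT SLOPE `s` FORCES `b0_k → s`**: the anchoring numbers converge (`conv_of_scaleShiftRate_cornerAnchor`),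
so do `b0` and its Cesàro averages (`Filter.Tendsto.cesaro`); the drift sends the averages to `s`; limits are unique. [folklore] -/
theorem tendsto_named_of_anchor_drift {β : HBeta} {b0 : ℕ → ℝ} {c θ γ cβ s A : ℝ} (hγ : 0 < γ) (hθ1 : θ < 1)
    (h : ScaleShiftRate c θ γ β) (hcβ : 0 < cβ) (hA : CornerAnchor (fun k => cβ * b0 k) γ β) (hdrift : OneLoopDrift s A b0) :
    Tendsto b0 atTop (𝓝 s) := by
  obtain ⟨L, hL, -⟩ := conv_of_scaleShiftRate_cornerAnchor hγ hθ1 hA h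
  have hb0 : Tendsto b0 atTop (𝓝 (cβ⁻¹ * L)) := by
    refine (hL.const_mul cβ⁻¹).congr fun k => ?_
    show cβ⁻¹ * (cβ * b0 k) = b0 k
    rw [← mul_assoc, inv_mul_cancel₀ hcβ.ne', one_mul]
  have hLs : cβ⁻¹ * L = s := tendsto_nhds_unique hb0.cesaro (tendsto_avg_of_oneLoopDrift hdrift)
  rw [hLs] at hb0
  exact hb0

/-- … hence, for a POSITIVE slope, the named numbers are EVENTUALLY `≥ s∕2` — road (R-k)'s input (§7 `cornerSign_of_namedAnchor`). [folklore] -/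
theorem eventually_ge_of_anchor_drift {β : HBeta} {b0 : ℕ → ℝ} {c θ γ cβ s A : ℝ} (hγ : 0 < γ) (hθ1 : θ < 1)
    (h : ScaleShiftRate c θ γ β) (hcβ : 0 < cβ) (hA : CornerAnchor (fun k => cβ * b0 k) γ β) (hdrift : OneLoopDrift s A b0) (hs : 0 < s) :
    ∃ k₀ : ℕ, ∀ k, k₀ ≤ k → s / 2 ≤ b0 k := by
  have hev : ∀ᶠ k in atTop, s / 2 ≤ b0 k :=
    (tendsto_named_of_anchor_drift hγ hθ1 h hcβ hA hdrift).eventually (eventually_ge_nhds (half_lt_self hs))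
  exact Filter.eventually_atTop.mp hev

/-- **(8.4) THE SIGN JUNCTION — (D1)'s DRIFT IS ROAD (R-k)'s SUPPLIER**: under N17, a corner anchor to θ-covariantly named numbers `cβ • b0` that DRIFT at a positive slope gives
editions 1∕2's stub-3 conclusion (every corner-anchoring sequence has a positive limit — namely `cβ·s`). [cite: Balaban1987RG1, (1.3) p.260 and (2.12)-(2.14) p.268] -/
theorem cornerSign_of_namedAnchor_drift {β : HBeta} {b0 : ℕ → ℝ} {c θ γ cβ s A : ℝ} (hγ : 0 < γ) (hθ1 : θ < 1)
    (h : ScaleShiftRate c θ γ β) (hcβ : 0 < cβ) (hs : 0 < s) (hA : CornerAnchor (fun k => cβ * b0 k) γ β) (hdrift : OneLoopDrift s A b0) :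
    ∀ b : ℕ → ℝ, CornerAnchor b γ β → ∀ binf : ℝ, Tendsto b atTop (𝓝 binf) → 0 < binf :=
  cornerSign_of_namedAnchor hcβ (half_pos hs) hA (eventually_ge_of_anchor_drift hγ hθ1 h hcβ hA hdrift hs)

/-! ### 8.3 At the record: v4's texts (verbatim), CRIT-2 2e §B's re-keyed corner texts (verbatim), THE LOCATING `iff`, and the three-stub line concluding the crux BY NAME -/

/-- v4's STUB 2′ TEXT WITH J1's GUARD (v4 :209 `RemAtSomeJets` is un-guarded and implies this, `remAtSomeJetsG_of_v4`; K2⁷'s text has the guard `hU` in scope, so the guarded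
text composes identically, `EndpointGivenBR13SepCoPH_of_shadowingJetsG`).  A hypothesis SHAPE. [folklore] -/
def RemAtSomeJetsG : Prop :=
  ∀ (F : T4Family) (θ : Node00.Stage13HParams F 2) (hP : θ.Provisos₁₃SepCoPH F 2),
    (θ.ZhUnity F 2 ∧ θ.SlotsNondegenerate₁₃ F 2) → θ.Admissible F 2 → ∃ κ : StepColourData, RemAt F κ θ hP θ.cβ

/-- CRIT-2 ROUND 2e §B's `AnchorSomeJets13`, VERBATIM: at every guarded admissible proviso'd tuple SOME colour datum κ (chosen AFTER θ) whose `θ.cβ`-scaled named one-loop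
numbers are the per-scale zero-history limits of the record's β — the IDENTIFICATION ALONE (no remainder, no cap, no (C)).  Per-k shrinking boxes: BN-F §3 «NOT HIT»; κ after
θ and `θ.cβ` carried: immune to `Negative/RemNamedJets13FalseOfTwoNormalisations` (p592392); reads β on boxes only: immune to `Negative/Anchor13FalseOfTwoBaseHistories`
(p592695).  Size M per k (∃κ once).  A hypothesis SHAPE, instance 0∕1. [cite: Balaban1987RG1, (2.13) p.268] -/
def AnchorSomeJets13 : Prop :=
  ∀ (F : T4Family) (θ : Node00.Stage13HParams F 2) (hP : θ.Provisos₁₃SepCoPH F 2),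
    (θ.ZhUnity F 2 ∧ θ.SlotsNondegenerate₁₃ F 2) → θ.Admissible F 2 →
      ∃ κ : StepColourData, ScaleAnchor (Node00.datumOfRecord₁₃SepCoPH F 2 θ hP).βfun (fun k => θ.cβ * beta0OfJs F κ k)

/-- CRIT-2 ROUND 2e §B's `D1SignShadowingAnchor13`, VERBATIM: the named numbers of every colour datum ANCHORED at a guarded admissible record are EVENTUALLY `≥ e > 0`
(row (D1)'s one-loop law read for its SIGN only).  By 8.4 the WEAKER ask than (D1)'s drift under K3's letters. A hypothesis SHAPE. [cite: Balaban1987RG1, (1.3) p.260] -/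
def D1SignShadowingAnchor13 : Prop :=
  ∀ (F : T4Family) (κ : StepColourData) (θ : Node00.Stage13HParams F 2) (hP : θ.Provisos₁₃SepCoPH F 2),
    (θ.ZhUnity F 2 ∧ θ.SlotsNondegenerate₁₃ F 2) → θ.Admissible F 2 →
      ScaleAnchor (Node00.datumOfRecord₁₃SepCoPH F 2 θ hP).βfun (fun k => θ.cβ * beta0OfJs F κ k) →
        ∃ e : ℝ, 0 < e ∧ ∃ k₀ : ℕ, ∀ k, k₀ ≤ k → e ≤ beta0OfJs F κ k

/-- v4's REGISTERED STUB 1′ TEXT `D1AtShadowingJets` (v4 :216), VERBATIM (= the inline `h₁` of DEF-1's `EndpointGivenBR13SepCoPH_of_shadowingJets`, p593586 :269): row (D1)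
at the record carried by the named jets that SHADOW it (hypothesis `RemAt`), bare slope. A hypothesis SHAPE. [cite: Balaban1988RG2Cluster, Lemma 3 (2.38) p.20] -/
def D1AtShadowingJetsV4 : Prop :=
  ∀ (F : T4Family) (κ : StepColourData) (θ : Node00.Stage13HParams F 2) (hP : θ.Provisos₁₃SepCoPH F 2), θ.Admissible F 2 →
    RemAt F κ θ hP θ.cβ → ∃ A : ℝ, OneLoopDrift (B12Normalization.stepBal 2 F.L) A (beta0OfJs F κ)

/-- DEF-1's ANCHOR-KEYED (D1) USE FORM, VERBATIM (= hypothesis `h` of `d1AtShadowingJets_of_drift_of_anchor` p593586 and `hD1` of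
`EndpointGivenBR13SepCoPH_of_runShadowingJetsGivenB_anchorRoad` p596574; director-ym №23 «(D1) anchor-keyed text as THE (D1) stub»): row (D1) at the record for every colour
datum whose scaled named numbers are ANCHORED there. A hypothesis SHAPE. [cite: Balaban1988RG2Cluster, Lemma 3 (2.38) p.20] -/
def D1AtAnchoredJets : Prop :=
  ∀ (F : T4Family) (κ : StepColourData) (θ : Node00.Stage13HParams F 2) (hP : θ.Provisos₁₃SepCoPH F 2), θ.Admissible F 2 →
    ScaleAnchor (Node00.datumOfRecord₁₃SepCoPH F 2 θ hP).βfun (fun k => θ.cβ * beta0OfJs F κ k) →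
    ∃ A : ℝ, OneLoopDrift (B12Normalization.stepBal 2 F.L) A (beta0OfJs F κ)

/-- v4's un-guarded stub-2′ text (inline, VERBATIM v4 :209) implies the guarded one. [folklore] -/
theorem remAtSomeJetsG_of_v4
    (h₂ : ∀ (F : T4Family) (θ : Node00.Stage13HParams F 2) (hP : θ.Provisos₁₃SepCoPH F 2), θ.Admissible F 2 →
      ∃ κ : StepColourData, RemAt F κ θ hP θ.cβ) :
    RemAtSomeJetsG := fun F θ hP _ hθ => h₂ F θ hP hθ

/-- DEF-1's anchor-keyed (D1) form implies v4's registered stub-1′ text (`RemAt` carries the anchor; = `d1AtShadowingJets_of_drift_of_anchor`). [folklore] -/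
theorem d1AtShadowingJetsV4_of_anchored (h : D1AtAnchoredJets) : D1AtShadowingJetsV4 := fun F κ θ hP hθ hRem => by
  obtain ⟨-, -, -, -, -, -, hanch, -⟩ := hRem
  exact h F κ θ hP hθ hanch

/-- **LINE 1′ WITH J1's GUARD ON 2′ concludes the crux BY NAME** (DEF-1's composition with the guard threaded; the guard costs line 1′ nothing). [folklore] -/
theorem EndpointGivenBR13SepCoPH_of_shadowingJetsG (h₁ : D1AtShadowingJetsV4) (h₂ : RemAtSomeJetsG) :
    Summit.QuantumFields.YangMills.Theses.BalabanUVNodes.EndpointGivenBR13SepCoPH := by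
  unfold Summit.QuantumFields.YangMills.Theses.BalabanUVNodes.EndpointGivenBR13SepCoPH
  intro F θ hP hU hθ _hB _hwin
  obtain ⟨κ, hRem⟩ := h₂ F θ hP hU hθ
  obtain ⟨A, hdrift⟩ := h₁ F κ θ hP hθ hRem
  exact endpointExistence_of_remAt_drift F κ θ hP hRem hdrift

/-- (⇒, projection) the guarded stub 2′ yields CRIT-2's anchor stub. [folklore] -/
theorem anchorSomeJets13_of_remAtSomeJetsG (h : RemAtSomeJetsG) : AnchorSomeJets13 := fun F θ hP hU hθ => by
  obtain ⟨κ, -, -, -, -, -, -, hanch, -⟩ := h F θ hP hU hθ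
  exact ⟨κ, hanch⟩

/-- **★ (8.2) v4's LETTER MANUFACTURED, per tuple: `RemAt F κ θ hP θ.cβ` from K3⁷'s two letters on the datum's β (N17 `ScaleShiftRate c ρ θ.γ`, `0 ≤ ρ < 1`;
`HistLipschitz Λ θ.γ`) and the per-scale ANCHOR ALONE** — constant remainder at the height of the cap itself (`s := θ.cβ·stepBal 2 F.L > 0`, 8.1), box (C) from the modulus,
window `γ_s ≤ θ.γ`.  Nothing of Bałaban asserted (three hypothesis shapes in, one out). [cite: Balaban1987RG1, (1.20)-(1.22) p.264 and (2.12)-(2.14) p.268] -/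
theorem remAt_of_letters_scaleAnchor {F : T4Family} {κ : StepColourData} {θ : Node00.Stage13HParams F 2} {hP : θ.Provisos₁₃SepCoPH F 2}
    (hθ : θ.Admissible F 2) {c ρ : ℝ} {Λ : ℕ → ℕ → ℝ} (hρ0 : 0 ≤ ρ) (hρ1 : ρ < 1)
    (hss : ScaleShiftRate c ρ θ.γ (Node00.datumOfRecord₁₃SepCoPH F 2 θ hP).βfun)
    (hL : HistLipschitz Λ θ.γ (Node00.datumOfRecord₁₃SepCoPH F 2 θ hP).βfun)
    (hA : ScaleAnchor (Node00.datumOfRecord₁₃SepCoPH F 2 θ hP).βfun (fun k => θ.cβ * beta0OfJs F κ k)) :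
    RemAt F κ θ hP θ.cβ := by
  have hγ : 0 < θ.γ := hθ.toStage12.toStage9.gamma_pos
  have hcβ : 0 < θ.cβ := hθ.toStage9.chart.1
  have hsb : 0 < B12Normalization.stepBal 2 (F.L : ℝ) := B12Normalization.stepBal_pos two_pos (by exact_mod_cast F.hL.2)
  have hs : 0 < θ.cβ * B12Normalization.stepBal 2 (F.L : ℝ) := mul_pos hcβ hsb
  obtain ⟨γs, hγs, hle, hrem⟩ :=
    constRemainder_of_scaleShiftRate_cornerAnchor hγ hρ0 hρ1 (cornerAnchor_of_scaleAnchor hγ hA) hss hs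
  exact ⟨γs, θ.cβ * B12Normalization.stepBal 2 (F.L : ℝ), hγs, hle, le_rfl, hrem, hA,
    fun k => (T4BetaStationary.betaContH_of_histLipschitz hL k).mono (box_mono hle k)⟩

/-- **★★ (8.2) THE WALL LOCATED: `U3TripleAtRecord13G → AnchorSomeJets13 → RemAtSomeJetsG`** — given K3⁷'s letters, v4's XL stub 2′ IS the per-scale identification.
[cite: Balaban1987RG1, (1.20)-(1.22) p.264 and (2.13) p.268] -/
theorem remAtSomeJetsG_of_u3TripleG_anchor (h : U3TripleAtRecord13G) (hA : AnchorSomeJets13) : RemAtSomeJetsG := fun F θ hP hU hθ => by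
  obtain ⟨c, ρ, Λ, hρ0, hρ1, hss, hL⟩ := letters_of_u3TripleG h F θ hP hU hθ
  obtain ⟨κ, hanch⟩ := hA F θ hP hU hθ
  exact ⟨κ, remAt_of_letters_scaleAnchor hθ hρ0 hρ1 hss hL hanch⟩

/-- **★★ GIVEN `U3TripleAtRecord13G`: v4's (guarded) stub 2′ ⟺ CRIT-2's anchor stub.** [folklore] -/
theorem remAtSomeJetsG_iff_anchorSomeJets13 (h : U3TripleAtRecord13G) : RemAtSomeJetsG ↔ AnchorSomeJets13 :=
  ⟨anchorSomeJets13_of_remAtSomeJetsG, remAtSomeJetsG_of_u3TripleG_anchor h⟩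

/-- **★★★ (8.3a) THE THREE-STUB LINE ON v4's OWN LETTERS, concluding THE CRUX DECL BY NAME — with v4's REGISTERED stub-1′ text as the (D1) stub**:
`U3TripleAtRecord13G → AnchorSomeJets13 → D1AtShadowingJetsV4 → EndpointGivenBR13SepCoPH` (line 1′'s own road: 2′ manufactured, then DEF-1's composition).
CONDITIONAL on three hypothesis shapes; K2⁷ NOT closed. [cite: Balaban1987RG1, Thm 2 p.259 (first sentence), (1.20)-(1.22) p.264 and (2.12)-(2.14) p.268] -/
theorem EndpointGivenBR13SepCoPH_of_u3TripleG_anchor_d1V4 (h : U3TripleAtRecord13G) (hA : AnchorSomeJets13) (h₁ : D1AtShadowingJetsV4) :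
    Summit.QuantumFields.YangMills.Theses.BalabanUVNodes.EndpointGivenBR13SepCoPH :=
  EndpointGivenBR13SepCoPH_of_shadowingJetsG h₁ (remAtSomeJetsG_of_u3TripleG_anchor h hA)

/-- **★★★ (8.3b) … with DEF-1's ANCHOR-KEYED (D1) use form (director-ym №23 «THE (D1) stub») as the (D1) stub.** [cite: Balaban1987RG1, Thm 2 p.259 (first sentence) and (1.3) p.260] -/
theorem EndpointGivenBR13SepCoPH_of_u3TripleG_anchor_d1Anchored (h : U3TripleAtRecord13G) (hA : AnchorSomeJets13) (hD1 : D1AtAnchoredJets) :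
    Summit.QuantumFields.YangMills.Theses.BalabanUVNodes.EndpointGivenBR13SepCoPH :=
  EndpointGivenBR13SepCoPH_of_u3TripleG_anchor_d1V4 h hA (d1AtShadowingJetsV4_of_anchored hD1)

/-- CRIT-2's two re-keyed texts give editions 1∕2's guarded stub 3 (road (R-k), §7 `cornerSign_of_namedAnchor`). [cite: Balaban1987RG1, (2.13) p.268] -/
theorem cornerSignRecord13G_of_anchor_sign (hA : AnchorSomeJets13) (hs : D1SignShadowingAnchor13) : CornerSignRecord13G := by
  intro F θ hP hU hθ
  obtain ⟨κ, hanch⟩ := hA F θ hP hU hθ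
  obtain ⟨e, he, hev⟩ := hs F κ θ hP hU hθ hanch
  have hγ : 0 < θ.γ := hθ.toStage12.toStage9.gamma_pos
  exact cornerSign_of_namedAnchor hθ.toStage9.chart.1 he (cornerAnchor_of_scaleAnchor hγ hanch) hev

/-- **★★★ (8.3c) CRIT-2 ROUND 2e §B's v5 LINE 2 VERBATIM, concluding THE CRUX DECL BY NAME — the corner road**:
`U3TripleAtRecord13G → AnchorSomeJets13 → D1SignShadowingAnchor13 → EndpointGivenBR13SepCoPH` (§4's two-stub line fed by 8.3's stub 3).
[cite: Balaban1987RG1, Thm 2 p.259 (first sentence), (1.20)-(1.22) p.264 and (2.13) p.268] -/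
theorem EndpointGivenBR13SepCoPH_of_u3TripleG_anchor_sign (h : U3TripleAtRecord13G) (hA : AnchorSomeJets13) (hs : D1SignShadowingAnchor13) :
    Summit.QuantumFields.YangMills.Theses.BalabanUVNodes.EndpointGivenBR13SepCoPH :=
  EndpointGivenBR13SepCoPH_of_u3TripleG_cornerSignG h (cornerSignRecord13G_of_anchor_sign hA hs)

/-! ### 8.4 At the record: (D1)'s drift texts ⟹ CRIT-2's eventual-sign text, GIVEN K3⁷'s letters (the sign stub is the weaker ask) -/

/-- **v4's registered stub-1′ text ⟹ CRIT-2's eventual-sign text, given `U3TripleAtRecord13G`** (build `RemAt` by 8.2, take the drift, apply the Cesàro junction 8.2 with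
`e := stepBal 2 F.L ∕ 2`). [cite: Balaban1987RG1, (1.3) p.260 and (1.20)-(1.22) p.264] -/
theorem d1SignShadowingAnchor13_of_u3TripleG_d1V4 (h : U3TripleAtRecord13G) (h₁ : D1AtShadowingJetsV4) : D1SignShadowingAnchor13 := by
  intro F κ θ hP hU hθ hanch
  obtain ⟨c, ρ, Λ, hρ0, hρ1, hss, hL⟩ := letters_of_u3TripleG h F θ hP hU hθ
  obtain ⟨A, hdrift⟩ := h₁ F κ θ hP hθ (remAt_of_letters_scaleAnchor hθ hρ0 hρ1 hss hL hanch)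
  have hγ : 0 < θ.γ := hθ.toStage12.toStage9.gamma_pos
  have hsb : 0 < B12Normalization.stepBal 2 (F.L : ℝ) := B12Normalization.stepBal_pos two_pos (by exact_mod_cast F.hL.2)
  exact ⟨B12Normalization.stepBal 2 (F.L : ℝ) / 2, half_pos hsb,
    eventually_ge_of_anchor_drift hγ hρ1 hss hθ.toStage9.chart.1 (cornerAnchor_of_scaleAnchor hγ hanch) hdrift hsb⟩

/-- … and DEF-1's anchor-keyed (D1) form ⟹ CRIT-2's eventual-sign text, given `U3TripleAtRecord13G`. [folklore] -/
theorem d1SignShadowingAnchor13_of_u3TripleG_d1Anchored (h : U3TripleAtRecord13G) (hD1 : D1AtAnchoredJets) : D1SignShadowingAnchor13 :=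
  d1SignShadowingAnchor13_of_u3TripleG_d1V4 h (d1AtShadowingJetsV4_of_anchored hD1)

/-! ### 8.5 BN-F placement, kernel part: the RUN letter 2ᴮ″ is manufactured too; the (B)-weakened anchor text composes identically -/

/-- **2ᴮ″ MANUFACTURED: `U3TripleAtRecord13G → AnchorSomeJets13 →` DEF-1's run-wise stub-2ᴮ″ text** (inline, VERBATIM = `h₂` of `EndpointGivenBR13SepCoPH_of_runShadowingJetsGivenB`,
p596574; `RemAt ⟹ RunRemAt` by `runRemAt_of_remAt`; the (B) hypothesis is unread).  So on the corner line the run re-keying of NODE O's wall changes nothing that node O owes: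
the box-wide ∀k content sits in `U3TripleAtRecord13G` (K3⁷'s typing call). [cite: Balaban1987RG1, Thm 3 p.264 and (2.13) p.268] -/
theorem runRemAtSomeJetsGivenB_of_u3TripleG_anchor (h : U3TripleAtRecord13G) (hA : AnchorSomeJets13) :
    ∀ (F : T4Family) (θ : Node00.Stage13HParams F 2) (hP : θ.Provisos₁₃SepCoPH F 2),
      (θ.ZhUnity F 2 ∧ θ.SlotsNondegenerate₁₃ F 2) → θ.Admissible F 2 →
      B16.EndStatementBPrinted (Node00.datumOfRecord₁₃SepCoPH F 2 θ hP).C →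
      ∃ κ : StepColourData, RunRemAt F κ θ hP θ.cβ := fun F θ hP hU hθ _ => by
  obtain ⟨κ, hRem⟩ := remAtSomeJetsG_of_u3TripleG_anchor h hA F θ hP hU hθ
  exact ⟨κ, runRemAt_of_remAt F κ θ hP hRem⟩

/-- (projection) DEF-1's stub-2ᴮ″ text yields the anchor text WEAKENED by the item's (B) hypothesis (which K2⁷'s text has in scope, `hB`). [folklore] -/
theorem anchorGivenB_of_runRemAtSomeJetsGivenB
    (h₂ : ∀ (F : T4Family) (θ : Node00.Stage13HParams F 2) (hP : θ.Provisos₁₃SepCoPH F 2),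
      (θ.ZhUnity F 2 ∧ θ.SlotsNondegenerate₁₃ F 2) → θ.Admissible F 2 →
      B16.EndStatementBPrinted (Node00.datumOfRecord₁₃SepCoPH F 2 θ hP).C →
      ∃ κ : StepColourData, RunRemAt F κ θ hP θ.cβ) :
    ∀ (F : T4Family) (θ : Node00.Stage13HParams F 2) (hP : θ.Provisos₁₃SepCoPH F 2),
      (θ.ZhUnity F 2 ∧ θ.SlotsNondegenerate₁₃ F 2) → θ.Admissible F 2 →
      B16.EndStatementBPrinted (Node00.datumOfRecord₁₃SepCoPH F 2 θ hP).C →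
      ∃ κ : StepColourData, ScaleAnchor (Node00.datumOfRecord₁₃SepCoPH F 2 θ hP).βfun (fun k => θ.cβ * beta0OfJs F κ k) :=
  fun F θ hP hU hθ hB => by
  obtain ⟨κ, -, -, -, -, -, -, hanch, -⟩ := h₂ F θ hP hU hθ hB
  exact ⟨κ, hanch⟩

/-- **(8.3d) the three-stub line with the (B)-WEAKENED anchor text** (the weakest identification stub that still composes: guard ∧ admissible ∧ (B) → ∃κ anchor) **and the
anchor-keyed (D1) stub, concluding THE CRUX DECL BY NAME.** [cite: Balaban1987RG1, Thm 2 p.259 (first sentence), (1.20)-(1.22) p.264 and (2.13) p.268] -/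
theorem EndpointGivenBR13SepCoPH_of_u3TripleG_anchorGivenB_d1Anchored (h : U3TripleAtRecord13G)
    (hA : ∀ (F : T4Family) (θ : Node00.Stage13HParams F 2) (hP : θ.Provisos₁₃SepCoPH F 2),
      (θ.ZhUnity F 2 ∧ θ.SlotsNondegenerate₁₃ F 2) → θ.Admissible F 2 →
      B16.EndStatementBPrinted (Node00.datumOfRecord₁₃SepCoPH F 2 θ hP).C →
      ∃ κ : StepColourData, ScaleAnchor (Node00.datumOfRecord₁₃SepCoPH F 2 θ hP).βfun (fun k => θ.cβ * beta0OfJs F κ k))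
    (hD1 : D1AtAnchoredJets) :
    Summit.QuantumFields.YangMills.Theses.BalabanUVNodes.EndpointGivenBR13SepCoPH := by
  unfold Summit.QuantumFields.YangMills.Theses.BalabanUVNodes.EndpointGivenBR13SepCoPH
  intro F θ hP hU hθ hB _hwin
  obtain ⟨c, ρ, Λ, hρ0, hρ1, hss, hL⟩ := letters_of_u3TripleG h F θ hP hU hθ
  obtain ⟨κ, hanch⟩ := hA F θ hP hU hθ hB
  have hRem : RemAt F κ θ hP θ.cβ := remAt_of_letters_scaleAnchor hθ hρ0 hρ1 hss hL hanch
  obtain ⟨A, hdrift⟩ := hD1 F κ θ hP hθ hanch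
  exact endpointExistence_of_remAt_drift F κ θ hP hRem hdrift

/-! ### 8.6 For CRIT-2 2e §B's flag: the every-slope telescoping and the END re-typed for N17 on an ABSTRACT TAIL-CLOSED FAMILY of history sets (run-keyable), through DEF-1's run consumer BY NAME

What the corner consumer READS of N17: only the steps `β_{k+1}(w) − β_k(tail w)` along `Fin.tail` chains ending in small boxes.  So N17 is re-typed ON a family
`H k ⊆ (Fin (k+1) → ℝ)` that is TAIL-CLOSED and REACHES THE CORNER; `H k := Box θ.γ k` is §1 verbatim (box-wide, BN-F (N3) exposed — K3's letter as typed today);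
a run-keyed N17 (suffix-closed in-window run prefixes of the datum's construction, print-faithful per BN-F §3 up to N17-size margins) is ANOTHER instance — naming it at
the record is K3⁷'s typing call (node U2 ∕ `T4CouplingMatching`), NOT done here.  Given such an `H` containing the in-window run prefixes, the (D1) drift and run-wise (C),
the END follows through DEF-1's `endpointExistence_of_drift_runConstRemainder_survCont` (p596574) BY NAME. -/

/-- HYPOTHESIS SHAPE: **N17's scale-shift rate read ONLY ON a family `H` of history sets** — `|β_{k+1}(w) − β_k(tail w)| ≤ c·θ^k` for `w ∈ H (k+1)`.
`ShiftRateOn (fun k => Box γ k) c θ β` is `ScaleShiftRate c θ γ β` (`shiftRateOn_box_iff`). A predicate, never a fact. [cite: Balaban1987RG1, (1.20)-(1.22) p.264] -/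
def ShiftRateOn (H : ∀ k : ℕ, Set (Fin (k + 1) → ℝ)) (c θ : ℝ) (β : HBeta) : Prop :=
  ∀ (k : ℕ) (w : Fin (k + 2) → ℝ), w ∈ H (k + 1) → |β (k + 1) w - β k (Fin.tail w)| ≤ c * θ ^ k

/-- The family is **TAIL-CLOSED**: dropping the last-listed coupling keeps membership (what the telescoping reads; boxes are, `tail_mem_box`). [folklore] -/
def TailClosed (H : ∀ k : ℕ, Set (Fin (k + 1) → ℝ)) : Prop :=
  ∀ (k : ℕ) (w : Fin (k + 2) → ℝ), w ∈ H (k + 1) → Fin.tail w ∈ H k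

/-- The family **REACHES THE CORNER**: at every scale it has members inside every small box (boxes do — the diagonal; in-window runs from arbitrarily small bare
couplings would). [folklore] -/
def ReachesCorner (H : ∀ k : ℕ, Set (Fin (k + 1) → ℝ)) : Prop :=
  ∀ (k : ℕ) (δ : ℝ), 0 < δ → ∃ w : Fin (k + 2) → ℝ, w ∈ H (k + 1) ∧ w ∈ Box δ (k + 1)

/-- The box family is §1's setting: `ShiftRateOn Box ⟺ ScaleShiftRate`. [folklore] -/
theorem shiftRateOn_box_iff {c θ γ : ℝ} {β : HBeta} : ShiftRateOn (fun k => Box γ k) c θ β ↔ ScaleShiftRate c θ γ β := Iff.rfl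

/-- Boxes are tail-closed. [folklore] -/
theorem tailClosed_box (γ : ℝ) : TailClosed (fun k => Box γ k) := fun _ _ hw => tail_mem_box hw

/-- Boxes of positive level reach the corner (the diagonal history `(t,…,t)`, `t := min γ δ`). [folklore] -/
theorem reachesCorner_box {γ : ℝ} (hγ : 0 < γ) : ReachesCorner (fun k => Box γ k) := fun _ δ hδ =>
  ⟨fun _ => min γ δ, mem_box.mpr fun _ => ⟨lt_min hγ hδ, min_le_left _ _⟩, mem_box.mpr fun _ => ⟨lt_min hγ hδ, min_le_right _ _⟩⟩

/-- A family that reaches the corner makes N17's constant nonnegative. [folklore] -/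
theorem shiftRateOn_const_nonneg {H : ∀ k : ℕ, Set (Fin (k + 1) → ℝ)} {c θ : ℝ} {β : HBeta} (hR : ReachesCorner H) (h : ShiftRateOn H c θ β) : 0 ≤ c := by
  obtain ⟨w, hwH, -⟩ := hR 0 1 one_pos
  have h0 := h 0 w hwH
  rw [pow_zero, mul_one] at h0
  exact (abs_nonneg _).trans h0

/-- The CORNER STEP on `H`: N17 on `H` + corner anchor ⟹ `|b_{k+1} − b_k| ≤ c·θ^k` (test history: a member of `H (k+1)` inside both anchoring boxes). [folklore] -/
theorem abs_step_le_of_shiftRateOn_cornerAnchor {H : ∀ k : ℕ, Set (Fin (k + 1) → ℝ)} {β : HBeta} {b : ℕ → ℝ} {c θ γ : ℝ}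
    (hb : CornerAnchor b γ β) (hR : ReachesCorner H) (h : ShiftRateOn H c θ β) (k : ℕ) : |b (k + 1) - b k| ≤ c * θ ^ k := by
  refine le_of_forall_pos_le_add fun ε hε => ?_
  obtain ⟨γ₁, hγ₁, -, hA₁⟩ := hb (k + 1) (ε / 2) (half_pos hε)
  obtain ⟨γ₀, hγ₀, -, hA₀⟩ := hb k (ε / 2) (half_pos hε)
  obtain ⟨w, hwH, hw⟩ := hR k (min γ₁ γ₀) (lt_min hγ₁ hγ₀)
  have hw₁ : w ∈ Box γ₁ (k + 1) := box_mono (min_le_left _ _) _ hw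
  have hw₀ : Fin.tail w ∈ Box γ₀ k := tail_mem_box (box_mono (min_le_right _ _) _ hw)
  have h1 : |β (k + 1) w - β k (Fin.tail w)| ≤ c * θ ^ k := h k w hwH
  have h2 : |β (k + 1) w - b (k + 1)| ≤ ε / 2 := hA₁ w hw₁
  have h3 : |β k (Fin.tail w) - b k| ≤ ε / 2 := hA₀ (Fin.tail w) hw₀
  have e : b (k + 1) - b k = ((β (k + 1) w - β k (Fin.tail w)) - (β (k + 1) w - b (k + 1))) + (β k (Fin.tail w) - b k) := by ring
  rw [e]
  calc |((β (k + 1) w - β k (Fin.tail w)) - (β (k + 1) w - b (k + 1))) + (β k (Fin.tail w) - b k)|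
      ≤ |(β (k + 1) w - β k (Fin.tail w)) - (β (k + 1) w - b (k + 1))| + |β k (Fin.tail w) - b k| := abs_add_le _ _
    _ ≤ (|β (k + 1) w - β k (Fin.tail w)| + |β (k + 1) w - b (k + 1)|) + |β k (Fin.tail w) - b k| :=
        add_le_add (abs_sub _ _) le_rfl
    _ ≤ (c * θ ^ k + ε / 2) + ε / 2 := add_le_add (add_le_add h1 h2) h3
    _ = c * θ ^ k + ε := by ring

/-- Re-based iteration ON `H`: from a base bound at scale `k₀` on `Box δ k₀`, the telescoping along `Fin.tail` chains inside `H` bounds `|β_{k₀+m}(v) − b_{k₀+m}|` on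
`H (k₀+m) ∩ Box δ (k₀+m)`. [folklore] -/
theorem rebased_iterateOn {H : ∀ k : ℕ, Set (Fin (k + 1) → ℝ)} {β : HBeta} {b : ℕ → ℝ} {c θ γ δ : ℝ}
    (hb : CornerAnchor b γ β) (hT : TailClosed H) (hR : ReachesCorner H) (h : ShiftRateOn H c θ β)
    (k₀ : ℕ) {e : ℝ} (hbase : ∀ v ∈ Box δ k₀, |β k₀ v - b k₀| ≤ e) :
    ∀ m : ℕ, ∀ v, v ∈ H (k₀ + m) → v ∈ Box δ (k₀ + m) → |β (k₀ + m) v - b (k₀ + m)| ≤ e + ∑ j ∈ range m, 2 * c * θ ^ (k₀ + j) := by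
  intro m
  induction m with
  | zero => intro v _ hv; simpa using hbase v hv
  | succ m ih =>
    intro v hvH hv
    have hs : |β (k₀ + m + 1) v - β (k₀ + m) (Fin.tail v)| ≤ c * θ ^ (k₀ + m) := h (k₀ + m) v hvH
    have hbs : |b (k₀ + m + 1) - b (k₀ + m)| ≤ c * θ ^ (k₀ + m) := abs_step_le_of_shiftRateOn_cornerAnchor hb hR h (k₀ + m)
    have ht : |β (k₀ + m) (Fin.tail v) - b (k₀ + m)| ≤ e + ∑ j ∈ range m, 2 * c * θ ^ (k₀ + j) :=
      ih (Fin.tail v) (hT (k₀ + m) v hvH) (tail_mem_box hv)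
    have eq : β (k₀ + m + 1) v - b (k₀ + m + 1)
        = (β (k₀ + m + 1) v - β (k₀ + m) (Fin.tail v)) - (b (k₀ + m + 1) - b (k₀ + m)) + (β (k₀ + m) (Fin.tail v) - b (k₀ + m)) := by ring
    show |β (k₀ + m + 1) v - b (k₀ + m + 1)| ≤ e + ∑ j ∈ range (m + 1), 2 * c * θ ^ (k₀ + j)
    rw [Finset.sum_range_succ, eq]
    calc |(β (k₀ + m + 1) v - β (k₀ + m) (Fin.tail v)) - (b (k₀ + m + 1) - b (k₀ + m)) + (β (k₀ + m) (Fin.tail v) - b (k₀ + m))|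
        ≤ |(β (k₀ + m + 1) v - β (k₀ + m) (Fin.tail v)) - (b (k₀ + m + 1) - b (k₀ + m))| + |β (k₀ + m) (Fin.tail v) - b (k₀ + m)| :=
          abs_add_le _ _
      _ ≤ (|β (k₀ + m + 1) v - β (k₀ + m) (Fin.tail v)| + |b (k₀ + m + 1) - b (k₀ + m)|) + |β (k₀ + m) (Fin.tail v) - b (k₀ + m)| :=
          add_le_add (abs_sub _ _) le_rfl
      _ ≤ (c * θ ^ (k₀ + m) + c * θ ^ (k₀ + m)) + (e + ∑ j ∈ range m, 2 * c * θ ^ (k₀ + j)) := add_le_add (add_le_add hs hbs) ht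
      _ = e + (∑ j ∈ range m, 2 * c * θ ^ (k₀ + j) + 2 * c * θ ^ (k₀ + m)) := by ring

/-- **★ EVERY-SLOPE ON `H` (the real-analysis half of CRIT-2 2e §B's flagged re-proof, generic):** N17 ON a tail-closed corner-reaching family + the corner anchor ⟹ for
every `s > 0` a level `γ_s ≤ γ` with `|β_k(v) − b_k| ≤ s` for ALL `k` and all `v ∈ H k ∩ Box γ_s k`. [cite: Balaban1987RG1, (1.20)-(1.22) p.264 and (2.13) p.268] -/
theorem everySlopeOn_of_shiftRateOn_cornerAnchor {H : ∀ k : ℕ, Set (Fin (k + 1) → ℝ)} {β : HBeta} {b : ℕ → ℝ} {c θ γ : ℝ} (hθ0 : 0 ≤ θ) (hθ1 : θ < 1)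
    (hb : CornerAnchor b γ β) (hT : TailClosed H) (hR : ReachesCorner H) (h : ShiftRateOn H c θ β) {s : ℝ} (hs : 0 < s) :
    ∃ γs : ℝ, 0 < γs ∧ γs ≤ γ ∧ ∀ k, ∀ v, v ∈ H k → v ∈ Box γs k → |β k v - b k| ≤ s := by
  have hc : 0 ≤ c := shiftRateOn_const_nonneg hR h
  have h1 : 0 < 1 - θ := by linarith
  set ε : ℝ := s / 2 * (1 - θ) / (2 * c + 1) with hε
  have hεpos : 0 < ε := by positivity
  obtain ⟨k₀, hk₀⟩ := exists_pow_lt_of_lt_one hεpos hθ1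
  obtain ⟨δ, hδ, hδγ, ha⟩ := cornerAnchor_upTo hb k₀ (half_pos hs)
  refine ⟨δ, hδ, hδγ, fun k v hvH hv => ?_⟩
  rcases Nat.lt_or_ge k₀ k with hk | hk
  · obtain ⟨m, rfl⟩ := Nat.exists_eq_add_of_le hk.le
    have hiter := rebased_iterateOn hb hT hR h k₀ (fun v hv => ha k₀ le_rfl v hv) m v hvH hv
    have htail : ∑ j ∈ range m, 2 * c * θ ^ (k₀ + j) ≤ s / 2 := by
      have hsum : ∑ j ∈ range m, 2 * c * θ ^ (k₀ + j) = 2 * c * θ ^ k₀ * ∑ j ∈ range m, θ ^ j := by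
        rw [Finset.mul_sum]
        refine Finset.sum_congr rfl fun j _ => ?_
        rw [pow_add]; ring
      rw [hsum]
      have hpk : 0 ≤ θ ^ k₀ := pow_nonneg hθ0 k₀
      calc 2 * c * θ ^ k₀ * ∑ j ∈ range m, θ ^ j
          ≤ 2 * c * θ ^ k₀ * (1 - θ)⁻¹ :=
            mul_le_mul_of_nonneg_left (geom_tail_le hθ0 hθ1 m) (mul_nonneg (by positivity) hpk)
        _ ≤ (2 * c + 1) * ε * (1 - θ)⁻¹ := by
            apply mul_le_mul_of_nonneg_right _ (inv_nonneg.mpr h1.le)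
            calc 2 * c * θ ^ k₀ ≤ (2 * c + 1) * θ ^ k₀ := by nlinarith
              _ ≤ (2 * c + 1) * ε := mul_le_mul_of_nonneg_left hk₀.le (by linarith)
        _ = s / 2 := by rw [hε]; field_simp
    linarith
  · exact (ha k hk v hv).trans (half_le_self hs.le)

/-- §1's `rebased_everySlope` is the box instance. [folklore] -/
theorem rebased_everySlope_of_on {β : HBeta} {b : ℕ → ℝ} {c θ γ : ℝ} (hγ : 0 < γ) (hθ0 : 0 ≤ θ) (hθ1 : θ < 1)
    (hb : CornerAnchor b γ β) (h : ScaleShiftRate c θ γ β) {s : ℝ} (hs : 0 < s) :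
    ∃ γs : ℝ, 0 < γs ∧ γs ≤ γ ∧ ∀ k, ∀ v ∈ Box γs k, |β k v - b k| ≤ s := by
  obtain ⟨γs, hγs, hle, hrem⟩ :=
    everySlopeOn_of_shiftRateOn_cornerAnchor hθ0 hθ1 hb (tailClosed_box γ) (reachesCorner_box hγ) (shiftRateOn_box_iff.mpr h) hs
  exact ⟨γs, hγs, hle, fun k v hv => hrem k v (box_mono hle k hv) hv⟩

/-- **N17 ON A FAMILY CONTAINING THE IN-WINDOW RUN PREFIXES + corner anchor ⟹ DEF-1's `RunConstRemainder` AT EVERY HEIGHT** on some level `γ_s ≤ γ`.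
[cite: Balaban1987RG1, Thm 3 p.264 and (1.20)-(1.22) p.264] -/
theorem runConstRemainder_of_shiftRateOn_cornerAnchor {H : ∀ k : ℕ, Set (Fin (k + 1) → ℝ)} {β : HBeta} {b : ℕ → ℝ} {c θ γ : ℝ} (hθ0 : 0 ≤ θ) (hθ1 : θ < 1)
    (hb : CornerAnchor b γ β) (hT : TailClosed H) (hR : ReachesCorner H) (h : ShiftRateOn H c θ β)
    (hruns : ∀ (n : ℕ) (gs : ℕ → ℝ), RGEqH n β gs → Step.InInterval γ n gs → ∀ k, k ≤ n → prefixOf gs k ∈ H k) {s : ℝ} (hs : 0 < s) :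
    ∃ γs : ℝ, 0 < γs ∧ γs ≤ γ ∧ RunConstRemainder β b s γs := by
  obtain ⟨γs, hγs, hle, hrem⟩ := everySlopeOn_of_shiftRateOn_cornerAnchor hθ0 hθ1 hb hT hR h hs
  refine ⟨γs, hγs, hle, fun n gs hrg hI k hk => hrem k (prefixOf gs k) ?_ ?_⟩
  · exact hruns n gs hrg (fun j hj => ⟨(hI j hj).1, (hI j hj).2.trans hle⟩) k hk
  · exact mem_box.mpr fun i => hI i ((Nat.lt_succ_iff.mp i.isLt).trans hk)

/-- **★★ (8.6) THE END FROM N17 ON A RUN-CONTAINING TAIL-CLOSED CORNER-REACHING FAMILY, the corner anchor to `cβ • b0`, (D1)'s drift of `b0` at slope `s > 0`, and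
run-wise (C)** — through DEF-1's run consumer `endpointExistence_of_drift_runConstRemainder_survCont` BY NAME (remainder at the height of the rescaled slope `cβ·s`, cap
`le_rfl`; drift rescaled by `oneLoopDrift_const_mul`).  Both halves of CRIT-2 2e §B's flagged run-keyed re-proof, generic in `H`; with `H := Box` and
`hsc := SurvCont.of_betaContH` it is editions 1∕2's road. CONDITIONAL on hypothesis shapes; nothing of Bałaban asserted.
[cite: Balaban1987RG1, Thm 2 p.259 (first sentence), Thm 3 p.264 and (5.10) p.293] -/
theorem endpointExistence_of_shiftRateOn_anchor_drift {Cn : B12.Construction} {β : HBeta} (hgen : ForwardGenerated Cn β)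
    {H : ∀ k : ℕ, Set (Fin (k + 1) → ℝ)} (hT : TailClosed H) (hR : ReachesCorner H) {γ : ℝ}
    (hruns : ∀ (n : ℕ) (gs : ℕ → ℝ), RGEqH n β gs → Step.InInterval γ n gs → ∀ k, k ≤ n → prefixOf gs k ∈ H k)
    {c θ : ℝ} (hθ0 : 0 ≤ θ) (hθ1 : θ < 1) (h : ShiftRateOn H c θ β)
    {b0 : ℕ → ℝ} {cβ s A : ℝ} (hcβ : 0 < cβ) (hs : 0 < s) (hA : CornerAnchor (fun k => cβ * b0 k) γ β) (hdrift : OneLoopDrift s A b0)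
    (hsc : ∀ γ₀ : ℝ, 0 < γ₀ → γ₀ ≤ γ → SurvCont β γ₀) : EndpointExistence Cn := by
  obtain ⟨γs, hγs, hle, hrun⟩ := runConstRemainder_of_shiftRateOn_cornerAnchor hθ0 hθ1 hA hT hR h hruns (mul_pos hcβ hs)
  exact endpointExistence_of_drift_runConstRemainder_survCont hgen hγs (oneLoopDrift_const_mul hdrift cβ) hrun le_rfl (hsc γs hγs hle)

/-! ### 8.7 AT v5's KEYING (plan g82's skeleton OF RECORD `D82-K2V5/K2Skeleton13SepCoPHv5.lean` 16e2ea6200bb4554, REGISTERED 2026-08-28T02:22:53Z; director-ym №204 T1 decision: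
every stub keyed on the crux's FULL prefix `guard → Admissible → (B) → Window13`): the corner line's three texts and the compositions concluding the crux BY NAME, POINTWISE
— the texts CRIT-2's pre-registration ASK (iii) (STATUS l.1618) names, supplied at v5's keying; v5's own 2′∕1′ texts VERBATIM; the located `iff` at v5's keying. -/

/-- K2⁷'s WINDOW hypothesis at `(F, θ, hP)`, VERBATIM from the crux text (= v5's `K2Skeleton13SepCoPH.Window13`, same text; a skeleton is not importable here). [folklore] -/
def Window13 (F : T4Family) (θ : Node00.Stage13HParams F 2) (hP : θ.Provisos₁₃SepCoPH F 2) : Prop :=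
  ∃ γ₁ : ℝ, 0 < γ₁ ∧ ∀ γ : ℝ, 0 < γ → γ ≤ γ₁ → ∃ P : B12.RunParams, 1 ≤ P.K ∧ ((Node00.datumOfRecord₁₃SepCoPH F 2 θ hP).C P).flow.InInterval γ P.K

/-- v5's REGISTERED STUB 2′ TEXT `RemAtSomeJets` (v5 :240), VERBATIM. A hypothesis SHAPE. [cite: Balaban1987RG1, (2.12)-(2.14) p.268] -/
def RemAtSomeJetsV5 : Prop :=
  ∀ (F : T4Family) (θ : Node00.Stage13HParams F 2) (hP : θ.Provisos₁₃SepCoPH F 2), (θ.ZhUnity F 2 ∧ θ.SlotsNondegenerate₁₃ F 2) → θ.Admissible F 2 →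
    B16.EndStatementBPrinted (Node00.datumOfRecord₁₃SepCoPH F 2 θ hP).C → Window13 F θ hP →
    ∃ κ : StepColourData, RemAt F κ θ hP θ.cβ

/-- v5's REGISTERED STUB 1′ TEXT `D1AtShadowingJets` (v5 :248), VERBATIM. A hypothesis SHAPE. [cite: Balaban1988RG2Cluster, Lemma 3 (2.38) p.20] -/
def D1AtShadowingJetsV5 : Prop :=
  ∀ (F : T4Family) (κ : StepColourData) (θ : Node00.Stage13HParams F 2) (hP : θ.Provisos₁₃SepCoPH F 2), (θ.ZhUnity F 2 ∧ θ.SlotsNondegenerate₁₃ F 2) → θ.Admissible F 2 →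
    B16.EndStatementBPrinted (Node00.datumOfRecord₁₃SepCoPH F 2 θ hP).C → Window13 F θ hP →
    RemAt F κ θ hP θ.cβ → ∃ A : ℝ, OneLoopDrift (B12Normalization.stepBal 2 F.L) A (beta0OfJs F κ)

/-- CRIT-1's asked one-token swap `RemAt ↦ RunRemAt` of v5's stub 2′ (= DEF-1's `h₂` of `EndpointGivenBR13SepCoPH_of_runShadowingJetsGivenB` with `Window13` threaded).
A hypothesis SHAPE. [cite: Balaban1987RG1, Thm 3 p.264 and (2.13) p.268] -/
def RunRemAtSomeJetsV5 : Prop :=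
  ∀ (F : T4Family) (θ : Node00.Stage13HParams F 2) (hP : θ.Provisos₁₃SepCoPH F 2), (θ.ZhUnity F 2 ∧ θ.SlotsNondegenerate₁₃ F 2) → θ.Admissible F 2 →
    B16.EndStatementBPrinted (Node00.datumOfRecord₁₃SepCoPH F 2 θ hP).C → Window13 F θ hP →
    ∃ κ : StepColourData, RunRemAt F κ θ hP θ.cβ

/-- §4's K3-shared merged letter `U3TripleAtRecord13G` at v5's keying (same body; RHS of the landed U3 read-out `iff`). A hypothesis SHAPE.
[cite: Balaban1987RG1, (1.20)-(1.22) p.264, (2.9) p.266] -/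
def U3TripleAtRecord13K : Prop :=
  ∀ (F : T4Family) (θ : Node00.Stage13HParams F 2) (hP : θ.Provisos₁₃SepCoPH F 2), (θ.ZhUnity F 2 ∧ θ.SlotsNondegenerate₁₃ F 2) → θ.Admissible F 2 →
    B16.EndStatementBPrinted (Node00.datumOfRecord₁₃SepCoPH F 2 θ hP).C → Window13 F θ hP →
      ∃ (c C ρ : ℝ) (Λ : ℕ → ℕ → ℝ), 0 ≤ c ∧ 0 < ρ ∧ ρ < 1 ∧
        ScaleShiftRate c ρ θ.γ (Node00.datumOfRecord₁₃SepCoPH F 2 θ hP).βfun ∧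
          HistLipschitz Λ θ.γ (Node00.datumOfRecord₁₃SepCoPH F 2 θ hP).βfun ∧ T4CouplingMatching.FadingMemory C ρ Λ

/-- CRIT-2 2e §B's `AnchorSomeJets13` at v5's keying: THE IDENTIFICATION STUB (per-k, ∃κ after θ, `θ.cβ` carried; BN-F NOT HIT; immune to p592392 ∕ p592695). A hypothesis SHAPE.
[cite: Balaban1987RG1, (2.13) p.268] -/
def AnchorSomeJets13K : Prop :=
  ∀ (F : T4Family) (θ : Node00.Stage13HParams F 2) (hP : θ.Provisos₁₃SepCoPH F 2), (θ.ZhUnity F 2 ∧ θ.SlotsNondegenerate₁₃ F 2) → θ.Admissible F 2 →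
    B16.EndStatementBPrinted (Node00.datumOfRecord₁₃SepCoPH F 2 θ hP).C → Window13 F θ hP →
      ∃ κ : StepColourData, ScaleAnchor (Node00.datumOfRecord₁₃SepCoPH F 2 θ hP).βfun (fun k => θ.cβ * beta0OfJs F κ k)

/-- CRIT-2 2e §B's `D1SignShadowingAnchor13` at v5's keying (eventual sign of the anchoring named numbers). A hypothesis SHAPE. [cite: Balaban1987RG1, (1.3) p.260] -/
def D1SignShadowingAnchor13K : Prop :=
  ∀ (F : T4Family) (κ : StepColourData) (θ : Node00.Stage13HParams F 2) (hP : θ.Provisos₁₃SepCoPH F 2), (θ.ZhUnity F 2 ∧ θ.SlotsNondegenerate₁₃ F 2) → θ.Admissible F 2 →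
    B16.EndStatementBPrinted (Node00.datumOfRecord₁₃SepCoPH F 2 θ hP).C → Window13 F θ hP →
      ScaleAnchor (Node00.datumOfRecord₁₃SepCoPH F 2 θ hP).βfun (fun k => θ.cβ * beta0OfJs F κ k) →
        ∃ e : ℝ, 0 < e ∧ ∃ k₀ : ℕ, ∀ k, k₀ ≤ k → e ≤ beta0OfJs F κ k

/-- DEF-1's ANCHOR-KEYED (D1) use form (director-ym №23∕24 (d) «THE (D1) stub») at v5's keying. A hypothesis SHAPE. [cite: Balaban1988RG2Cluster, Lemma 3 (2.38) p.20] -/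
def D1AtAnchoredJetsK : Prop :=
  ∀ (F : T4Family) (κ : StepColourData) (θ : Node00.Stage13HParams F 2) (hP : θ.Provisos₁₃SepCoPH F 2), (θ.ZhUnity F 2 ∧ θ.SlotsNondegenerate₁₃ F 2) → θ.Admissible F 2 →
    B16.EndStatementBPrinted (Node00.datumOfRecord₁₃SepCoPH F 2 θ hP).C → Window13 F θ hP →
      ScaleAnchor (Node00.datumOfRecord₁₃SepCoPH F 2 θ hP).βfun (fun k => θ.cβ * beta0OfJs F κ k) →
        ∃ A : ℝ, OneLoopDrift (B12Normalization.stepBal 2 F.L) A (beta0OfJs F κ)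

/-- Weakenings: the guard-keyed texts of 8.3 imply the v5-keyed ones (the extra binders are discarded). [folklore] -/
theorem u3TripleAtRecord13K_of_G (h : U3TripleAtRecord13G) : U3TripleAtRecord13K := fun F θ hP hU hθ _ _ => h F θ hP hU hθ

theorem anchorSomeJets13K_of (h : AnchorSomeJets13) : AnchorSomeJets13K := fun F θ hP hU hθ _ _ => h F θ hP hU hθ

theorem d1SignShadowingAnchor13K_of (h : D1SignShadowingAnchor13) : D1SignShadowingAnchor13K := fun F κ θ hP hU hθ _ _ => h F κ θ hP hU hθ

theorem d1AtAnchoredJetsK_of (h : D1AtAnchoredJets) : D1AtAnchoredJetsK := fun F κ θ hP _ hθ _ _ => h F κ θ hP hθ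

theorem remAtSomeJetsV5_of_G (h : RemAtSomeJetsG) : RemAtSomeJetsV5 := fun F θ hP hU hθ _ _ => h F θ hP hU hθ

theorem d1AtShadowingJetsV5_of_V4 (h : D1AtShadowingJetsV4) : D1AtShadowingJetsV5 := fun F κ θ hP _ hθ _ _ => h F κ θ hP hθ

/-- The anchor-keyed (D1) form implies v5's registered stub-1′ text (`RemAt` carries the anchor). [folklore] -/
theorem d1AtShadowingJetsV5_of_anchoredK (h : D1AtAnchoredJetsK) : D1AtShadowingJetsV5 := fun F κ θ hP hU hθ hB hwin hRem => by
  obtain ⟨-, -, -, -, -, -, hanch, -⟩ := hRem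
  exact h F κ θ hP hU hθ hB hwin hanch

/-- v5's LINE 1′ composition, re-proved here over the verbatim texts, concluding THE CRUX DECL BY NAME (v5 :256 concludes the crux's literal text; same proof). [folklore] -/
theorem EndpointGivenBR13SepCoPH_of_shadowingJetsV5 (h₁ : D1AtShadowingJetsV5) (h₂ : RemAtSomeJetsV5) :
    Summit.QuantumFields.YangMills.Theses.BalabanUVNodes.EndpointGivenBR13SepCoPH := by
  unfold Summit.QuantumFields.YangMills.Theses.BalabanUVNodes.EndpointGivenBR13SepCoPH
  intro F θ hP hU hθ hB hwin
  obtain ⟨κ, hRem⟩ := h₂ F θ hP hU hθ hB hwin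
  obtain ⟨A, hdrift⟩ := h₁ F κ θ hP hU hθ hB hwin hRem
  exact endpointExistence_of_remAt_drift F κ θ hP hRem hdrift

/-- (projection) v5's stub 2′ yields the identification stub. [folklore] -/
theorem anchorSomeJets13K_of_remAtSomeJetsV5 (h : RemAtSomeJetsV5) : AnchorSomeJets13K := fun F θ hP hU hθ hB hwin => by
  obtain ⟨κ, -, -, -, -, -, -, hanch, -⟩ := h F θ hP hU hθ hB hwin
  exact ⟨κ, hanch⟩

/-- **★★ (8.7a) THE WALL LOCATED AT v5's KEYING: `U3TripleAtRecord13K → AnchorSomeJets13K → RemAtSomeJetsV5`** (v5's registered stub 2′ manufactured from K3⁷'s letters + the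
identification; 8.2 pointwise). [cite: Balaban1987RG1, (1.20)-(1.22) p.264 and (2.13) p.268] -/
theorem remAtSomeJetsV5_of_u3TripleK_anchorK (h : U3TripleAtRecord13K) (hA : AnchorSomeJets13K) : RemAtSomeJetsV5 := fun F θ hP hU hθ hB hwin => by
  obtain ⟨c, -, ρ, Λ, -, hρ0, hρ1, hss, hL, -⟩ := h F θ hP hU hθ hB hwin
  obtain ⟨κ, hanch⟩ := hA F θ hP hU hθ hB hwin
  exact ⟨κ, remAt_of_letters_scaleAnchor hθ hρ0.le hρ1 hss hL hanch⟩

/-- **★★ GIVEN `U3TripleAtRecord13K`: v5's registered stub 2′ ⟺ the identification stub.** [folklore] -/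
theorem remAtSomeJetsV5_iff_anchorSomeJets13K (h : U3TripleAtRecord13K) : RemAtSomeJetsV5 ↔ AnchorSomeJets13K :=
  ⟨anchorSomeJets13K_of_remAtSomeJetsV5, remAtSomeJetsV5_of_u3TripleK_anchorK h⟩

/-- … and the RUN letter too (CRIT-1's asked swap): `U3TripleAtRecord13K → AnchorSomeJets13K → RunRemAtSomeJetsV5`. [cite: Balaban1987RG1, Thm 3 p.264 and (2.13) p.268] -/
theorem runRemAtSomeJetsV5_of_u3TripleK_anchorK (h : U3TripleAtRecord13K) (hA : AnchorSomeJets13K) : RunRemAtSomeJetsV5 := fun F θ hP hU hθ hB hwin => by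
  obtain ⟨κ, hRem⟩ := remAtSomeJetsV5_of_u3TripleK_anchorK h hA F θ hP hU hθ hB hwin
  exact ⟨κ, runRemAt_of_remAt F κ θ hP hRem⟩

/-- **★★★ (8.7b) THE THREE-STUB LINE AT v5's KEYING with v5's REGISTERED stub-1′ text as the (D1) stub, concluding THE CRUX DECL BY NAME:**
`U3TripleAtRecord13K → AnchorSomeJets13K → D1AtShadowingJetsV5 → EndpointGivenBR13SepCoPH`. CONDITIONAL on three hypothesis shapes; K2⁷ NOT closed.
[cite: Balaban1987RG1, Thm 2 p.259 (first sentence), (1.20)-(1.22) p.264 and (2.12)-(2.14) p.268] -/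
theorem EndpointGivenBR13SepCoPH_of_u3TripleK_anchorK_d1V5 (h : U3TripleAtRecord13K) (hA : AnchorSomeJets13K) (h₁ : D1AtShadowingJetsV5) :
    Summit.QuantumFields.YangMills.Theses.BalabanUVNodes.EndpointGivenBR13SepCoPH :=
  EndpointGivenBR13SepCoPH_of_shadowingJetsV5 h₁ (remAtSomeJetsV5_of_u3TripleK_anchorK h hA)

/-- **★★★ (8.7c) … with the ANCHOR-KEYED (D1) stub (director-ym №23∕24 (d)), at v5's keying, concluding THE CRUX DECL BY NAME.**
[cite: Balaban1987RG1, Thm 2 p.259 (first sentence) and (1.3) p.260] -/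
theorem EndpointGivenBR13SepCoPH_of_u3TripleK_anchorK_d1AnchoredK (h : U3TripleAtRecord13K) (hA : AnchorSomeJets13K) (hD1 : D1AtAnchoredJetsK) :
    Summit.QuantumFields.YangMills.Theses.BalabanUVNodes.EndpointGivenBR13SepCoPH :=
  EndpointGivenBR13SepCoPH_of_u3TripleK_anchorK_d1V5 h hA (d1AtShadowingJetsV5_of_anchoredK hD1)

/-- **★★★ (8.7d) CRIT-2's ASK (iii) VERBATIM AT v5's KEYING — THE CORNER ROAD, concluding THE CRUX DECL BY NAME, POINTWISE:**
`U3TripleAtRecord13K → AnchorSomeJets13K → D1SignShadowingAnchor13K → EndpointGivenBR13SepCoPH` (J2 `cornerAnchor_of_scaleAnchor` + §7 `cornerSign_of_namedAnchor` + §1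
`endpointExistence_of_cornerSign` at the tuple).  Split-free, `v₀`-free, no `OneLoopDrift`, no `ContRecord13`. CONDITIONAL on three hypothesis shapes; K2⁷ NOT closed.
[cite: Balaban1987RG1, Thm 2 p.259 (first sentence), (1.20)-(1.22) p.264 and (2.13) p.268] -/
theorem EndpointGivenBR13SepCoPH_of_u3TripleK_anchorK_signK (h : U3TripleAtRecord13K) (hA : AnchorSomeJets13K) (hs : D1SignShadowingAnchor13K) :
    Summit.QuantumFields.YangMills.Theses.BalabanUVNodes.EndpointGivenBR13SepCoPH := by
  unfold Summit.QuantumFields.YangMills.Theses.BalabanUVNodes.EndpointGivenBR13SepCoPH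
  intro F θ hP hU hθ hB hwin
  obtain ⟨c, -, ρ, Λ, -, hρ0, hρ1, hss, hL, -⟩ := h F θ hP hU hθ hB hwin
  obtain ⟨κ, hanch⟩ := hA F θ hP hU hθ hB hwin
  obtain ⟨e, he, hev⟩ := hs F κ θ hP hU hθ hB hwin hanch
  have hγ : 0 < θ.γ := hθ.toStage12.toStage9.gamma_pos
  exact endpointExistence_of_cornerSign (Node00.datumOfRecord₁₃SepCoPH F 2 θ hP).fwd hγ hρ0.le hρ1 hL hss
    (cornerSign_of_namedAnchor hθ.toStage9.chart.1 he (cornerAnchor_of_scaleAnchor hγ hanch) hev)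

/-- **(8.7e) at v5's keying, v5's registered stub-1′ text ⟹ the eventual-sign text, GIVEN `U3TripleAtRecord13K`** (8.4 pointwise: the sign stub is the WEAKER ask).
[cite: Balaban1987RG1, (1.3) p.260 and (1.20)-(1.22) p.264] -/
theorem d1SignShadowingAnchor13K_of_u3TripleK_d1V5 (h : U3TripleAtRecord13K) (h₁ : D1AtShadowingJetsV5) : D1SignShadowingAnchor13K := by
  intro F κ θ hP hU hθ hB hwin hanch
  obtain ⟨c, -, ρ, Λ, -, hρ0, hρ1, hss, hL, -⟩ := h F θ hP hU hθ hB hwin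
  obtain ⟨A, hdrift⟩ := h₁ F κ θ hP hU hθ hB hwin (remAt_of_letters_scaleAnchor hθ hρ0.le hρ1 hss hL hanch)
  have hγ : 0 < θ.γ := hθ.toStage12.toStage9.gamma_pos
  have hsb : 0 < B12Normalization.stepBal 2 (F.L : ℝ) := B12Normalization.stepBal_pos two_pos (by exact_mod_cast F.hL.2)
  exact ⟨B12Normalization.stepBal 2 (F.L : ℝ) / 2, half_pos hsb,
    eventually_ge_of_anchor_drift hγ hρ1 hss hθ.toStage9.chart.1 (cornerAnchor_of_scaleAnchor hγ hanch) hdrift hsb⟩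

/-- … and the anchor-keyed (D1) stub ⟹ the eventual-sign text at v5's keying, GIVEN `U3TripleAtRecord13K`. [folklore] -/
theorem d1SignShadowingAnchor13K_of_u3TripleK_d1AnchoredK (h : U3TripleAtRecord13K) (hD1 : D1AtAnchoredJetsK) : D1SignShadowingAnchor13K :=
  d1SignShadowingAnchor13K_of_u3TripleK_d1V5 h (d1AtShadowingJetsV5_of_anchoredK hD1)

end Edition3

/-! ## §9 (EDITION 4, GEN 5, 2026-08-28) v6's (D1) STUB LOCATED — run the dependency backwards from `stub_d1AnchoredJets13`

Plan g82's skeleton OF RECORD v6 `D82-K2V6/K2Skeleton13SepCoPHv6.lean` 5a75a2378c79b303 (REGISTERED 2026-08-28T02:32:34Z) = LINE 1′ {`stub_runRemNamedJets13 : RunRemAtSomeJets`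
(XL; = 8.7's `RunRemAtSomeJetsV5`, byte-identical), `stub_d1AnchoredJets13 : D1AtAnchoredJets` («L», dealt as «row (D1) at the named jets»; body = 8.7's `D1AtAnchoredJetsK`)}.
INVERSION, fifth pass — run stub 1 BACKWARDS: for WHICH `(F, κ, θ)` must the drift hold?  For every colour datum κ that NAMES an admissible record (anchors its β on the
window to `θ.cβ • beta0OfJs F κ`, 9.2's `Names`).  And the tree DECIDES the drift at each κ HYPOTHESIS-FREE (9.1): the named one-loop numbers `beta0OfJs F κ` CONVERGE for
EVERY colour datum (gan24-p1's rate through g1-p3's `Gaps.CapTailPinnedLimitSign.tendsto_pinned` at `Lc := F.L`, root `ctrOff`), and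
`(∃ A, OneLoopDrift (stepBal N F.L) A (beta0OfJs F κ)) ⟺ limOfJs F κ = stepBal N F.L` (`d1Drift_pinned_iff_lim_eq`; `limOfJs F κ := CauchyRate.lim (beta0OfJs F κ)` has
g1-p1's closed form, `Gaps.D1PinnedLimitClosedForm.lim_eq_closedForm_pinnedCtr`, affine in the border weight by `Gaps.D1PinnedBorderWeightAffine.lim_JsBalAn1_borderWeight_affine`).
CONSEQUENCES (kernel, 0 sorry; every text keyed on the crux's FULL prefix as v5∕v6):
* (9.2) stub 1 ⟺ `UVNamable13K` := «every colour datum naming an admissible record lies ON THE DRIFT VARIETY `{κ | limOfJs F κ = stepBal 2 F.L}`» — a statement about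
  WHICH colour data name def-T's RECORDS, not a row-(D1) statement.  Its only record-free sufficient condition is (D1) at EVERY κ (9.2b) = «the one-loop limit is
  COLOUR-BLIND at the value `stepBal 2 F.L` on all of `StepColourData`» — not decided in the tree (the blind∕generic alternative of `D1PinnedBorderWeightAffine` is open there)
  and not expected; the jets-free def-T statement that DOES discharge it is the UNIVERSAL CORNER VALUE `UniversalCornerValue13K` («on every admissible record every
  corner-anchoring sequence of the β of record tends to `θ.cβ · stepBal 2 F.L`» — edition 2's road (R-∞) in value form), and ON NAMABLE RECORDS the two are EQUIVALENT
  (9.2c∕d).  So a seat dealt stub 1 alone holds def-T content («no admissible record is named off the variety»), not the β sub-cell's (D1) row; the β sub-cell's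
  θ-free (D1)-AT-A-PIN is p593586's (R-a) shape (`EndpointGivenBR13SepCoPH_of_namedJets`, `κ : ℕ → StepColourData` chosen BEFORE θ), which 9.1 turns into ONE real-number
  identity per `L` (9.3c) — the evaluation of a closed form, a computation (`D1PinnedNumeral`∕`D1PinnedFiniteDecision`), once the pin is named.
* (9.3) by anchor uniqueness (`ScaleAnchor.eq_of_smul`, p593586; `θ.cβ ≠ 0`) v6's PAIR ⟺ ONE ∃κ statement `RunRemAtDriftingJets13K` («some colour datum ON THE DRIFT
  VARIETY names the record, run edition»), concluding the crux BY NAME through p596574 (9.3b): the κ-condition belongs INSIDE the identification's `∃ κ`, where — once the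
  identification's proof EXHIBITS its κ⋆ — it is 9.1's evaluation at κ⋆, not a stub.
* (9.4) THE END accepts ANY positive slope (`endpointExistence_of_cornerSign`): the weakest private text on the corner road is the SIGN edition `AnchorPositiveJets13K`
  («some colour datum with `0 < limOfJs F κ` names the record»): `U3TripleAtRecord13K → AnchorPositiveJets13K → crux` BY NAME (9.4a; the eventual floor `limOfJs ∕ 2` is
  supplied by the TREE, no (D1) stub, no drift, no `stepBal`); `AnchorPositiveJets13K ⟺ AnchorSomeJets13K ∧ CornerSignRecord13K` (9.4b: the sign conjunct is EXACTLY
  edition 1's one private bit, now read through the tree's hypothesis-free limit; no U3 letter needed); v6's pair ⟹ it, and given `U3TripleAtRecord13K` it ⟹ v6's XL stub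
  (9.4c∕d) — on K3⁷'s letters LINE 2″ asks the sign where LINE 1′ asks the value.
SELF-CORRECTION: editions 2∕3's `D1SignShadowingAnchor13(K)` has the SAME anchor-guarded ∀κ shape as v6's stub 1 and is likewise record-side — it is «every naming κ has
`0 < limOfJs F κ`» (9.2e); superseded by 9.4's ∃κ-internal sign conjunct.  RECOMMENDED SHAPES (count-neutral; the plan's call): LINE 1″ := ONE private stub
`RunRemAtDriftingJets13K` (XL; concluder 9.3b), or LINE 2″ := {`U3TripleAtRecord13K` (K3⁷-shared), `AnchorPositiveJets13K` (XL; concluder 9.4a)}; a separate (D1) stub is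
warranted ONLY in the pinned (R-a) keying, where it is θ-free.  HONEST: hypothesis SHAPES and kernel junctions over tree theorems BY NAME; (D1) NOT discharged at any κ;
no coefficient certified; nothing of Bałaban's asserted ([Balaban1987RG1] Thm 2 UNPROVED IN PRINT); K2⁷ NOT closed; R4 closes only the conditional finite-𝕋⁴ rung
`BalabanLadder.UV`; the Clay YM mass gap is NOT proved by any of this. -/

section Edition4

open Literature.MathematicalPhysics.QuantumFieldTheory.Balaban1983to89.B12Beta (HistBox)
open Literature.MathematicalPhysics.QuantumFieldTheory.Balaban1983to89.Beta.Drift (OneLoopDrift)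
open Literature.MathematicalPhysics.QuantumFieldTheory.Balaban1983to89.Beta.RateCertificate (CauchyRate)
open Literature.MathematicalPhysics.QuantumFieldTheory.Balaban1983to89.Beta.AveragingContoursRooted (ctrOff_mem_box)
open Summit.QuantumFields.YangMills.Theorems.BalabanUVNodesK2JsOfRecord (StepColourData beta0OfJs JsOfRecord d1Drift_JsOfRecord_iff)
open Summit.QuantumFields.YangMills.Theorems.BalabanUVNodesK2NamedJetsRemAt (RemAt ScaleAnchor endpointExistence_of_remAt_drift EndpointGivenBR13SepCoPH_of_namedJets)
open Summit.QuantumFields.YangMills.Theorems.BalabanUVNodesK2NamedJetsRunRemAt (RunRemAt runRemAt_of_remAt endpointExistence_of_runRemAt_drift)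
open Summit.QuantumFields.BalabanUV.Gaps.CapTailPinnedLimitSign (tendsto_pinned d1Drift_pinned_iff_lim_eq)

/-! ### 9.1 The tree's HYPOTHESIS-FREE limit of the named one-loop numbers of record (∀ F κ — gan24-p1's rate ∕ g1-p3's letters at `Lc := F.L`, root `ctrOff`) -/

/-- THE LIMIT OF THE NAMED ONE-LOOP NUMBERS OF RECORD, `limOfJs F κ := CauchyRate.lim (beta0OfJs F κ)` (g1-p3's limit; g1-p1's closed form `M∞` at the centred root,
`Gaps.D1PinnedLimitClosedForm`). [folklore] -/
def limOfJs (F : T4Family) (κ : StepColourData) : ℝ := CauchyRate.lim (beta0OfJs F κ)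

/-- `2 ≤ F.L` (the family's block, `F.hL.2 : 1 < F.L`). [folklore] -/
theorem two_le_L (F : T4Family) : 2 ≤ F.L := F.hL.2

/-- **`beta0OfJs F κ → limOfJs F κ` for EVERY colour datum κ — HYPOTHESIS-FREE** (g1-p3's `CapTailPinnedLimitSign.tendsto_pinned` over gan24-p1's all-scales rate, at
`Lc := F.L`, root `ctrOff (3+1) F.L`, channel `(0,1)`; `JsOfRecord`∕`JsBalAn1Ctr` unfold to the pinned literal by `rfl`). [folklore] -/
theorem tendsto_beta0OfJs (F : T4Family) (κ : StepColourData) : Tendsto (beta0OfJs F κ) atTop (𝓝 (limOfJs F κ)) := by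
  haveI : NeZero F.L := ⟨by have := F.hL.2; omega⟩
  exact tendsto_pinned (two_le_L F) (ctrOff_mem_box F.hL.2.le) κ.cE κ.cVH κ.cΛ κ.cB κ.Tc 0 1

/-- **«(D1) AT THE NAMED JETS» IS THE EVALUATION OF ONE REAL NUMBER — HYPOTHESIS-FREE, at every numeral `N`:**
`(∃ A, OneLoopDrift (stepBal N F.L) A (beta0OfJs F κ)) ⟺ limOfJs F κ = stepBal N F.L` (DEF-1's `d1Drift_JsOfRecord_iff` = `Iff.rfl` + g1-p3's `d1Drift_pinned_iff_lim_eq`).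
[folklore] -/
theorem drift_iff_limOfJs_eq (F : T4Family) (κ : StepColourData) (N : ℝ) :
    (∃ A : ℝ, OneLoopDrift (B12Normalization.stepBal N F.L) A (beta0OfJs F κ)) ↔ limOfJs F κ = B12Normalization.stepBal N F.L := by
  haveI : NeZero F.L := ⟨by have := F.hL.2; omega⟩
  exact (d1Drift_JsOfRecord_iff F κ N).symm.trans (d1Drift_pinned_iff_lim_eq (two_le_L F) (ctrOff_mem_box F.hL.2.le) κ.cE κ.cVH κ.cΛ κ.cB κ.Tc 0 1 N)

/-- … hence a POSITIVE limit gives the eventual floor `limOfJs F κ ∕ 2 ≤ beta0OfJs F κ k` (the input `hev` of §7's road (R-k), supplied by the TREE). [folklore] -/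
theorem eventuallyFloor_of_limOfJs_pos (F : T4Family) (κ : StepColourData) (h : 0 < limOfJs F κ) :
    ∃ k₀ : ℕ, ∀ k, k₀ ≤ k → limOfJs F κ / 2 ≤ beta0OfJs F κ k :=
  Filter.eventually_atTop.mp ((tendsto_beta0OfJs F κ).eventually (eventually_ge_nhds (half_lt_self h)))

/-- at a non-zero scale `cβ`: `cβ • beta0OfJs F κ → cβ · s` forces `limOfJs F κ = s` (the tree's convergence + uniqueness of limits). [folklore] -/
theorem limOfJs_eq_of_tendsto_smul {F : T4Family} {κ : StepColourData} {cβ s : ℝ} (hcβ : cβ ≠ 0)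
    (h : Tendsto (fun k => cβ * beta0OfJs F κ k) atTop (𝓝 (cβ * s))) : limOfJs F κ = s :=
  mul_left_cancel₀ hcβ (tendsto_nhds_unique ((tendsto_beta0OfJs F κ).const_mul cβ) h)

/-! ### 9.2 v6's stub 1 `D1AtAnchoredJets` (= 8.7's `D1AtAnchoredJetsK`) LOCATED: a statement about WHICH colour data NAME def-T's records -/

/-- «κ NAMES the record `(F, θ, hP)`»: the β of record is anchored, scale by scale, to the θ-covariantly named numbers `θ.cβ · beta0OfJs F κ k` (DEF-1's `ScaleAnchor`;
the anchor conjunct of `RemAt`∕`RunRemAt`, the body of `AnchorSomeJets13K`). [folklore] -/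
def Names (F : T4Family) (κ : StepColourData) (θ : Node00.Stage13HParams F 2) (hP : θ.Provisos₁₃SepCoPH F 2) : Prop :=
  ScaleAnchor (Node00.datumOfRecord₁₃SepCoPH F 2 θ hP).βfun (fun k => θ.cβ * beta0OfJs F κ k)

/-- two colour data naming the SAME admissible record have the same named numbers (`ScaleAnchor.eq_of_smul`, p593586; `θ.cβ ≠ 0` from Stage-9 admissibility) — hence the
same limit and the same drifts. [folklore] -/
theorem beta0OfJs_eq_of_names {F : T4Family} {κ κ' : StepColourData} {θ : Node00.Stage13HParams F 2} {hP : θ.Provisos₁₃SepCoPH F 2} (hθ : θ.Admissible F 2)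
    (h : Names F κ θ hP) (h' : Names F κ' θ hP) : beta0OfJs F κ = beta0OfJs F κ' :=
  ScaleAnchor.eq_of_smul (b := beta0OfJs F κ) (b' := beta0OfJs F κ') (ne_of_gt hθ.toStage9.chart.1) h h'

theorem limOfJs_eq_of_names {F : T4Family} {κ κ' : StepColourData} {θ : Node00.Stage13HParams F 2} {hP : θ.Provisos₁₃SepCoPH F 2} (hθ : θ.Admissible F 2)
    (h : Names F κ θ hP) (h' : Names F κ' θ hP) : limOfJs F κ = limOfJs F κ' := by
  unfold limOfJs
  rw [beta0OfJs_eq_of_names hθ h h']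

/-- the run letter names. [folklore] -/
theorem names_of_runRemAt {F : T4Family} {κ : StepColourData} {θ : Node00.Stage13HParams F 2} {hP : θ.Provisos₁₃SepCoPH F 2} (h : RunRemAt F κ θ hP θ.cβ) :
    Names F κ θ hP := by
  obtain ⟨-, -, -, -, -, -, hanch, -⟩ := h
  exact hanch

/-- **`UVNamable13K`** — «EVERY colour datum naming an admissible record (under the crux's prefix) lies ON THE DRIFT VARIETY `limOfJs F κ = stepBal 2 F.L`».  A statement over
def-T's records (which colour data can name them).  A hypothesis SHAPE. [cite: Balaban1987RG1, (2.13) p.268] -/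
def UVNamable13K : Prop :=
  ∀ (F : T4Family) (κ : StepColourData) (θ : Node00.Stage13HParams F 2) (hP : θ.Provisos₁₃SepCoPH F 2), (θ.ZhUnity F 2 ∧ θ.SlotsNondegenerate₁₃ F 2) → θ.Admissible F 2 →
    B16.EndStatementBPrinted (Node00.datumOfRecord₁₃SepCoPH F 2 θ hP).C → Window13 F θ hP →
      Names F κ θ hP → limOfJs F κ = B12Normalization.stepBal 2 F.L

/-- **★ (9.2a) v6's stub 1 IS `UVNamable13K`** (pointwise 9.1). [folklore] -/
theorem d1AtAnchoredJetsK_iff_uvNamable : D1AtAnchoredJetsK ↔ UVNamable13K :=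
  ⟨fun h F κ θ hP hU hθ hB hwin hN => (drift_iff_limOfJs_eq F κ 2).mp (h F κ θ hP hU hθ hB hwin hN),
    fun h F κ θ hP hU hθ hB hwin hN => (drift_iff_limOfJs_eq F κ 2).mpr (h F κ θ hP hU hθ hB hwin hN)⟩

/-- (9.2b) stub 1's only RECORD-FREE sufficient condition: (D1) at EVERY colour datum ⟺ the one-loop limit COLOUR-BLIND at the value `stepBal 2 F.L` — NOT decided in the
tree, NOT expected. [folklore] -/
theorem d1AtAnchoredJetsK_of_colourBlind (h : ∀ (F : T4Family) (κ : StepColourData), limOfJs F κ = B12Normalization.stepBal 2 F.L) : D1AtAnchoredJetsK :=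
  fun F κ _ _ _ _ _ _ _ => (drift_iff_limOfJs_eq F κ 2).mpr (h F κ)

/-- (9.2b′) «(D1) at EVERY colour datum» — the hypothesis of the v3∕v6 use forms `…_of_d1Drift_all` (v6 :369 itself: «NOT a road — (D1) is ONE quartic equation in the colour
data») — ⟺ the one-loop limit is the CONSTANT `stepBal 2 F.L` on ALL of `StepColourData` (total colour-blindness: g1-p1's one polynomial equation
`Gaps.D1PinnedColourPolynomial.d1Drift_iff_normalForm_universal` holding identically; no coefficient is certified either way in the tree).  So the β side decides (D1) on
β-DESCRIBABLE colour sets (all κ: not a road; the variety: a tautology), while stub 1 quantifies over the RECORD-defined set of naming κ's (9.2a). [folklore] -/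
theorem d1DriftAll_iff_colourBlind :
    (∀ (F : T4Family) (κ : StepColourData), ∃ A : ℝ, OneLoopDrift (B12Normalization.stepBal 2 F.L) A (beta0OfJs F κ)) ↔
      ∀ (F : T4Family) (κ : StepColourData), limOfJs F κ = B12Normalization.stepBal 2 F.L :=
  forall_congr' fun F => forall_congr' fun κ => drift_iff_limOfJs_eq F κ 2

/-- **`UniversalCornerValue13K`** — THE JETS-FREE, κ-FREE def-T STATEMENT «on every admissible record (under the crux's prefix) EVERY corner-anchoring sequence of the β
of record tends to the universal one-loop value `θ.cβ · stepBal 2 F.L`» (edition 2's road (R-∞) in value form: print's «one function β … asymptotic expansions»,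
[Balaban1987RG1] p.255, (2.13) p.268).  A hypothesis SHAPE. [cite: Balaban1987RG1, (2.13) p.268] -/
def UniversalCornerValue13K : Prop :=
  ∀ (F : T4Family) (θ : Node00.Stage13HParams F 2) (hP : θ.Provisos₁₃SepCoPH F 2), (θ.ZhUnity F 2 ∧ θ.SlotsNondegenerate₁₃ F 2) → θ.Admissible F 2 →
    B16.EndStatementBPrinted (Node00.datumOfRecord₁₃SepCoPH F 2 θ hP).C → Window13 F θ hP →
      ∀ b : ℕ → ℝ, CornerAnchor b θ.γ (Node00.datumOfRecord₁₃SepCoPH F 2 θ hP).βfun →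
        Tendsto b atTop (𝓝 (θ.cβ * B12Normalization.stepBal 2 F.L))

/-- **★ (9.2c) THE JETS-FREE UNIVERSAL CORNER VALUE DISCHARGES v6's stub 1** (J2 `cornerAnchor_of_scaleAnchor` + 9.1's convergence + uniqueness of limits). [folklore] -/
theorem d1AtAnchoredJetsK_of_universalCornerValue (h : UniversalCornerValue13K) : D1AtAnchoredJetsK := by
  intro F κ θ hP hU hθ hB hwin hN
  have hγ : 0 < θ.γ := hθ.toStage12.toStage9.gamma_pos
  exact (drift_iff_limOfJs_eq F κ 2).mpr
    (limOfJs_eq_of_tendsto_smul (ne_of_gt hθ.toStage9.chart.1) (h F θ hP hU hθ hB hwin _ (cornerAnchor_of_scaleAnchor hγ hN)))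

/-- **★ (9.2d) … and ON NAMABLE RECORDS the converse: v6's stub 1 + the identification ⟹ the universal corner value** (`cornerAnchor_unique`).  So GIVEN the identification
stub, v6's «(D1) stub» ⟺ a jets-free statement about def-T's continuum β-functional — record-side either way. [folklore] -/
theorem universalCornerValue13K_of_d1AnchoredK_anchorSomeK (h₁ : D1AtAnchoredJetsK) (hA : AnchorSomeJets13K) : UniversalCornerValue13K := by
  intro F θ hP hU hθ hB hwin b hb
  have hγ : 0 < θ.γ := hθ.toStage12.toStage9.gamma_pos
  obtain ⟨κ, hN⟩ := hA F θ hP hU hθ hB hwin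
  have hlim : limOfJs F κ = B12Normalization.stepBal 2 F.L := (drift_iff_limOfJs_eq F κ 2).mp (h₁ F κ θ hP hU hθ hB hwin hN)
  have hbb : b = fun k => θ.cβ * beta0OfJs F κ k := cornerAnchor_unique hb (cornerAnchor_of_scaleAnchor hγ hN)
  rw [hbb, ← hlim]
  exact (tendsto_beta0OfJs F κ).const_mul θ.cβ

/-- editions 2∕3's eventual-sign text LOCATED the same way: «every colour datum naming an admissible record has POSITIVE one-loop limit». A hypothesis SHAPE.
[cite: Balaban1987RG1, (1.3) p.260] -/
def PositivelyNamable13K : Prop :=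
  ∀ (F : T4Family) (κ : StepColourData) (θ : Node00.Stage13HParams F 2) (hP : θ.Provisos₁₃SepCoPH F 2), (θ.ZhUnity F 2 ∧ θ.SlotsNondegenerate₁₃ F 2) → θ.Admissible F 2 →
    B16.EndStatementBPrinted (Node00.datumOfRecord₁₃SepCoPH F 2 θ hP).C → Window13 F θ hP →
      Names F κ θ hP → 0 < limOfJs F κ

/-- **(9.2e) SELF-CORRECTION: `D1SignShadowingAnchor13K ⟺ PositivelyNamable13K`** — the same anchor-guarded ∀κ shape as v6's stub 1, hence record-side too. [folklore] -/
theorem d1SignShadowingAnchor13K_iff_positivelyNamable : D1SignShadowingAnchor13K ↔ PositivelyNamable13K := by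
  constructor
  · intro h F κ θ hP hU hθ hB hwin hN
    obtain ⟨e, he, k₀, hk₀⟩ := h F κ θ hP hU hθ hB hwin hN
    exact lt_of_lt_of_le he (ge_of_tendsto (tendsto_beta0OfJs F κ) (Filter.eventually_atTop.mpr ⟨k₀, hk₀⟩))
  · intro h F κ θ hP hU hθ hB hwin hN
    have hl : 0 < limOfJs F κ := h F κ θ hP hU hθ hB hwin hN
    exact ⟨limOfJs F κ / 2, half_pos hl, eventuallyFloor_of_limOfJs_pos F κ hl⟩

/-- (9.2f) value ⟹ sign: `UVNamable13K → PositivelyNamable13K` (`0 < stepBal 2 F.L`). [folklore] -/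
theorem positivelyNamable_of_uvNamable (h : UVNamable13K) : PositivelyNamable13K := by
  intro F κ θ hP hU hθ hB hwin hN
  rw [h F κ θ hP hU hθ hB hwin hN]
  exact B12Normalization.stepBal_pos two_pos (by exact_mod_cast F.hL.2)

/-! ### 9.3 v6's PAIR ⟺ ONE ∃κ STATEMENT — the κ-condition INSIDE the identification -/

/-- **`RunRemAtDriftingJets13K`** — «some colour datum ON THE DRIFT VARIETY names the record, run edition»: v6's two stubs merged into ONE ∃κ statement (its (D1) clause is
9.1's evaluation `limOfJs F κ = stepBal 2 F.L` at the exhibited κ).  A hypothesis SHAPE. [cite: Balaban1987RG1, Thm 3 p.264 and (2.13) p.268] -/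
def RunRemAtDriftingJets13K : Prop :=
  ∀ (F : T4Family) (θ : Node00.Stage13HParams F 2) (hP : θ.Provisos₁₃SepCoPH F 2), (θ.ZhUnity F 2 ∧ θ.SlotsNondegenerate₁₃ F 2) → θ.Admissible F 2 →
    B16.EndStatementBPrinted (Node00.datumOfRecord₁₃SepCoPH F 2 θ hP).C → Window13 F θ hP →
      ∃ κ : StepColourData, limOfJs F κ = B12Normalization.stepBal 2 F.L ∧ RunRemAt F κ θ hP θ.cβ

/-- **★ (9.3a) v6's PAIR ⟺ THE ONE MERGED STATEMENT** (→: the drift at the run letter's own κ; ←: a naming κ′ has the same numbers as the drifting κ, 9.2). [folklore] -/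
theorem v6Pair_iff_runRemAtDriftingJets : (D1AtAnchoredJetsK ∧ RunRemAtSomeJetsV5) ↔ RunRemAtDriftingJets13K := by
  constructor
  · rintro ⟨h₁, h₂⟩ F θ hP hU hθ hB hwin
    obtain ⟨κ, hRun⟩ := h₂ F θ hP hU hθ hB hwin
    exact ⟨κ, (drift_iff_limOfJs_eq F κ 2).mp (h₁ F κ θ hP hU hθ hB hwin (names_of_runRemAt hRun)), hRun⟩
  · intro h
    refine ⟨fun F κ' θ hP hU hθ hB hwin hN => ?_, fun F θ hP hU hθ hB hwin => ?_⟩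
    · obtain ⟨κ, hlim, hRun⟩ := h F θ hP hU hθ hB hwin
      refine (drift_iff_limOfJs_eq F κ' 2).mpr ?_
      rw [limOfJs_eq_of_names hθ hN (names_of_runRemAt hRun)]
      exact hlim
    · obtain ⟨κ, -, hRun⟩ := h F θ hP hU hθ hB hwin
      exact ⟨κ, hRun⟩

/-- **★★ (9.3b) LINE 1″ — ONE PRIVATE STUB — concluding THE CRUX DECL BY NAME: `RunRemAtDriftingJets13K → EndpointGivenBR13SepCoPH`** (9.1 + p596574's consumer
`endpointExistence_of_runRemAt_drift`).  CONDITIONAL on one hypothesis shape; K2⁷ NOT closed. [cite: Balaban1987RG1, Thm 2 p.259 (first sentence), Thm 3 p.264 and (2.12)-(2.14) p.268] -/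
theorem EndpointGivenBR13SepCoPH_of_runRemAtDriftingJets (h : RunRemAtDriftingJets13K) :
    Summit.QuantumFields.YangMills.Theses.BalabanUVNodes.EndpointGivenBR13SepCoPH := by
  unfold Summit.QuantumFields.YangMills.Theses.BalabanUVNodes.EndpointGivenBR13SepCoPH
  intro F θ hP hU hθ hB hwin
  obtain ⟨κ, hlim, hRun⟩ := h F θ hP hU hθ hB hwin
  obtain ⟨A, hdrift⟩ := (drift_iff_limOfJs_eq F κ 2).mpr hlim
  exact endpointExistence_of_runRemAt_drift F κ θ hP hRun hdrift

/-- **(9.3c) THE PINNED KEYING IS WHERE A θ-FREE (D1) STUB LIVES**: p593586's (R-a) two-stub shape (`EndpointGivenBR13SepCoPH_of_namedJets`, pin `κ : ℕ → StepColourData` chosen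
BEFORE θ) has the θ-free (D1) stub `∀ F, ∃ A, OneLoopDrift (stepBal 2 F.L) A (beta0OfJs F (κ F.L))`, which 9.1 turns into ONE REAL-NUMBER IDENTITY PER FAMILY — the evaluation
of g1-p1's closed form at the pin. [folklore] -/
theorem pinnedD1_iff_limOfJs_eq (κ : ℕ → StepColourData) :
    (∀ F : T4Family, ∃ A : ℝ, OneLoopDrift (B12Normalization.stepBal 2 F.L) A (beta0OfJs F (κ F.L))) ↔
      ∀ F : T4Family, limOfJs F (κ F.L) = B12Normalization.stepBal 2 F.L :=
  forall_congr' fun F => drift_iff_limOfJs_eq F (κ F.L) 2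

/-- (9.3d) THE PINNED KEYING IS A SPECIAL CASE OF LINE 1″: a pin `κ⋆ : ℕ → StepColourData` ON THE DRIFT VARIETY of every family (θ-free — 9.3c's one identity per `L`)
+ the run letter AT THE PIN under the crux's prefix ⟹ `RunRemAtDriftingJets13K`.  (The pin must be NAMED in the skeleton — the β-lead's (P6) «colour constants pinned LAST»
decision; nothing here says which κ⋆ is print's.) [folklore] -/
theorem runRemAtDriftingJets_of_pin (κ : ℕ → StepColourData) (hD1 : ∀ F : T4Family, limOfJs F (κ F.L) = B12Normalization.stepBal 2 F.L)
    (hRun : ∀ (F : T4Family) (θ : Node00.Stage13HParams F 2) (hP : θ.Provisos₁₃SepCoPH F 2), (θ.ZhUnity F 2 ∧ θ.SlotsNondegenerate₁₃ F 2) → θ.Admissible F 2 →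
      B16.EndStatementBPrinted (Node00.datumOfRecord₁₃SepCoPH F 2 θ hP).C → Window13 F θ hP → RunRemAt F (κ F.L) θ hP θ.cβ) :
    RunRemAtDriftingJets13K := fun F θ hP hU hθ hB hwin => ⟨κ F.L, hD1 F, hRun F θ hP hU hθ hB hwin⟩

/-- (9.3e) … and in the pinned keying v6's stub 1 FOLLOWS from the pin's two θ-free∕record statements: if a pin on the drift variety NAMES every admissible record, every
naming κ′ has the pin's numbers (9.2), hence lies on the variety — `UVNamable13K`, i.e. v6's stub 1 (9.2a).  So v6's «(D1) stub» is discharged by {pinned (D1), pinned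
identification} — the second is record content again. [folklore] -/
theorem uvNamable_of_pin (κ : ℕ → StepColourData) (hD1 : ∀ F : T4Family, limOfJs F (κ F.L) = B12Normalization.stepBal 2 F.L)
    (hN : ∀ (F : T4Family) (θ : Node00.Stage13HParams F 2) (hP : θ.Provisos₁₃SepCoPH F 2), (θ.ZhUnity F 2 ∧ θ.SlotsNondegenerate₁₃ F 2) → θ.Admissible F 2 →
      B16.EndStatementBPrinted (Node00.datumOfRecord₁₃SepCoPH F 2 θ hP).C → Window13 F θ hP → Names F (κ F.L) θ hP) :
    UVNamable13K := fun F κ' θ hP hU hθ hB hwin hN' => by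
  rw [limOfJs_eq_of_names hθ hN' (hN F θ hP hU hθ hB hwin)]
  exact hD1 F

theorem d1AtAnchoredJetsK_of_pin (κ : ℕ → StepColourData) (hD1 : ∀ F : T4Family, limOfJs F (κ F.L) = B12Normalization.stepBal 2 F.L)
    (hN : ∀ (F : T4Family) (θ : Node00.Stage13HParams F 2) (hP : θ.Provisos₁₃SepCoPH F 2), (θ.ZhUnity F 2 ∧ θ.SlotsNondegenerate₁₃ F 2) → θ.Admissible F 2 →
      B16.EndStatementBPrinted (Node00.datumOfRecord₁₃SepCoPH F 2 θ hP).C → Window13 F θ hP → Names F (κ F.L) θ hP) :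
    D1AtAnchoredJetsK := d1AtAnchoredJetsK_iff_uvNamable.mpr (uvNamable_of_pin κ hD1 hN)

/-! ### 9.4 THE END ACCEPTS ANY POSITIVE SLOPE: the weakest private text on the corner road is the SIGN edition -/

/-- **`AnchorPositiveJets13K`** — «some colour datum with POSITIVE one-loop limit names the record»: the identification landing in the positive cone of the closed form
(∃κ after θ, `θ.cβ` carried — immune to `Negative/RemNamedJets13FalseOfTwoNormalisations` and `…/Anchor13FalseOfTwoBaseHistories` exactly as `AnchorSomeJets13K`;
BN-F NOT HIT: per-k anchor, no box-wide ∀k letter).  A hypothesis SHAPE. [cite: Balaban1987RG1, (1.3) p.260 and (2.13) p.268] -/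
def AnchorPositiveJets13K : Prop :=
  ∀ (F : T4Family) (θ : Node00.Stage13HParams F 2) (hP : θ.Provisos₁₃SepCoPH F 2), (θ.ZhUnity F 2 ∧ θ.SlotsNondegenerate₁₃ F 2) → θ.Admissible F 2 →
    B16.EndStatementBPrinted (Node00.datumOfRecord₁₃SepCoPH F 2 θ hP).C → Window13 F θ hP →
      ∃ κ : StepColourData, 0 < limOfJs F κ ∧ Names F κ θ hP

/-- edition 1's sign text at v5∕v6's keying (§4's `CornerSignRecord13G` with (B) and the window threaded). A hypothesis SHAPE. [cite: Balaban1987RG1, (1.3) p.260] -/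
def CornerSignRecord13K : Prop :=
  ∀ (F : T4Family) (θ : Node00.Stage13HParams F 2) (hP : θ.Provisos₁₃SepCoPH F 2), (θ.ZhUnity F 2 ∧ θ.SlotsNondegenerate₁₃ F 2) → θ.Admissible F 2 →
    B16.EndStatementBPrinted (Node00.datumOfRecord₁₃SepCoPH F 2 θ hP).C → Window13 F θ hP →
      ∀ b : ℕ → ℝ, CornerAnchor b θ.γ (Node00.datumOfRecord₁₃SepCoPH F 2 θ hP).βfun → ∀ binf : ℝ, Tendsto b atTop (𝓝 binf) → 0 < binf

/-- **★★ (9.4a) LINE 2″ — THE CORNER ROAD WITH TWO STUBS — concluding THE CRUX DECL BY NAME: `U3TripleAtRecord13K → AnchorPositiveJets13K → EndpointGivenBR13SepCoPH`**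
(8.7d with road (R-k)'s eventual floor `limOfJs F κ ∕ 2` supplied by the TREE (9.1): no (D1) stub, no `OneLoopDrift`, no `stepBal`, split-free, `v₀`-free).  CONDITIONAL on
two hypothesis shapes; K2⁷ NOT closed. [cite: Balaban1987RG1, Thm 2 p.259 (first sentence), (1.20)-(1.22) p.264 and (2.13) p.268] -/
theorem EndpointGivenBR13SepCoPH_of_u3TripleK_anchorPositiveK (h : U3TripleAtRecord13K) (hA : AnchorPositiveJets13K) :
    Summit.QuantumFields.YangMills.Theses.BalabanUVNodes.EndpointGivenBR13SepCoPH := by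
  unfold Summit.QuantumFields.YangMills.Theses.BalabanUVNodes.EndpointGivenBR13SepCoPH
  intro F θ hP hU hθ hB hwin
  obtain ⟨c, -, ρ, Λ, -, hρ0, hρ1, hss, hL, -⟩ := h F θ hP hU hθ hB hwin
  obtain ⟨κ, hpos, hN⟩ := hA F θ hP hU hθ hB hwin
  have hγ : 0 < θ.γ := hθ.toStage12.toStage9.gamma_pos
  exact endpointExistence_of_cornerSign (Node00.datumOfRecord₁₃SepCoPH F 2 θ hP).fwd hγ hρ0.le hρ1 hL hss
    (cornerSign_of_namedAnchor hθ.toStage9.chart.1 (half_pos hpos) (cornerAnchor_of_scaleAnchor hγ hN) (eventuallyFloor_of_limOfJs_pos F κ hpos))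

/-- **★ (9.4b) `AnchorPositiveJets13K ⟺ AnchorSomeJets13K ∧ CornerSignRecord13K`** — the sign edition's extra conjunct is EXACTLY edition 1's one private bit (uniqueness of
corner limits + the tree's convergence; no U3 letter needed). [folklore] -/
theorem anchorPositiveJets13K_iff : AnchorPositiveJets13K ↔ (AnchorSomeJets13K ∧ CornerSignRecord13K) := by
  constructor
  · intro h
    refine ⟨fun F θ hP hU hθ hB hwin => ?_, fun F θ hP hU hθ hB hwin b hb binf hlim => ?_⟩
    · obtain ⟨κ, -, hN⟩ := h F θ hP hU hθ hB hwin
      exact ⟨κ, hN⟩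
    · obtain ⟨κ, hpos, hN⟩ := h F θ hP hU hθ hB hwin
      have hγ : 0 < θ.γ := hθ.toStage12.toStage9.gamma_pos
      have hbb : b = fun k => θ.cβ * beta0OfJs F κ k := cornerAnchor_unique hb (cornerAnchor_of_scaleAnchor hγ hN)
      have hlim' : Tendsto b atTop (𝓝 (θ.cβ * limOfJs F κ)) := by
        rw [hbb]
        exact (tendsto_beta0OfJs F κ).const_mul θ.cβ
      rw [tendsto_nhds_unique hlim hlim']
      exact mul_pos hθ.toStage9.chart.1 hpos
  · rintro ⟨hA, hs⟩ F θ hP hU hθ hB hwin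
    obtain ⟨κ, hN⟩ := hA F θ hP hU hθ hB hwin
    have hγ : 0 < θ.γ := hθ.toStage12.toStage9.gamma_pos
    have hpos : 0 < θ.cβ * limOfJs F κ :=
      hs F θ hP hU hθ hB hwin _ (cornerAnchor_of_scaleAnchor hγ hN) _ ((tendsto_beta0OfJs F κ).const_mul θ.cβ)
    exact ⟨κ, (mul_pos_iff_of_pos_left hθ.toStage9.chart.1).mp hpos, hN⟩

/-- (9.4c) v6's pair ⟹ the sign edition (value ⟹ sign, `0 < stepBal 2 F.L`); so does the merged LINE 1″ text. [folklore] -/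
theorem anchorPositiveJets13K_of_runRemAtDriftingJets (h : RunRemAtDriftingJets13K) : AnchorPositiveJets13K := by
  intro F θ hP hU hθ hB hwin
  obtain ⟨κ, hlim, hRun⟩ := h F θ hP hU hθ hB hwin
  refine ⟨κ, ?_, names_of_runRemAt hRun⟩
  rw [hlim]
  exact B12Normalization.stepBal_pos two_pos (by exact_mod_cast F.hL.2)

theorem anchorPositiveJets13K_of_v6Pair (h₁ : D1AtAnchoredJetsK) (h₂ : RunRemAtSomeJetsV5) : AnchorPositiveJets13K :=
  anchorPositiveJets13K_of_runRemAtDriftingJets (v6Pair_iff_runRemAtDriftingJets.mp ⟨h₁, h₂⟩)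

/-- (9.4d) … and GIVEN `U3TripleAtRecord13K` the sign edition ⟹ v6's XL stub (8.7a∕8.2: K3⁷'s letters + the identification manufacture the run letter) — on K3⁷'s letters
LINE 2″ asks the SIGN of the limit where LINE 1′ asks its VALUE. [cite: Balaban1987RG1, Thm 3 p.264, (1.20)-(1.22) p.264 and (2.13) p.268] -/
theorem runRemAtSomeJetsV5_of_u3TripleK_anchorPositiveK (h : U3TripleAtRecord13K) (hA : AnchorPositiveJets13K) : RunRemAtSomeJetsV5 :=
  runRemAtSomeJetsV5_of_u3TripleK_anchorK h (anchorPositiveJets13K_iff.mp hA).1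

/-- (9.4e) SUMMARY OF THE ORDER on the crux's prefix (kernel): `RunRemAtDriftingJets13K (= v6's pair) ⟹ AnchorPositiveJets13K ⟹ AnchorSomeJets13K`, and given
`U3TripleAtRecord13K`: `AnchorPositiveJets13K ⟹ RunRemAtSomeJetsV5` while `AnchorSomeJets13K ∧ UVNamable13K ⟹ RunRemAtDriftingJets13K`. [folklore] -/
theorem runRemAtDriftingJets_of_u3TripleK_anchorSomeK_uvNamable (h : U3TripleAtRecord13K) (hA : AnchorSomeJets13K) (hV : UVNamable13K) : RunRemAtDriftingJets13K :=
  v6Pair_iff_runRemAtDriftingJets.mp ⟨d1AtAnchoredJetsK_iff_uvNamable.mpr hV, runRemAtSomeJetsV5_of_u3TripleK_anchorK h hA⟩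

end Edition4


end Summit.QuantumFields.YangMills.Cruxes.EndpointGivenBR13SepCoPH.CornerLimitSign

end
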